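import Mathlib
import HarnessLib
import HarnessLib.Audit
import Summits.FinalStateConjecture.Statement
import Literature.Geometry.Lorentzian.TrappedSurface
import Literature.Geometry.Lorentzian.EventHorizon
import Literature.Geometry.Lorentzian.CutBondiMass
import Literature.Geometry.Lorentzian.WeightedNorms
import HarnessLib.Audit.Status.Attr

/-!
Route: RootDecompSobolevLedgerCells

# Route RootDecompSobolevLedgerCells — Root decomposition N2g «SobolevLedgerCells» (form b″-ter) —
FarLedgerCells leaves by signature; the rough-tail leaf 29291 cut by the CHRUŚCIEL–BIERI
infinite-boost weighted-Sobolev tail class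

DECOMPOSITION CELL decomp-fsc (D-0178; doctrine D-0170/0171/0172), summit S =
`_root_.FinalStateConjecture` exactly as typed; LADDER rung 0 — NOTHING IN THIS FILE PROVES THE
FINAL STATE CONJECTURE. THIN SIBLING in FILING FORM (b″)-ter = critic FORM RULING R2 (α)
2026-08-30T06:51:06Z (CRITIC-LEDGER row 73): the thirteen top-level leaves of
route-FinalStateConjecture-RootDecompFarLedgerCells with the cut leaf NoChargeExit 28426 REPLACED by
its two born split children FarAccountDoor 29290 and RoughTailExit 29291 — fourteen items BY
SIGNATURE + Assembly — so that the layer-1 child RoughTailExit sits at top level and can receive the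
lens-5 g7 cut «SobolevLedgerCells» as a glued split (gate max_depth 1 forbids splitting it where it
was born). It suffices to show the conjunction X of the fourteen leaves; `closes` is route #17's
certified closes₁₃ with the hypothesis hN : NoChargeExit DERIVED INLINE from FarAccountDoor and
RoughTailExit by the proved split glue 29292 (one excluded middle on the Klainerman–Nicolò tail
predicate KN d; kernel noChargeExitGlue_holds, critic certificate SplitFLCheck glue_holds). Every
leaf is S-implied (free exact population split), so X ⟺ S; the content is the LOCALISATION of the
summit's unknown far-field regularity into one typed residual.
Lean: `RoughTailExit ∧ SubextremalChargeExit ∧ HeavyChargeExit ∧ LightChargeExit ∧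
InfiniteHoleCaptureExit ∧ FarAccountDoor ∧ HeavyChargeDoor ∧ MultiHoleCaptureExit ∧ TrappedNakedExit
∧ CascadeSingleExit ∧ TrappedExtremalExit ∧ ExtremalThresholdExit ∧ DispersiveExit ∧
NakedThresholdExit`

## Assembly
Pure logic inside `closes` (folder/sl/glue.lean, certified native): route #17's closes₁₃ body
verbatim with the single use of hN : NoChargeExit replaced by `(Classical.em (KN d)).elim (door …)
(rough …)` — i.e. NoChargeExit ⟸ FarAccountDoor ∧ RoughTailExit by the proved glue item 29292 — then
BoundedSingleExit from the charge cells by four nested excluded middles, RegularSingleExit /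
SingleHoleCaptureExit / AllTrapCaptureExit / TrappedDataExit / QuietWild by the certified glue chain
of routes #14 / #11 / #6 / #3, and S from the causal cells (route #3 closes). The optional Assembly
item records the fourteen-fold implication.

Rationale: WHY THIS LINE. The no-honest-Bondi-account residual of the summit was localised by gen 6
(FarLedgerCells) to tails strictly below the Klainerman–Nicolò class; gen 7 imports the ONLY OTHER
printed large-data exterior theorem with future-complete null hypersurfaces — Chruściel's
infinite-boost theorem (arXiv:1612.04523 = CQG 34 (2017) 145016, Thm 3.1: vacuum data, compact ∪ one
end, g − δ ∈ H⁴ weighted-Sobolev with α ∈ (1/2,1), parity condition with α₋ > 1/2, timelike ADM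
four-momentum ⟹ a retarded-time foliation by future-complete outgoing null hypersurfaces N(u) of a
neighbourhood of 𝓘⁺ inside the MGHD, NO maximality hypothesis, NO smallness) together with the
Trautman–Bondi mass ledger along N(u) sketched by Bieri–Chruściel (arXiv:1612.04359 §§4–5) — typed
verbatim over the tree's gr.S15 `weightedSobolevSeminorm` (dictionary δ = α − 3/2, WeightedNorms
docstring) as the transversal predicate ST d on the far-field tail. The cut absorbs gen 6's strata
r1 (non-maximal K–N data) and r2a (Hintz polyhomogeneous class) into a THIN door emptied by porting
(S1 InfiniteBoostLedger = new request D14; S3⁰ ADMLedger = D10 re-pointed, one ADM port for both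
doors; S2 ChargeCoherence = wi-96536 whose transport brick B0 is proved by lens-4 g8) and leaves ONE
counting residual SubSobolevTailExit = admissible o₂(r⁻¹)/o₁(r⁻²) tails whose third/fourth
derivatives are not weighted-L² in any chart — the derivative-poor Dafermos–Rodnianski tails, below
every printed exterior theory with null completeness (Bieri ℓ = 3 small data, Chruściel ℓ ≥ 4 large
data, K–N o₄/o₃, Hintz conormal). Imported: weighted-Sobolev large-data exterior theory + ADM/TB
ledgers; nothing perturbative-about-Kerr.

RANKED CRUXES. #2 RoughTailExit (crux) — = the BORN item stmt-FinalStateConjecture-29291 of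
route-FinalStateConjecture-RootDecompFarLedgerCells (node N2f; born there as layer-1 split child Rₙ
of NoChargeExit 28426, split #18; home tag NEW RESIDUAL of N · COUNTS · UNDECIDED, stratified),
reused BY SIGNATURE (dedup-attach); EXPOSED AT TOP LEVEL HERE to receive, right after birth, the
critic-CLEARED (2026-08-30T06:51:06Z, FORM RULING R2 (α), CRITIC-LEDGER row 73) lens-5 g7 cut
«SobolevLedgerCells» as its glued split: SobolevAccountDoor D₇ (tail in the Chruściel–Bieri
infinite-boost weighted-Sobolev class ST, no honest Bondi account; THIN · EMPTY GIVEN SUPPORTS S1 ∧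
S3⁰ ∧ S2, kernel sobolevAccountDoor_of_ledgers) and SubSobolevTailExit R₇ (tail outside ST: NEW
RESIDUAL, COUNTS, replaces this item in the census), glue SobolevAccountDoor → SubSobolevTailExit →
RoughTailExit (kernel rough_of_cells, one excluded middle on ST d; exactness roughTailExit_iff_cells
BY NAME). T6: LAST by-signature host on the N-lineage. Text as born: Same population as NoChargeExit
AND ¬KN d (the Cauchy datum is non-maximal, or its sole end is rougher / slower than the K–N weights
(3/2+η, 5/2+η, 4, 3) for every η > 0): exit tamely with codimension ≥ 1. Strata (lens-5 NODE-g6 §3,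
NOT items — caution c4): r1 non-maximal gauge = ATTACKABLE only … (full text as born on the home
route) [difficulty: open-problem] (why it might fail: Admissible o₂(r⁻¹)/o₁(r⁻²) tails below
Klainerman–Nicolò regularity (e.g. r^{-3-ε} sin r ripples) have no printed exterior theory with
Hawking-mass limits (Hintz arXiv:2302.13804 Rem 3.38: Bondi mass unproved); a censored development
with NO convergent round family refutes it and S as typed.) [arXiv:2302.13804 Thm 1.1, Rem 3.38,
arXiv:2405.00735, arXiv:2303.12758, arXiv:2606.08716, KlainermanNicolo2003 fn 49]
#3 SubextremalChargeExit (crux) — = the BORN item stmt-FinalStateConjecture-28422 of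
route-FinalStateConjecture-RootDecompFinalChargeCells (layer-2 child K of 27603; home tag NEW
RESIDUAL · PARKED), reused BY SIGNATURE (dedup-attach); text as born: [crux · NEW RESIDUAL · PARKED
residual · internal node K of lens-5 g5 «FinalChargeCells» on stmt-27603] Admissible non-generic
data outside … (full text as born on the home route) [difficulty: open-problem] (why it might fail:
Kerr-compatible books (8πM_f² < A_f ≤ 16πM_f²) do not force convergence: no theorem excludes an
eternally non-settling censored exterior whose monotone limits sit on a Kerr curve; the χ̄-margin
stability theorems consume slice-norm closeness that monotone limits never supply (caution c4).)
[arXiv:2104.11857, arXiv:2606.28253, arXiv:2605.18730, arXiv:2205.14808,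
doi:10.1111/j.1749-6632.1973.tb41447.x]
#4 HeavyChargeExit (crux) — = the BORN item stmt-FinalStateConjecture-28424 of
route-FinalStateConjecture-RootDecompFinalChargeCells (layer-2 child L of 27603; home tag
SPECIAL-TYPE, vacuum third law), reused BY SIGNATURE (dedup-attach); text as born: [crux ·
SPECIAL-TYPE · leaf L of lens-5 g5 on stmt-27603] Same population with Acc ∧ ¬KerrB ∧ HeavyB ∧ ¬Hor:
the books are at or below the … (full text as born on the home route) [difficulty: open-problem]
(why it might fail: Extremal horizons DO form dynamically in finite time for
Einstein–Maxwell–charged matter (Kehle–Unger); a vacuum analogue A_f = 8πM_f², or an eternal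
non-radiating exterior reservoir giving A_f < 8πM_f², is excluded by no theorem (no-periodic results
need analyticity/stationarity near 𝓘).) [arXiv:2211.15742, arXiv:2402.10190, arXiv:1504.04592,
arXiv:1008.0248]
#5 LightChargeExit (crux) — = the BORN item stmt-FinalStateConjecture-28425 of
route-FinalStateConjecture-RootDecompFinalChargeCells (layer-2 child H of 27603; home tag
IDEA-NEEDED, limiting-Bondi-mass Penrose inequality), reused BY SIGNATURE (dedup-attach); text as
born: [crux · IDEA-NEEDED · leaf H of lens-5 g5 on stmt-27603] Same population with Acc ∧ AreaF >
16π·MassF² (the books ABOVE the Schwarzschild … (full text as born on the home route) [difficulty: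
open-problem] (why it might fail: M_f ≥ √(A_f/16π) for the LIMITING Bondi mass is Penrose's stronger
spacetime statement, proved only near Schwarzschild (Alexakis; Le) or under a quasi-final-state
hypothesis (2026); a censored development whose horizon area outgrows 16πM_f² contradicts no
theorem.) [arXiv:1506.06400, arXiv:2605.18730, arXiv:1609.02875, arXiv:2404.17137, arXiv:2505.11399]
#6 InfiniteHoleCaptureExit (crux) — = the BORN item stmt-FinalStateConjecture-26647 of
route-FinalStateConjecture-RootDecompTrappedBasinCells (node N2b; THIN BRIDGE ⟸ FiniteCensus
stmt-13847), reused BY SIGNATURE (dedup-attach); text as born: = the BORN gen-1 child of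
TrappedCaptureExit (stmt-25597) on route-FinalStateConjecture-RootDecompTrappedBasinCells, reused BY
SIGNATURE; … (full text as born on the home route) [difficulty: open-problem] (why it might fail:
Late-time tails refocusing through an already formed hole's strong field (caustics near photon
spheres) could keep forming ever smaller holes at ever later times on a tame-open set; no statement
either way is in print (arXiv:2210.13960 p.6).) [arXiv:0805.3880, arXiv:1409.6270,
Christodoulou1999, arXiv:0811.0354, arXiv:2210.13960, HawkingEllis1973]
#9 FarAccountDoor (support) — = the BORN item stmt-FinalStateConjecture-29290 of
route-FinalStateConjecture-RootDecompFarLedgerCells (layer-1 split door Dₙ of 28426, split #18; home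
tag THIN · EMPTY GIVEN SUPPORTS S1 ExteriorBondiLedger = D9 wi-97120 ∧ S3 ADM ledger = D10 wi-97121
∧ S2 ChargeCoherence = wi-96536 · does NOT count; local kind support), reused BY SIGNATURE
(dedup-attach); text as born: Same population as NoChargeExit (censored single-hole data,
admissible, not dispersive, every MGHD traps, complete 𝓘⁺, weak C⁰-Kerr capture fails, at most one
final hole, bounded future census, ¬Acc d: no honest Bondi account) AND the datum's TAIL lies in the
Klainerman–Nicolò class KN d := … (full text as born on the home route) [difficulty: open-problem]
(why it might fail: Empty only modulo S1∧S3∧S2: should the identification of the Klainerman–Nicolò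
exterior cones with ∂J⁺(K) inside an arbitrary MGHD fail (causal bridge) the door would carry
content; else none — K–N is printed for all data sizes.) [KlainermanNicolo2003 Thm 3.7.1, Thm 8.5.2,
Thm 8.5.3, Bartnik1986 Thm 4.2, ChoquetBruhatGeroch1969]
#9 HeavyChargeDoor (support) — = the BORN item stmt-FinalStateConjecture-28423 of
route-FinalStateConjecture-RootDecompFinalChargeCells (layer-2 door Dr of 27603; home tag THIN ·
EMPTY BY BRIDGE HorizonAreaBridge = D5 wi-96862; crux by gate auto-crux on
RootDecompFarLedgerCells), reused BY SIGNATURE (dedup-attach); text as born: [support · THIN · EMPTY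
BY BRIDGE · door Dr of lens-5 g5 on stmt-27603] Same population with Acc ∧ ¬KerrB ∧ HeavyB (AreaF ≤
8π·MassF²) ∧ … (full text as born on the home route) [difficulty: open-problem] (why it might fail:
Empty only modulo HorizonAreaBridge: should the outermost trapped region of some censored MGHD be
visible from 𝓘⁺ in the sojourn formalism (HE 9.2.8 / Wald 12.2.4 porting fails without future causal
simplicity) or A_min exceed the Lipschitz horizon-cut area, heavy books could coexist with Hor.)
[HawkingEllis1973 §9.2, Wald1984 §12.2, arXiv:2605.18730 p.3, ChruscielEtAl2001 §3-4,
decomp-fsc-lens-5/g5/FinalChargeCells.lean:heavyChargeDoor_of_bridge,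
stmt-FinalStateConjecture-26560]
#9 MultiHoleCaptureExit (support) — = the BORN item stmt-FinalStateConjecture-26646 of
route-FinalStateConjecture-RootDecompTrappedBasinCells (node N2b; home kind crux; split #16 on
RootDecompHoleCountCells; local kind support = staffed at home), reused BY SIGNATURE (dedup-attach);
text as born: = the BORN gen-1 child of TrappedCaptureExit (stmt-25597) on
route-FinalStateConjecture-RootDecompTrappedBasinCells, reused BY SIGNATURE; … (full text as born on
the home route) [difficulty: open-problem] (why it might fail: A tame-open set of admissible data
whose MGHD keeps two holes on an eternal quasi-periodic censored orbit (a vacuum 'floating' binary),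
or n ≥ 3 co-axial multi-Kerr(–NUT) equilibria that exist AND are attained from an open set, would
refute it; n ≥ 3 non-existence is open (CCH12 p.14).) [doi:10.1007/BF00770326, arXiv:0905.4179,
arXiv:1103.5248, arXiv:1105.5830, arXiv:1111.1448, arXiv:0811.1727, arXiv:1205.6112,
arXiv:gr-qc/0210103, arXiv:2210.13960, arXiv:2001.10401, arXiv:1904.04831, arXiv:0710.3823]
#9 TrappedNakedExit (support) — = the BORN item stmt-FinalStateConjecture-25598 of
route-FinalStateConjecture-RootDecompTrappedBasinCells (node N2b; home kind crux; local kind support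
as on RootDecompFarLedgerCells rev 1), reused BY SIGNATURE (dedup-attach); text as born: = the BORN
N2b item stmt-FinalStateConjecture-25598 reused BY SIGNATURE (dedup-attach), text as born (abridged;
full docstring in … (full text as born on the home route) [difficulty: open-problem] (why it might
fail: a tame-open set of admissible vacuum data whose MGHD traps a sphere AND forms a naked
singularity outside the resulting black hole (smooth-data analogue of the Hölder-class stability
arXiv:2605.16235), or incompleteness of 𝓘⁺ generated by the black-hole region itself on an open
set.) [doi:10.1088/0264-9381/22/11/019, arXiv:2402.10190, arXiv:2211.15742, arXiv:1912.08478,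
arXiv:2204.09891, arXiv:1407.4766, arXiv:2605.16235, Christodoulou1999]
#9 CascadeSingleExit (support) — = the BORN item stmt-FinalStateConjecture-27604 of
route-FinalStateConjecture-RootDecompHoleCountCells (node N2c; layer-2 child of 26645; THIN BRIDGE ⟸
stmt-13847, kernel-certified), reused BY SIGNATURE (dedup-attach); text as born: [support · THIN
BRIDGE ⟸ stmt-13847 · expectedly VACUOUS · dominated] lens-5 g4 «FutureCensusCarve» child 2 of
SingleHoleCaptureExit … (full text as born on the home route) [difficulty: open-problem] (why it
might fail: Vacuous iff 13847 FiniteCensus holds on the cell; a single-final-hole development whose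
future slices carry unboundedly many disjoint shrinking outermost-MOTS bodies (not excluded by
Penrose-type area/mass heuristics) would make it contentful and as hard as 26645 there.)
[HawkingEllis1973, AnderssonMetzgerTrapped2009, arXiv:0805.3880, arXiv:1407.4766,
doi:10.1103/PhysRevLett.14.57]
#9 TrappedExtremalExit (support) — = the BORN item stmt-FinalStateConjecture-25599 of
route-FinalStateConjecture-RootDecompTrappedBasinCells (node N2b; local kind support = cap
arithmetic only, home kind crux), reused BY SIGNATURE (dedup-attach); text as born: = the BORN N2b
item stmt-FinalStateConjecture-25599 reused BY SIGNATURE (dedup-attach), text as born (abridged;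
full docstring in … (full text as born on the home route) [difficulty: open-problem] (why it might
fail: the set of trapped data with exactly extremal remnants could be tame-thick (accumulating on
itself along every tame line through a member), or every tame exit from it could pass through
uncensored data; vacuum extremal Kerr formation itself is open (arXiv:2402.10190 p.12).)
[arXiv:2211.15742, arXiv:2402.10190, arXiv:2304.08455, Aretakis2015, arXiv:1402.7034, Israel1986]
#9 ExtremalThresholdExit (support) — = the BORN item stmt-FinalStateConjecture-24765 of
route-FinalStateConjecture-RootDecompCausalCells (node N2; local kind support = cap arithmetic only,
home kind crux), reused BY SIGNATURE (dedup-attach); text as born: = the BORN N2 item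
stmt-FinalStateConjecture-24765 reused BY SIGNATURE (dedup-attach; declared kind SUPPORT on this
route only to respect … (full text as born on the home route) [difficulty: open-problem] (why it
might fail: the extremal critical set B_crit could be thick in the tame topology (extremal
thresholds accumulating on themselves along every tame line), or leaving the threshold could land in
naked data; vacuum extremal formation itself is open (arXiv:2402.10190 p.12).) [arXiv:2402.10190,
arXiv:2211.15742, arXiv:2304.08455]
#9 DispersiveExit (support) — = the BORN item stmt-FinalStateConjecture-24766 of
route-FinalStateConjecture-RootDecompCausalCells (node N2; split #20 σ/β/δ there), reused BY
SIGNATURE (dedup-attach); text as born: = the BORN N2 item stmt-FinalStateConjecture-24766 reused BY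
SIGNATURE (dedup-attach; declared kind SUPPORT on this route only to respect … (full text as born on
the home route) [difficulty: open-problem] (why it might fail: a non-radiating vacuum breather or a
complete development with curvature not decaying at i⁺ whose tame neighbours are also exceptional
(an open set) refutes it; no-breather results hold only near 𝓘 (arXiv:1504.04592) or for decaying
solutions (arXiv:2108.13379).) [arXiv:2108.13379, arXiv:1504.04592, doi:10.1007/PL00001021]
#9 NakedThresholdExit (support) — = the BORN item stmt-FinalStateConjecture-24767 of
route-FinalStateConjecture-RootDecompCausalCells (node N2; home kind crux), reused BY SIGNATURE
(dedup-attach); text as born: = the BORN N2 item stmt-FinalStateConjecture-24767 reused BY SIGNATURE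
(dedup-attach; declared kind SUPPORT on this route only to respect … (full text as born on the home
route) [difficulty: open-problem] (why it might fail: a smooth-data analogue of the Singh–Zheng
stability — a tame-open set of admissible vacuum data forming naked singularities (RSR
arXiv:1912.08478 exteriors are fine-tuned, consistent so far).) [Christodoulou1999,
arXiv:1912.08478, arXiv:2204.09891, arXiv:2605.16235, arXiv:0811.0354]

TWO-LAYER PLAN. Layer 2 here = {SobolevAccountDoor (support · THIN · EMPTY GIVEN SUPPORTS S1 ∧ S3⁰ ∧
S2 · does NOT count), SubSobolevTailExit (crux · NEW RESIDUAL of Rₙ hence of N · COUNTS · replaces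
RoughTailExit in the census, count unchanged)} under RoughTailExit, filed as the glued split right
after birth with glue 'SobolevAccountDoor → SubSobolevTailExit → RoughTailExit' (texts = lens-5 g7
children.json VERBATIM; item imports += Literature.Geometry.Lorentzian.WeightedNorms, REQUIRED for
`weightedSobolevSeminorm`). Supports S1 InfiniteBoostLedger / S3⁰ ADMLedger (bricks B1 SoleSameEnd ·
B2 EnergyTransfers · B3 MomentumTransfers, kernel admLedger_of_bricks) / S2 ChargeCoherence are NOT
items (β-rule): typer/port requests D14 (new), D10 (re-pointed), wi-96536. TOWER CAP T6 (critic
standing rule): no further by-signature host on this lineage; a later one-predicate refinement of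
SubSobolevTailExit is HOME-only unless it closes an item, changes the census count, or a tribunal
asks.

KILL CRITERIA. Every binder and both split children are S-implied (lens kernel necessity pieces;
critic pieces_of_summit), so a refutation of any of them refutes S as typed. For this node: a
censored single-hole MGHD of admissible data whose tail lies OUTSIDE the weighted-Sobolev class ST
(∂³h, ∂⁴h, ∂²k, ∂³k not weighted-L² in any chart, e.g. h − h_M ∼ r^{-3.1} sin r) carrying NO
asymptotically round receding section family with convergent Hawking mass kills SubSobolevTailExit
(and S); a counterexample to the Bieri–Chruściel TB ledger at H⁴ regularity (Hawking masses along
Chruściel's N(u) failing to converge or exceeding m_ADM) kills the door's emptiness route (the door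
item itself stays S-implied). The route is retired `superseded` if a large-data exterior theorem at
ℓ ≤ 2 with null asymptotics appears in print (the residual then empties by porting).

NOT DECOMPOSED YET. SubSobolevTailExit's slivers (ρ0 M ≤ 0 — empty by PMT rigidity; ρ∂ parity
failure and ρα rate α ≤ 1/2 — automatic for DR charts with α₋ = 1; live stratum = derivative-poor DR
tails) are deliberately NOT items (c4: no certified regularity NUMBER below ℓ = 4; T6 tower cap);
the interiors of SubextremalChargeExit (large-data Kerr stability proper), HeavyChargeExit (vacuum
third law), LightChargeExit (limiting-Bondi-mass Penrose inequality) stay as born on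
RootDecompFinalChargeCells; the bricks B1–B3 and S1's TB half are typer work, not route items.

CHEAPEST FALSIFIER. D14 / S1: transcribe Bieri–Chruściel arXiv:1612.04359 §§4–5 at H⁴-Sobolev
regularity — do the Hawking masses of the round receding sections of Chruściel's N(u) converge with
M_TB(u) ≤ m_ADM, and is N(u) ∩ D⁺(Σ_ext) ⊆ ∂J⁺(ι K_u) inside an ARBITRARY MGHD (causal bridge by
domains of dependence)? If the TB half cannot be completed at this regularity the door is not
empty-by-porting and the cut loses its point (the residual would have to absorb ST-class tails too);
one reading pass of two papers decides it. Second: `lean check` that the ST clauses elaborate over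
`weightedSobolevSeminorm` in the host context (done: g7/ImportProbe2.lean) — a renaming in
WeightedNorms would bounce the split texts.

NUMBERS. No hand-picked constant enters a binder: ST d quantifies the PRINTED hypothesis constants
of Chruściel 2017 Thm 3.1 — ℓ = 4 derivatives of g − δ (3 of K), decay exponent α ∈ (1/2, 1), parity
exponent α₋ > 1/2 — in the tree norm with δ = α − 3/2 (critic c4 ✓); the admissible class is
o₂(r⁻¹)/o₁(r⁻²) (DR, α₋ = 1 automatically). Ladder ceiling of the method family (large-data
weighted-Sobolev exterior theory): ℓ = 3 small data (Bieri 2010), ℓ = 4 large data (Chruściel 2017);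
lift = an ℓ ≤ 3 large-data exterior theorem with null asymptotics (none in print) or a density
principle for the Bondi ledger needing Cauchy stability up to 𝓘⁺ (idea-needed).

DEFINITION REQUESTS. Per the critic's ruling R2 (iv): D14 «port: InfiniteBoostLedger» (kind cite,
typer queue; Chruściel arXiv:1612.04523 Thm 3.1 (i) future-complete retarded null foliation near 𝓘⁺
in the MGHD for ST-class vacuum data with timelike four-momentum + (iii) causal bridge N(u) ∩
D⁺(Σ_ext) ⊆ ∂J⁺(ι K_u); (ii) TB ledger m_H → M_TB(u) ≤ m_ADM along round receding sections,
Bieri–Chruściel arXiv:1612.04359 §§4–5, print-sketch to complete) filed --for the door item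
SobolevAccountDoor once born; D10 wi-97121 RE-POINTED to the DR-chart-level ADMLedger text
(g7/ADMLedger.oneline; skeleton bricks B1 SoleSameEnd (Jordan–Brouwer grade, PORTING·CITED-FACT) ·
B2 EnergyTransfers (Bartnik 1986 Thm 4.2/4.3) · B3 MomentumTransfers (Chruściel 1986)) — ONE ADM
port serves both doors 29290 and SobolevAccountDoor; wi-96536 (ChargeCoherence) serves Dₙ, D₇ and
lens-4. Typer nit D15 (critic): HasADMEnergy.Of_isSameEnd carries an unused IntegrableOn
scalarCurvatureCoeff hypothesis — drop or discharge for vacuum.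

Novelty: GEN-7 on 29291 (2026-08-30T06:45:52Z, lens-5 g7 + critic R2 06:51:06Z + writer): the move = cut the
far-field residual a SECOND time by the hypothesis class of the only other printed LARGE-DATA
exterior theorem with complete null hypersurfaces, Chruściel's infinite-boost theorem (no
maximality, no smallness), typed verbatim over the tree's weighted-Sobolev seminorm, so that gen 6's
strata r1 (non-maximal K–N) and r2a (Hintz conormal) fall into a door emptied by porting and the
census residual shrinks to derivative-poor DR tails. Searches RUN (lens-5 g7 NODE §6, labelled):
corpus `lit search --hybrid "infinite boost theorem asymptotically flat vacuum null infinity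
Sobolev"` → [corpus:arXiv:1612.04523 p.6] Thm 3.1, [corpus:arXiv:1612.04359 p.1, §§4–5]; `lit
vsearch "large data exterior stability future complete null infinity weighted Sobolev"` → Bieri 2010
(ℓ = 3 small), Klainerman–Nicolò 2003 (o₄/o₃, maximal), Hintz arXiv:2302.13804 (conormal, Bondi mass
open Rem 3.38); galaxy `lit galaxy search "infinite boost|boost theorem|Trautman-Bondi" --star all`
→ [galaxy:pdf] Christodoulou–Ó Murchadha 1981 boost problem (interior boosts only), no
exterior-to-𝓘⁺ large-data theorem below ℓ = 4; `lean search weightedSobolevSeminorm` →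
Literature.Geometry.Lorentzian.WeightedNorms (gr.S15). Nearest prior art:
route-FinalStateConjecture-RootDecompFarLedgerCells (gen 6, K–N class) — delta: the transversal
predicate is a DIFFERENT printed theorem's hypothesis block (H⁴-Sobolev + parity + timel  [refs: 1612.04523, 1612.04359, 2302.13804]

Barriers (technique_class: population-split, weighted-Sobolev tail class, TB ledger): - technique_class: population-split, weighted-Sobolev tail class, TB ledger
- Literature.Barriers.FinalStateConjecture.KerrStabilityHoldsBelowNarrow: the printed
slowly-rotating Kerr stability frontier (∃ α > 0; KlainermanSzeftel2023 Thm 1.2.1) is a POSITIVE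
theorem about near-Kerr data; no item here is a perturbation-of-Kerr statement and no binder carries
a smallness-in-spin or closeness-to-Kerr hypothesis — the K–N class KN d is a FAR-FIELD tail class
for data of any size; outside the class (the frontier bites only roads inside SubextremalChargeExit,
acknowledged there as on the home route).
- Literature.Barriers.FinalStateConjecture.KehrbergerLogarithmicAsymptoticsNarrow: the K–N class KN
d (o₄(r^{-3/2-η}) beyond Schwarzschild, ∃ η > 0) EXCLUDES the logarithmic / polyhomogeneous tails of
the barrier by hypothesis — those data fall into RoughTailExit (stratum r2a), where the barrier is
DECLARED (no peeling or smooth 𝓘⁺ is claimed; HasCutBondiMass is the sojourn/cut form); outside for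
the door, inside-and-acknowledged for the residual.
- Literature.Barriers.FinalStateConjecture.nakedSingularityInstability: genericity-blind methods
excluded; NakedThresholdExit / TrappedNakedExit / all pieces are the GENERIC (tame-curve) forms —
outside the class; the barrier's own theorem (Christodoulou 1999 Thm 4.1) is the model exit family.
- Literature.Barriers.FinalStateConjecture.AretakisInstability: bites settling ON an extremal
horizon and every uniform-in-spin road inside TrappedCapt

History (route lifecycle, newest last):
- 2026-08-30T07:04:47Z · AUTO-CRUX (open): HeavyChargeDoor — hypotheses of the deciding theorem that nothing in the route derives are cruxes (planner-decomp-fsc-writer-1-g2-0)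

sub-problem: FinalStateConjecture · status: draft · opened planner-decomp-fsc-writer-1-g2-0 2026-08-30T07:03:58Z · rev 1 · ledger route-FinalStateConjecture-RootDecompSobolevLedgerCells
GENERATED by the gate from the ledger (D-0016/17). Provers cite these decls: `theorem foo : Summit.FinalStateConjecture.FinalStateConjecture.Theses.RootDecompSobolevLedgerCells.<Decl> := …` in Summits/FinalStateConjecture/FinalStateConjecture/Theorems/<Name>.lean.
-/

namespace Summit.FinalStateConjecture.FinalStateConjecture.Theses.RootDecompSobolevLedgerCells

open scoped BigOperators Topology Manifold Classical MeasureTheory ProbabilityTheory Matrix InnerProductSpace ComplexConjugate ContinuousMap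
open Filter Set Function TopologicalSpace MeasureTheory

attribute [summit_statement] _root_.FinalStateConjecture

/-- item stmt-FinalStateConjecture-29291 · crux · rank 2 · SPLIT (gen 1) into SobolevAccountDoor, SubSobolevTailExit + glue RoughTailExitGlue · direct attempts still welcome (low priority) · by planner
why it might fail: Admissible o₂(r⁻¹)/o₁(r⁻²) tails below Klainerman–Nicolò regularity (e.g. r^{-3-ε} sin r ripples) have no printed exterior theory with Hawking-mass limits (Hintz arXiv:2302.13804 Rem 3.38: Bondi mass unproved); a censored development with NO convergent round family refutes it and S as typed.
sources: arXiv:2302.13804 Thm 1.1, Rem 3.38, arXiv:2405.00735, arXiv:2303.12758, arXiv:2606.08716, KlainermanNicolo2003 fn 49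
[crux · NEW RESIDUAL of N · WEAKER · COUNTS (replaces NoChargeExit in the census; N's «UNDECIDED
(𝓘⁺-regularity)» is LOCALISED here to far-field regularity strictly below Klainerman–Nicolò,
independent of every interior clause) · UNDECIDED, stratified · leaf Rₙ of lens-5 g6
«FarLedgerCells» on stmt-28426 (critic CLEARED 2026-08-30T06:07:07Z, R1 06:11:22Z)] Same population
as NoChargeExit AND ¬KN d (the Cauchy datum is non-maximal, or its sole end is rougher / slower than
the K–N weights (3/2+η, 5/2+η, 4, 3) for every η > 0): exit tamely with codimension ≥ 1. Strata
(lens-5 NODE-g6 §3, NOT items — caution c4): r1 non-maximal gauge = ATTACKABLE only modulo ONE of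
{maximal SAF Cauchy slice existence in the MGHD of censored black-hole data (Bartnik 1984 interior
condition; Bartnik–Chruściel–Ó Murchadha 1990 for the trapped case), a K–N theorem without
maximality (K–N fn 49 «not essential» is a remark, not a theorem)} + CBG transport; r2a Hintz-class
polyhomogeneous tails (arXiv:2302.13804 Thm 1.1, Rem 3.38: Bondi mass unproved) = porting+effort
once an explicit regularity number is certified (request F6); r2b borderline / derivative-poor
admissible tails (o₂(r⁻¹)/o₁(r⁻²), e.g. r^{-3-ε} -/
@[route_item "route-FinalStateConjecture-RootDecompSobolevLedgerCells", crux]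
def RoughTailExit : Prop :=
  ∀ (X : Type) [TopologicalSpace X] [ChartedSpace Literature.Geometry.Lorentzian.E3 X] [IsManifold (𝓡 3) ((⊤ : ℕ∞) : WithTop ℕ∞) X] [T2Space X] [SecondCountableTopology X] [ConnectedSpace X], let P : Literature.Geometry.Lorentzian.InitialDataSet (𝓡 3) X → Prop := fun D ↦ (∃ 𝒟 : Literature.Geometry.Lorentzian.VacuumCauchyDevelopment D, 𝒟.IsMaximal) ∧ ∀ 𝒟 : Literature.Geometry.Lorentzian.VacuumCauchyDevelopment D, 𝒟.IsMaximal → Summit.FinalStateConjecture.HasCompleteNullInfinity 𝒟.toCauchyDevelopment ∧ ∃ (O : Set 𝒟.carrier) (d : Literature.Geometry.Lorentzian.FinalStateDecomposition 𝒟.toSpacetime O 2), (∀ i, Literature.Geometry.Lorentzian.Kerr.IsSubextremal (d.mass i) (d.spin i)) ∧ O = Summit.FinalStateConjecture.exteriorOf 𝒟.toCauchyDevelopment d.charted ∧ Summit.FinalStateConjecture.RaysStayInClosure 𝒟.toCauchyDevelopment O ∧ Summit.FinalStateConjecture.HasExhaustiveCharts d ∧ Summit.FinalStateConjecture.IsFutureOriented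 d; let Pw0 : Literature.Geometry.Lorentzian.InitialDataSet (𝓡 3) X → Prop := fun D ↦ (∃ 𝒟 : Literature.Geometry.Lorentzian.VacuumCauchyDevelopment D, 𝒟.IsMaximal) ∧ ∀ 𝒟 : Literature.Geometry.Lorentzian.VacuumCauchyDevelopment D, 𝒟.IsMaximal → Summit.FinalStateConjecture.HasCompleteNullInfinity 𝒟.toCauchyDevelopment ∧ ∃ (O : Set 𝒟.carrier) (d : Literature.Geometry.Lorentzian.FinalStateDecomposition 𝒟.toSpacetime O 0), O = Summit.FinalStateConjecture.exteriorOf 𝒟.toCauchyDevelopment d.charted ∧ Summit.FinalStateConjecture.RaysStayInClosure 𝒟.toCauchyDevelopment O ∧ Summit.FinalStateConjecture.HasExhaustiveCharts d ∧ Summit.FinalStateConjecture.IsFutureOriented d; let Disp : Literature.Geometry.Lorentzian.InitialDataSet (𝓡 3) X → Prop := fun D ↦ (∃ 𝒟 : Literature.Geometry.Lorentzian.VacuumCauchyDevelopment D, 𝒟.IsMaximal) ∧ ∀ 𝒟 : Literature.Geometry.Lorentzian.VacuumCauchyDevelopment D, 𝒟.IsMaximal → ∀ [𝒟.metric.HasLeviCivita],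 ¬ 𝒟.metric.IsFutureNullGeodesicallyIncomplete 𝒟.timeOrientation ∧ ¬ 𝒟.metric.IsFutureTimelikeGeodesicallyIncomplete 𝒟.timeOrientation; let Trap : Literature.Geometry.Lorentzian.InitialDataSet (𝓡 3) X → Prop := fun D ↦ (∃ 𝒟 : Literature.Geometry.Lorentzian.VacuumCauchyDevelopment D, 𝒟.IsMaximal) ∧ ∀ 𝒟 : Literature.Geometry.Lorentzian.VacuumCauchyDevelopment D, 𝒟.IsMaximal → ∀ [𝒟.metric.HasLeviCivita], ∃ f : Metric.sphere (0 : Literature.Geometry.Lorentzian.E3) 1 → 𝒟.carrier, Set.range f ⊆ 𝒟.metric.causalFuture 𝒟.timeOrientation (Set.range 𝒟.embed) ∧ 𝒟.metric.IsTrappedSurface (𝓡 2) 𝒟.timeOrientation f; let Cens : Literature.Geometry.Lorentzian.InitialDataSet (𝓡 3) X → Prop := fun D ↦ ∀ 𝒟 : Literature.Geometry.Lorentzian.VacuumCauchyDevelopment D, 𝒟.IsMaximal → Summit.FinalStateConjecture.HasCompleteNullInfinity 𝒟.toCauchyDevelopment; let Single : Literature.Geometry.Lorentzian.InitialDataSet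 (𝓡 3) X → Prop := fun D ↦ ∀ 𝒟 : Literature.Geometry.Lorentzian.VacuumCauchyDevelopment D, 𝒟.IsMaximal → ∀ [𝒟.metric.HasLeviCivita], Subsingleton (ConnectedComponents ↥(Literature.Geometry.Lorentzian.DataEmbedding.blackHoleRegion 𝒟.toDataEmbedding ∩ 𝒟.metric.causalFuture 𝒟.timeOrientation (Set.range 𝒟.embed))); let CenFinF : Literature.Geometry.Lorentzian.InitialDataSet (𝓡 3) X → Prop := fun D ↦ ∀ 𝒟 : Literature.Geometry.Lorentzian.VacuumCauchyDevelopment D, 𝒟.IsMaximal → ∃ n : ℕ, ∀ (X' : Type) [TopologicalSpace X'] [ChartedSpace Literature.Geometry.Lorentzian.E3 X'] [IsManifold (𝓡 3) ((⊤ : ℕ∞) : WithTop ℕ∞) X'] [ConnectedSpace X'] (D' : Literature.Geometry.Lorentzian.InitialDataSet (𝓡 3) X') (ι' : X' → 𝒟.carrier) (ν' : Literature.Geometry.Lorentzian.NormalField (𝓡 4) ι'), Manifold.IsSmoothEmbedding (𝓡 3) (𝓡 4) ((⊤ : ℕ∞) : WithTop ℕ∞) ι' → 𝒟.metric.IsFutureUnitNormal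 (𝓡 3) 𝒟.timeOrientation ι' ν' → (∀ y : X', Literature.Geometry.Lorentzian.pullbackBilin (I := 𝓡 4) (I' := 𝓡 3) ι' 𝒟.metric.val y = D'.h.inner y) → (∀ [𝒟.metric.toPseudoRiemannianMetric.HasLeviCivita] (y : X'), 𝒟.metric.toPseudoRiemannianMetric.secondFundamentalForm (𝓡 3) ι' ν' y = D'.kBilin y) → 𝒟.metric.IsCauchyHypersurface 𝒟.timeOrientation (Set.range ι') → Set.range ι' ⊆ 𝒟.metric.causalFuture 𝒟.timeOrientation (Set.range 𝒟.embed) → ∀ S : Fin (n + 1) → Literature.Geometry.Lorentzian.OutermostMOTS (𝓡 3) D'.h D'.k, (∀ j, ConnectedSpace (S j).surf) → (∀ j, IsCompact (((S j).exterior : Set X'))ᶜ ∧ (interior (((S j).exterior : Set X'))ᶜ).Nonempty) → ∃ j j', j ≠ j' ∧ ((((S j).exterior : Set X'))ᶜ ∩ (((S j').exterior : Set X'))ᶜ).Nonempty; let MassF : (D : Literature.Geometry.Lorentzian.InitialDataSet (𝓡 3) X) → Literature.Geometry.Lorentzian.VacuumCauchyDevelopment D → ENNReal := fun D 𝒟 ↦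 ⨅ (K : Set 𝒟.carrier) (_ : IsCompact K) (m : ℝ) (_ : 𝒟.toCauchyDevelopment.HasCutBondiMass K m), ENNReal.ofReal m; let AreaF : (D : Literature.Geometry.Lorentzian.InitialDataSet (𝓡 3) X) → (𝒟 : Literature.Geometry.Lorentzian.VacuumCauchyDevelopment D) → [𝒟.metric.HasLeviCivita] → ENNReal := fun D 𝒟 hLC ↦ sInf {a : ENNReal | ∀ (X' : Type) [TopologicalSpace X'] [ChartedSpace Literature.Geometry.Lorentzian.E3 X'] [IsManifold (𝓡 3) ((⊤ : ℕ∞) : WithTop ℕ∞) X'] [ConnectedSpace X'] [T2Space X'] (D' : Literature.Geometry.Lorentzian.InitialDataSet (𝓡 3) X') (ι' : X' → 𝒟.carrier) (ν' : Literature.Geometry.Lorentzian.NormalField (𝓡 4) ι'), Manifold.IsSmoothEmbedding (𝓡 3) (𝓡 4) ((⊤ : ℕ∞) : WithTop ℕ∞) ι' → 𝒟.metric.IsFutureUnitNormal (𝓡 3) 𝒟.timeOrientation ι' ν' → (∀ y : X', Literature.Geometry.Lorentzian.pullbackBilin (I := 𝓡 4) (I' := 𝓡 3) ι' 𝒟.metric.val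 y = D'.h.inner y) → (∀ [𝒟.metric.toPseudoRiemannianMetric.HasLeviCivita] (y : X'), 𝒟.metric.toPseudoRiemannianMetric.secondFundamentalForm (𝓡 3) ι' ν' y = D'.kBilin y) → 𝒟.metric.IsCauchyHypersurface 𝒟.timeOrientation (Set.range ι') → Set.range ι' ⊆ 𝒟.metric.causalFuture 𝒟.timeOrientation (Set.range 𝒟.embed) → (letI : MeasurableSpace X' := borel X'; haveI : BorelSpace X' := ⟨rfl⟩; haveI : LocallyCompactSpace X' := ChartedSpace.locallyCompactSpace Literature.Geometry.Lorentzian.E3 X'; Literature.Geometry.Lorentzian.area D'.h (ι' ⁻¹' Literature.Geometry.Lorentzian.DataEmbedding.futureEventHorizon 𝒟.toDataEmbedding)) ≤ a}; let Acc : Literature.Geometry.Lorentzian.InitialDataSet (𝓡 3) X → Prop := fun D ↦ ∃ (M A : ENNReal), M ≠ ⊤ ∧ (∀ e : Literature.Geometry.Lorentzian.AFEnd X, e.IsAsymptoticallyFlat D 1 → (∃ m, e.HasADMEnergy D m) → M ≤ ENNReal.ofReal (e.admMass D)) ∧ ∀ 𝒟 : Literature.Geometry.Lorentzian.VacuumCauchyDevelopment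 D, 𝒟.IsMaximal → ∀ [𝒟.metric.HasLeviCivita], MassF D 𝒟 = M ∧ AreaF D 𝒟 = A; let KN : Literature.Geometry.Lorentzian.InitialDataSet (𝓡 3) X → Prop := fun D ↦ D.IsMaximalData ∧ ∃ (e : Literature.Geometry.Lorentzian.AFEnd X) (M η : ℝ), 0 < η ∧ e.IsSoleEnd ∧ e.IsStronglyAsymptoticallyFlatWith D M (3 / 2 + η) (5 / 2 + η) 4 3; ∀ d ∈ Literature.Geometry.Lorentzian.admissibleVacuumData X, ¬ P d → (((¬ Disp d ∧ Trap d ∧ Cens d ∧ ¬ Pw0 d) ∧ Single d) ∧ CenFinF d) → (¬ Acc d ∧ ¬ KN d) → ∃ (e : Literature.Geometry.Lorentzian.AFEnd X) (F : EuclideanSpace ℝ (Fin 1) → Literature.Geometry.Lorentzian.InitialDataSet (𝓡 3) X), Literature.Geometry.Lorentzian.InitialDataSet.IsTameDataFamily e 1 F ∧ Literature.Geometry.Lorentzian.InitialDataSet.IsImmersedAtZero 1 F ∧ F 0 = d ∧ Injective F ∧ (∀ c, F c ∈ Literature.Geometry.Lorentzian.admissibleVacuumData X) ∧ ∀ c ≠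 0, P (F c)

-- parent: RoughTailExit · child (gen 1)
/--     item stmt-FinalStateConjecture-29969 · crux · rank 202 · open
    parent: RoughTailExit · by planner
    why it might fail: Admissible tails with ∂³h, ∂⁴h, ∂²k, ∂³k not weighted-L² in any chart (h − h_M ∼ r^{-3.1} sin r) lie below every printed exterior theory with null completeness (Bieri, Chruściel ℓ≥4, K–N, Hintz); a censored MGHD of such data with NO round receding family of convergent Hawking mass refutes it.
    sources: arXiv:1612.04523 §3, arXiv:1612.04359 §1, arXiv:2405.00735, arXiv:2606.08716, KlainermanRodnianskiSzeftel2015, arXiv:2302.13804 Rem 3.38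
[crux · NEW RESIDUAL of Rₙ (hence of N) · WEAKER · COUNTS (replaces RoughTailExit in the census;
count unchanged) · UNDECIDED · LENS-TERMINAL modulo print (ladder ceiling ℓ = 3 small / ℓ = 4 large)
· IDEA-NEEDED · leaf R₇ of lens-5 g7 «SobolevLedgerCells» on stmt-29291 (critic CLEARED
2026-08-30T06:51:06Z, R2 (α), row 73; tower cap T6: further one-predicate refinements HOME-only)]
Same population as RoughTailExit AND ¬ST d: the admissible o₂(r⁻¹)/o₁(r⁻²) tail is outside the
Chruściel–Bieri weighted-Sobolev class in EVERY chart (third/fourth derivatives of h and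
second/third of k not weighted-L² at infinity, or no sole-end H⁴ chart with parity and timelike
momentum). Absorbs gen 6's strata r1 (non-maximal Klainerman–Nicolò data) and r2a (Hintz
polyhomogeneous/conormal class) into the door; slivers ρ0 (M ≤ 0: empty by PMT rigidity, tree
ExactKerrEnds.ZeroMassAdmissibleMinkowskian), ρ∂ (parity) and ρα (rate α ≤ 1/2) are automatic-empty
for DR charts (α₋ = 1); LIVE stratum = derivative-poor Dafermos–Rodnianski tails (e.g. h − h_M ∼
r^{-3.1} sin r), below every printed exterior theory with null completeness (Bieri ℓ = 3 small data,
Chruściel ℓ ≥ 4, K–N o₄/o₃, Hintz C^∞-conormal; bounded -/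
@[route_item "route-FinalStateConjecture-RootDecompSobolevLedgerCells"]
def SubSobolevTailExit : Prop :=
  ∀ (X : Type) [TopologicalSpace X] [ChartedSpace Literature.Geometry.Lorentzian.E3 X] [IsManifold (𝓡 3) ((⊤ : ℕ∞) : WithTop ℕ∞) X] [T2Space X] [SecondCountableTopology X] [ConnectedSpace X], let P : Literature.Geometry.Lorentzian.InitialDataSet (𝓡 3) X → Prop := fun D ↦ (∃ 𝒟 : Literature.Geometry.Lorentzian.VacuumCauchyDevelopment D, 𝒟.IsMaximal) ∧ ∀ 𝒟 : Literature.Geometry.Lorentzian.VacuumCauchyDevelopment D, 𝒟.IsMaximal → Summit.FinalStateConjecture.HasCompleteNullInfinity 𝒟.toCauchyDevelopment ∧ ∃ (O : Set 𝒟.carrier) (d : Literature.Geometry.Lorentzian.FinalStateDecomposition 𝒟.toSpacetime O 2), (∀ i, Literature.Geometry.Lorentzian.Kerr.IsSubextremal (d.mass i) (d.spin i)) ∧ O = Summit.FinalStateConjecture.exteriorOf 𝒟.toCauchyDevelopment d.charted ∧ Summit.FinalStateConjecture.RaysStayInClosure 𝒟.toCauchyDevelopment O ∧ Summit.FinalStateConjecture.HasExhaustiveCharts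 d ∧ Summit.FinalStateConjecture.IsFutureOriented d; let Pw0 : Literature.Geometry.Lorentzian.InitialDataSet (𝓡 3) X → Prop := fun D ↦ (∃ 𝒟 : Literature.Geometry.Lorentzian.VacuumCauchyDevelopment D, 𝒟.IsMaximal) ∧ ∀ 𝒟 : Literature.Geometry.Lorentzian.VacuumCauchyDevelopment D, 𝒟.IsMaximal → Summit.FinalStateConjecture.HasCompleteNullInfinity 𝒟.toCauchyDevelopment ∧ ∃ (O : Set 𝒟.carrier) (d : Literature.Geometry.Lorentzian.FinalStateDecomposition 𝒟.toSpacetime O 0), O = Summit.FinalStateConjecture.exteriorOf 𝒟.toCauchyDevelopment d.charted ∧ Summit.FinalStateConjecture.RaysStayInClosure 𝒟.toCauchyDevelopment O ∧ Summit.FinalStateConjecture.HasExhaustiveCharts d ∧ Summit.FinalStateConjecture.IsFutureOriented d; let Disp : Literature.Geometry.Lorentzian.InitialDataSet (𝓡 3) X → Prop := fun D ↦ (∃ 𝒟 : Literature.Geometry.Lorentzian.VacuumCauchyDevelopment D, 𝒟.IsMaximal) ∧ ∀ 𝒟 : Literature.Geometry.Lorentzian.VacuumCauchyDevelopment D, 𝒟.IsMaximal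 → ∀ [𝒟.metric.HasLeviCivita], ¬ 𝒟.metric.IsFutureNullGeodesicallyIncomplete 𝒟.timeOrientation ∧ ¬ 𝒟.metric.IsFutureTimelikeGeodesicallyIncomplete 𝒟.timeOrientation; let Trap : Literature.Geometry.Lorentzian.InitialDataSet (𝓡 3) X → Prop := fun D ↦ (∃ 𝒟 : Literature.Geometry.Lorentzian.VacuumCauchyDevelopment D, 𝒟.IsMaximal) ∧ ∀ 𝒟 : Literature.Geometry.Lorentzian.VacuumCauchyDevelopment D, 𝒟.IsMaximal → ∀ [𝒟.metric.HasLeviCivita], ∃ f : Metric.sphere (0 : Literature.Geometry.Lorentzian.E3) 1 → 𝒟.carrier, Set.range f ⊆ 𝒟.metric.causalFuture 𝒟.timeOrientation (Set.range 𝒟.embed) ∧ 𝒟.metric.IsTrappedSurface (𝓡 2) 𝒟.timeOrientation f; let Cens : Literature.Geometry.Lorentzian.InitialDataSet (𝓡 3) X → Prop := fun D ↦ ∀ 𝒟 : Literature.Geometry.Lorentzian.VacuumCauchyDevelopment D, 𝒟.IsMaximal → Summit.FinalStateConjecture.HasCompleteNullInfinity 𝒟.toCauchyDevelopment; let Single :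 Literature.Geometry.Lorentzian.InitialDataSet (𝓡 3) X → Prop := fun D ↦ ∀ 𝒟 : Literature.Geometry.Lorentzian.VacuumCauchyDevelopment D, 𝒟.IsMaximal → ∀ [𝒟.metric.HasLeviCivita], Subsingleton (ConnectedComponents ↥(Literature.Geometry.Lorentzian.DataEmbedding.blackHoleRegion 𝒟.toDataEmbedding ∩ 𝒟.metric.causalFuture 𝒟.timeOrientation (Set.range 𝒟.embed))); let CenFinF : Literature.Geometry.Lorentzian.InitialDataSet (𝓡 3) X → Prop := fun D ↦ ∀ 𝒟 : Literature.Geometry.Lorentzian.VacuumCauchyDevelopment D, 𝒟.IsMaximal → ∃ n : ℕ, ∀ (X' : Type) [TopologicalSpace X'] [ChartedSpace Literature.Geometry.Lorentzian.E3 X'] [IsManifold (𝓡 3) ((⊤ : ℕ∞) : WithTop ℕ∞) X'] [ConnectedSpace X'] (D' : Literature.Geometry.Lorentzian.InitialDataSet (𝓡 3) X') (ι' : X' → 𝒟.carrier) (ν' : Literature.Geometry.Lorentzian.NormalField (𝓡 4) ι'), Manifold.IsSmoothEmbedding (𝓡 3) (𝓡 4) ((⊤ : ℕ∞) : WithTop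 ℕ∞) ι' → 𝒟.metric.IsFutureUnitNormal (𝓡 3) 𝒟.timeOrientation ι' ν' → (∀ y : X', Literature.Geometry.Lorentzian.pullbackBilin (I := 𝓡 4) (I' := 𝓡 3) ι' 𝒟.metric.val y = D'.h.inner y) → (∀ [𝒟.metric.toPseudoRiemannianMetric.HasLeviCivita] (y : X'), 𝒟.metric.toPseudoRiemannianMetric.secondFundamentalForm (𝓡 3) ι' ν' y = D'.kBilin y) → 𝒟.metric.IsCauchyHypersurface 𝒟.timeOrientation (Set.range ι') → Set.range ι' ⊆ 𝒟.metric.causalFuture 𝒟.timeOrientation (Set.range 𝒟.embed) → ∀ S : Fin (n + 1) → Literature.Geometry.Lorentzian.OutermostMOTS (𝓡 3) D'.h D'.k, (∀ j, ConnectedSpace (S j).surf) → (∀ j, IsCompact (((S j).exterior : Set X'))ᶜ ∧ (interior (((S j).exterior : Set X'))ᶜ).Nonempty) → ∃ j j', j ≠ j' ∧ ((((S j).exterior : Set X'))ᶜ ∩ (((S j').exterior : Set X'))ᶜ).Nonempty; let MassF : (D : Literature.Geometry.Lorentzian.InitialDataSet (𝓡 3) X) → Literature.Geometry.Lorentzian.VacuumCauchyDevelopment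 D → ENNReal := fun D 𝒟 ↦ ⨅ (K : Set 𝒟.carrier) (_ : IsCompact K) (m : ℝ) (_ : 𝒟.toCauchyDevelopment.HasCutBondiMass K m), ENNReal.ofReal m; let AreaF : (D : Literature.Geometry.Lorentzian.InitialDataSet (𝓡 3) X) → (𝒟 : Literature.Geometry.Lorentzian.VacuumCauchyDevelopment D) → [𝒟.metric.HasLeviCivita] → ENNReal := fun D 𝒟 hLC ↦ sInf {a : ENNReal | ∀ (X' : Type) [TopologicalSpace X'] [ChartedSpace Literature.Geometry.Lorentzian.E3 X'] [IsManifold (𝓡 3) ((⊤ : ℕ∞) : WithTop ℕ∞) X'] [ConnectedSpace X'] [T2Space X'] (D' : Literature.Geometry.Lorentzian.InitialDataSet (𝓡 3) X') (ι' : X' → 𝒟.carrier) (ν' : Literature.Geometry.Lorentzian.NormalField (𝓡 4) ι'), Manifold.IsSmoothEmbedding (𝓡 3) (𝓡 4) ((⊤ : ℕ∞) : WithTop ℕ∞) ι' → 𝒟.metric.IsFutureUnitNormal (𝓡 3) 𝒟.timeOrientation ι' ν' → (∀ y : X', Literature.Geometry.Lorentzian.pullbackBilin (I := 𝓡 4)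 (I' := 𝓡 3) ι' 𝒟.metric.val y = D'.h.inner y) → (∀ [𝒟.metric.toPseudoRiemannianMetric.HasLeviCivita] (y : X'), 𝒟.metric.toPseudoRiemannianMetric.secondFundamentalForm (𝓡 3) ι' ν' y = D'.kBilin y) → 𝒟.metric.IsCauchyHypersurface 𝒟.timeOrientation (Set.range ι') → Set.range ι' ⊆ 𝒟.metric.causalFuture 𝒟.timeOrientation (Set.range 𝒟.embed) → (letI : MeasurableSpace X' := borel X'; haveI : BorelSpace X' := ⟨rfl⟩; haveI : LocallyCompactSpace X' := ChartedSpace.locallyCompactSpace Literature.Geometry.Lorentzian.E3 X'; Literature.Geometry.Lorentzian.area D'.h (ι' ⁻¹' Literature.Geometry.Lorentzian.DataEmbedding.futureEventHorizon 𝒟.toDataEmbedding)) ≤ a}; let Acc : Literature.Geometry.Lorentzian.InitialDataSet (𝓡 3) X → Prop := fun D ↦ ∃ (M A : ENNReal), M ≠ ⊤ ∧ (∀ e : Literature.Geometry.Lorentzian.AFEnd X, e.IsAsymptoticallyFlat D 1 → (∃ m, e.HasADMEnergy D m) → M ≤ ENNReal.ofReal (e.admMass D)) ∧ ∀ 𝒟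 : Literature.Geometry.Lorentzian.VacuumCauchyDevelopment D, 𝒟.IsMaximal → ∀ [𝒟.metric.HasLeviCivita], MassF D 𝒟 = M ∧ AreaF D 𝒟 = A; let KN : Literature.Geometry.Lorentzian.InitialDataSet (𝓡 3) X → Prop := fun D ↦ D.IsMaximalData ∧ ∃ (e : Literature.Geometry.Lorentzian.AFEnd X) (M η : ℝ), 0 < η ∧ e.IsSoleEnd ∧ e.IsStronglyAsymptoticallyFlatWith D M (3 / 2 + η) (5 / 2 + η) 4 3; let ST : Literature.Geometry.Lorentzian.InitialDataSet (𝓡 3) X → Prop := fun D ↦ ∃ (e₀ : Literature.Geometry.Lorentzian.AFEnd X) (M : ℝ), e₀.IsSoleEnd ∧ e₀.IsStronglyAsymptoticallyFlatDR D M ∧ 0 < M ∧ ∃ (e : Literature.Geometry.Lorentzian.AFEnd X) (α αm R' : ℝ), 1 / 2 < α ∧ α < 1 ∧ 1 / 2 < αm ∧ e.R ≤ R' ∧ e.IsSoleEnd ∧ Literature.Geometry.Lorentzian.weightedSobolevSeminorm {x : Literature.Geometry.Lorentzian.E3 | R' < ‖x‖} 4 (α - 3 / 2) (fun x ↦ e.hCoeff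 D x - (innerSL ℝ : Literature.Geometry.Lorentzian.E3 →L[ℝ] Literature.Geometry.Lorentzian.E3 →L[ℝ] ℝ)) < ⊤ ∧ Literature.Geometry.Lorentzian.weightedSobolevSeminorm {x : Literature.Geometry.Lorentzian.E3 | R' < ‖x‖} 3 (α - 1 / 2) (fun x ↦ e.kCoeff D x) < ⊤ ∧ Asymptotics.IsBigO (Bornology.cobounded Literature.Geometry.Lorentzian.E3) (fun x : Literature.Geometry.Lorentzian.E3 ↦ ‖e.hCoeff D x - e.hCoeff D (-x)‖) (fun x ↦ ‖x‖ ^ (-αm)) ∧ Asymptotics.IsBigO (Bornology.cobounded Literature.Geometry.Lorentzian.E3) (fun x : Literature.Geometry.Lorentzian.E3 ↦ ‖x‖ * ‖iteratedFDeriv ℝ 1 (fun y ↦ e.hCoeff D y - e.hCoeff D (-y)) x‖) (fun x ↦ ‖x‖ ^ (-αm)) ∧ Asymptotics.IsBigO (Bornology.cobounded Literature.Geometry.Lorentzian.E3) (fun x : Literature.Geometry.Lorentzian.E3 ↦ ‖e.kCoeff D x + e.kCoeff D (-x)‖) (fun x ↦ ‖x‖ ^ (-1 - αm)); ∀ d ∈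 Literature.Geometry.Lorentzian.admissibleVacuumData X, ¬ P d → (((¬ Disp d ∧ Trap d ∧ Cens d ∧ ¬ Pw0 d) ∧ Single d) ∧ CenFinF d) → ((¬ Acc d ∧ ¬ KN d) ∧ ¬ ST d) → ∃ (e : Literature.Geometry.Lorentzian.AFEnd X) (F : EuclideanSpace ℝ (Fin 1) → Literature.Geometry.Lorentzian.InitialDataSet (𝓡 3) X), Literature.Geometry.Lorentzian.InitialDataSet.IsTameDataFamily e 1 F ∧ Literature.Geometry.Lorentzian.InitialDataSet.IsImmersedAtZero 1 F ∧ F 0 = d ∧ Injective F ∧ (∀ c, F c ∈ Literature.Geometry.Lorentzian.admissibleVacuumData X) ∧ ∀ c ≠ 0, P (F c)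

-- parent: RoughTailExit · child (gen 1)
/--     item stmt-FinalStateConjecture-29968 · support · rank 201 · open
    parent: RoughTailExit · by planner
    why it might fail: Empty only modulo S1: the TB half of the Chruściel–Bieri ledger (Hawking masses of round receding sections of N(u) converge, M_TB(u) ≤ m_ADM) is SKETCHED (Bieri–Chruściel 2016 §§4–5), not printed at H⁴ regularity; N(u) ⊆ ∂J⁺(K_u) in an arbitrary MGHD is a causal bridge to port.
    sources: arXiv:1612.04523 Thm 3.1, arXiv:1612.04359 §§4–5, Thm 6.1, Bieri2010, Bartnik1986 Thm 4.2, ChoquetBruhatGeroch1969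
[support · THIN · EMPTY GIVEN SUPPORTS S1 InfiniteBoostLedger (port request D14) ∧ S3⁰ ADMLedger
(D10 wi-97121 re-pointed: bricks B1 SoleSameEnd · B2 EnergyTransfers · B3 MomentumTransfers, kernel
admLedger_of_bricks) ∧ S2 ChargeCoherence (wi-96536; transport brick B0 proved by lens-4 g8), kernel
sobolevAccountDoor_of_ledgers · does NOT count · ATTACKABLE NOW as porting · door D₇ of lens-5 g7
«SobolevLedgerCells» on stmt-29291 (critic CLEARED 2026-08-30T06:51:06Z, FORM RULING R2 (α),
CRITIC-LEDGER row 73)] Same population as RoughTailExit (censored single-hole admissible data, not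
dispersive, every MGHD traps, complete 𝓘⁺, weak C⁰-Kerr capture fails, at most one final hole,
bounded census, ¬Acc d no honest Bondi account, tail OUTSIDE the Klainerman–Nicolò class KN d) AND
the tail lies in the Chruściel–Bieri infinite-boost class ST d: compact core ∪ ONE sole end chart e
with e.R ≤ R′ on which g − δ ∈ H⁴ weighted-Sobolev (tree gr.S15 weightedSobolevSeminorm, δ = α −
3/2), K ∈ H³, decay exponent α ∈ (1/2, 1), parity condition with α₋ > 1/2, vacuum, timelike ADM
four-momentum (M, 0) from the DR chart — the PRINTED hypothesis block of Chruściel CQG 34 (2017)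
145016 Thm 3.1 (arXiv:1612.0 -/
@[route_item "route-FinalStateConjecture-RootDecompSobolevLedgerCells"]
def SobolevAccountDoor : Prop :=
  ∀ (X : Type) [TopologicalSpace X] [ChartedSpace Literature.Geometry.Lorentzian.E3 X] [IsManifold (𝓡 3) ((⊤ : ℕ∞) : WithTop ℕ∞) X] [T2Space X] [SecondCountableTopology X] [ConnectedSpace X], let P : Literature.Geometry.Lorentzian.InitialDataSet (𝓡 3) X → Prop := fun D ↦ (∃ 𝒟 : Literature.Geometry.Lorentzian.VacuumCauchyDevelopment D, 𝒟.IsMaximal) ∧ ∀ 𝒟 : Literature.Geometry.Lorentzian.VacuumCauchyDevelopment D, 𝒟.IsMaximal → Summit.FinalStateConjecture.HasCompleteNullInfinity 𝒟.toCauchyDevelopment ∧ ∃ (O : Set 𝒟.carrier) (d : Literature.Geometry.Lorentzian.FinalStateDecomposition 𝒟.toSpacetime O 2), (∀ i, Literature.Geometry.Lorentzian.Kerr.IsSubextremal (d.mass i) (d.spin i)) ∧ O = Summit.FinalStateConjecture.exteriorOf 𝒟.toCauchyDevelopment d.charted ∧ Summit.FinalStateConjecture.RaysStayInClosure 𝒟.toCauchyDevelopment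 O ∧ Summit.FinalStateConjecture.HasExhaustiveCharts d ∧ Summit.FinalStateConjecture.IsFutureOriented d; let Pw0 : Literature.Geometry.Lorentzian.InitialDataSet (𝓡 3) X → Prop := fun D ↦ (∃ 𝒟 : Literature.Geometry.Lorentzian.VacuumCauchyDevelopment D, 𝒟.IsMaximal) ∧ ∀ 𝒟 : Literature.Geometry.Lorentzian.VacuumCauchyDevelopment D, 𝒟.IsMaximal → Summit.FinalStateConjecture.HasCompleteNullInfinity 𝒟.toCauchyDevelopment ∧ ∃ (O : Set 𝒟.carrier) (d : Literature.Geometry.Lorentzian.FinalStateDecomposition 𝒟.toSpacetime O 0), O = Summit.FinalStateConjecture.exteriorOf 𝒟.toCauchyDevelopment d.charted ∧ Summit.FinalStateConjecture.RaysStayInClosure 𝒟.toCauchyDevelopment O ∧ Summit.FinalStateConjecture.HasExhaustiveCharts d ∧ Summit.FinalStateConjecture.IsFutureOriented d; let Disp : Literature.Geometry.Lorentzian.InitialDataSet (𝓡 3) X → Prop := fun D ↦ (∃ 𝒟 : Literature.Geometry.Lorentzian.VacuumCauchyDevelopment D, 𝒟.IsMaximal) ∧ ∀ 𝒟 : Literature.Geometry.Lorentzian.VacuumCauchyDevelopment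 D, 𝒟.IsMaximal → ∀ [𝒟.metric.HasLeviCivita], ¬ 𝒟.metric.IsFutureNullGeodesicallyIncomplete 𝒟.timeOrientation ∧ ¬ 𝒟.metric.IsFutureTimelikeGeodesicallyIncomplete 𝒟.timeOrientation; let Trap : Literature.Geometry.Lorentzian.InitialDataSet (𝓡 3) X → Prop := fun D ↦ (∃ 𝒟 : Literature.Geometry.Lorentzian.VacuumCauchyDevelopment D, 𝒟.IsMaximal) ∧ ∀ 𝒟 : Literature.Geometry.Lorentzian.VacuumCauchyDevelopment D, 𝒟.IsMaximal → ∀ [𝒟.metric.HasLeviCivita], ∃ f : Metric.sphere (0 : Literature.Geometry.Lorentzian.E3) 1 → 𝒟.carrier, Set.range f ⊆ 𝒟.metric.causalFuture 𝒟.timeOrientation (Set.range 𝒟.embed) ∧ 𝒟.metric.IsTrappedSurface (𝓡 2) 𝒟.timeOrientation f; let Cens : Literature.Geometry.Lorentzian.InitialDataSet (𝓡 3) X → Prop := fun D ↦ ∀ 𝒟 : Literature.Geometry.Lorentzian.VacuumCauchyDevelopment D, 𝒟.IsMaximal → Summit.FinalStateConjecture.HasCompleteNullInfinity 𝒟.toCauchyDevelopment;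 let Single : Literature.Geometry.Lorentzian.InitialDataSet (𝓡 3) X → Prop := fun D ↦ ∀ 𝒟 : Literature.Geometry.Lorentzian.VacuumCauchyDevelopment D, 𝒟.IsMaximal → ∀ [𝒟.metric.HasLeviCivita], Subsingleton (ConnectedComponents ↥(Literature.Geometry.Lorentzian.DataEmbedding.blackHoleRegion 𝒟.toDataEmbedding ∩ 𝒟.metric.causalFuture 𝒟.timeOrientation (Set.range 𝒟.embed))); let CenFinF : Literature.Geometry.Lorentzian.InitialDataSet (𝓡 3) X → Prop := fun D ↦ ∀ 𝒟 : Literature.Geometry.Lorentzian.VacuumCauchyDevelopment D, 𝒟.IsMaximal → ∃ n : ℕ, ∀ (X' : Type) [TopologicalSpace X'] [ChartedSpace Literature.Geometry.Lorentzian.E3 X'] [IsManifold (𝓡 3) ((⊤ : ℕ∞) : WithTop ℕ∞) X'] [ConnectedSpace X'] (D' : Literature.Geometry.Lorentzian.InitialDataSet (𝓡 3) X') (ι' : X' → 𝒟.carrier) (ν' : Literature.Geometry.Lorentzian.NormalField (𝓡 4) ι'), Manifold.IsSmoothEmbedding (𝓡 3) (𝓡 4) ((⊤ : ℕ∞) :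 WithTop ℕ∞) ι' → 𝒟.metric.IsFutureUnitNormal (𝓡 3) 𝒟.timeOrientation ι' ν' → (∀ y : X', Literature.Geometry.Lorentzian.pullbackBilin (I := 𝓡 4) (I' := 𝓡 3) ι' 𝒟.metric.val y = D'.h.inner y) → (∀ [𝒟.metric.toPseudoRiemannianMetric.HasLeviCivita] (y : X'), 𝒟.metric.toPseudoRiemannianMetric.secondFundamentalForm (𝓡 3) ι' ν' y = D'.kBilin y) → 𝒟.metric.IsCauchyHypersurface 𝒟.timeOrientation (Set.range ι') → Set.range ι' ⊆ 𝒟.metric.causalFuture 𝒟.timeOrientation (Set.range 𝒟.embed) → ∀ S : Fin (n + 1) → Literature.Geometry.Lorentzian.OutermostMOTS (𝓡 3) D'.h D'.k, (∀ j, ConnectedSpace (S j).surf) → (∀ j, IsCompact (((S j).exterior : Set X'))ᶜ ∧ (interior (((S j).exterior : Set X'))ᶜ).Nonempty) → ∃ j j', j ≠ j' ∧ ((((S j).exterior : Set X'))ᶜ ∩ (((S j').exterior : Set X'))ᶜ).Nonempty; let MassF : (D : Literature.Geometry.Lorentzian.InitialDataSet (𝓡 3) X) → Literature.Geometry.Lorentzian.VacuumCauchyDevelopment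 D → ENNReal := fun D 𝒟 ↦ ⨅ (K : Set 𝒟.carrier) (_ : IsCompact K) (m : ℝ) (_ : 𝒟.toCauchyDevelopment.HasCutBondiMass K m), ENNReal.ofReal m; let AreaF : (D : Literature.Geometry.Lorentzian.InitialDataSet (𝓡 3) X) → (𝒟 : Literature.Geometry.Lorentzian.VacuumCauchyDevelopment D) → [𝒟.metric.HasLeviCivita] → ENNReal := fun D 𝒟 hLC ↦ sInf {a : ENNReal | ∀ (X' : Type) [TopologicalSpace X'] [ChartedSpace Literature.Geometry.Lorentzian.E3 X'] [IsManifold (𝓡 3) ((⊤ : ℕ∞) : WithTop ℕ∞) X'] [ConnectedSpace X'] [T2Space X'] (D' : Literature.Geometry.Lorentzian.InitialDataSet (𝓡 3) X') (ι' : X' → 𝒟.carrier) (ν' : Literature.Geometry.Lorentzian.NormalField (𝓡 4) ι'), Manifold.IsSmoothEmbedding (𝓡 3) (𝓡 4) ((⊤ : ℕ∞) : WithTop ℕ∞) ι' → 𝒟.metric.IsFutureUnitNormal (𝓡 3) 𝒟.timeOrientation ι' ν' → (∀ y : X', Literature.Geometry.Lorentzian.pullbackBilin (I := 𝓡 4)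 (I' := 𝓡 3) ι' 𝒟.metric.val y = D'.h.inner y) → (∀ [𝒟.metric.toPseudoRiemannianMetric.HasLeviCivita] (y : X'), 𝒟.metric.toPseudoRiemannianMetric.secondFundamentalForm (𝓡 3) ι' ν' y = D'.kBilin y) → 𝒟.metric.IsCauchyHypersurface 𝒟.timeOrientation (Set.range ι') → Set.range ι' ⊆ 𝒟.metric.causalFuture 𝒟.timeOrientation (Set.range 𝒟.embed) → (letI : MeasurableSpace X' := borel X'; haveI : BorelSpace X' := ⟨rfl⟩; haveI : LocallyCompactSpace X' := ChartedSpace.locallyCompactSpace Literature.Geometry.Lorentzian.E3 X'; Literature.Geometry.Lorentzian.area D'.h (ι' ⁻¹' Literature.Geometry.Lorentzian.DataEmbedding.futureEventHorizon 𝒟.toDataEmbedding)) ≤ a}; let Acc : Literature.Geometry.Lorentzian.InitialDataSet (𝓡 3) X → Prop := fun D ↦ ∃ (M A : ENNReal), M ≠ ⊤ ∧ (∀ e : Literature.Geometry.Lorentzian.AFEnd X, e.IsAsymptoticallyFlat D 1 → (∃ m, e.HasADMEnergy D m) → M ≤ ENNReal.ofReal (e.admMass D)) ∧ ∀ 𝒟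 : Literature.Geometry.Lorentzian.VacuumCauchyDevelopment D, 𝒟.IsMaximal → ∀ [𝒟.metric.HasLeviCivita], MassF D 𝒟 = M ∧ AreaF D 𝒟 = A; let KN : Literature.Geometry.Lorentzian.InitialDataSet (𝓡 3) X → Prop := fun D ↦ D.IsMaximalData ∧ ∃ (e : Literature.Geometry.Lorentzian.AFEnd X) (M η : ℝ), 0 < η ∧ e.IsSoleEnd ∧ e.IsStronglyAsymptoticallyFlatWith D M (3 / 2 + η) (5 / 2 + η) 4 3; let ST : Literature.Geometry.Lorentzian.InitialDataSet (𝓡 3) X → Prop := fun D ↦ ∃ (e₀ : Literature.Geometry.Lorentzian.AFEnd X) (M : ℝ), e₀.IsSoleEnd ∧ e₀.IsStronglyAsymptoticallyFlatDR D M ∧ 0 < M ∧ ∃ (e : Literature.Geometry.Lorentzian.AFEnd X) (α αm R' : ℝ), 1 / 2 < α ∧ α < 1 ∧ 1 / 2 < αm ∧ e.R ≤ R' ∧ e.IsSoleEnd ∧ Literature.Geometry.Lorentzian.weightedSobolevSeminorm {x : Literature.Geometry.Lorentzian.E3 | R' < ‖x‖} 4 (α - 3 / 2) (fun x ↦ e.hCoeff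 D x - (innerSL ℝ : Literature.Geometry.Lorentzian.E3 →L[ℝ] Literature.Geometry.Lorentzian.E3 →L[ℝ] ℝ)) < ⊤ ∧ Literature.Geometry.Lorentzian.weightedSobolevSeminorm {x : Literature.Geometry.Lorentzian.E3 | R' < ‖x‖} 3 (α - 1 / 2) (fun x ↦ e.kCoeff D x) < ⊤ ∧ Asymptotics.IsBigO (Bornology.cobounded Literature.Geometry.Lorentzian.E3) (fun x : Literature.Geometry.Lorentzian.E3 ↦ ‖e.hCoeff D x - e.hCoeff D (-x)‖) (fun x ↦ ‖x‖ ^ (-αm)) ∧ Asymptotics.IsBigO (Bornology.cobounded Literature.Geometry.Lorentzian.E3) (fun x : Literature.Geometry.Lorentzian.E3 ↦ ‖x‖ * ‖iteratedFDeriv ℝ 1 (fun y ↦ e.hCoeff D y - e.hCoeff D (-y)) x‖) (fun x ↦ ‖x‖ ^ (-αm)) ∧ Asymptotics.IsBigO (Bornology.cobounded Literature.Geometry.Lorentzian.E3) (fun x : Literature.Geometry.Lorentzian.E3 ↦ ‖e.kCoeff D x + e.kCoeff D (-x)‖) (fun x ↦ ‖x‖ ^ (-1 - αm)); ∀ d ∈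 Literature.Geometry.Lorentzian.admissibleVacuumData X, ¬ P d → (((¬ Disp d ∧ Trap d ∧ Cens d ∧ ¬ Pw0 d) ∧ Single d) ∧ CenFinF d) → ((¬ Acc d ∧ ¬ KN d) ∧ ST d) → ∃ (e : Literature.Geometry.Lorentzian.AFEnd X) (F : EuclideanSpace ℝ (Fin 1) → Literature.Geometry.Lorentzian.InitialDataSet (𝓡 3) X), Literature.Geometry.Lorentzian.InitialDataSet.IsTameDataFamily e 1 F ∧ Literature.Geometry.Lorentzian.InitialDataSet.IsImmersedAtZero 1 F ∧ F 0 = d ∧ Injective F ∧ (∀ c, F c ∈ Literature.Geometry.Lorentzian.admissibleVacuumData X) ∧ ∀ c ≠ 0, P (F c)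

-- parent: RoughTailExit · glue (gen 1)
/--     item stmt-FinalStateConjecture-29970 · support · rank 203 · closed · proved by Summit.FinalStateConjecture.FinalStateConjecture.Theorems.RootDecompSobolevLedgerCellsRoughTailExitGlue.roughTailExitGlue (prover)
    parent: RoughTailExit · GLUE: children ⟹ parent · by planner
SobolevAccountDoor → SubSobolevTailExit → RoughTailExit -/
@[route_item "route-FinalStateConjecture-RootDecompSobolevLedgerCells"]
def RoughTailExitGlue : Prop :=
  SobolevAccountDoor → SubSobolevTailExit → RoughTailExit

-- `RoughTailExitGlue` holds: proved by `Summit.FinalStateConjecture.FinalStateConjecture.Theorems.RootDecompSobolevLedgerCellsRoughTailExitGlue.roughTailExitGlue` (its module imports this route file, so no `_holds` link can be stated here).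

/-- item stmt-FinalStateConjecture-28422 · crux · rank 3 · open · by planner
why it might fail: Kerr-compatible books (8πM_f² < A_f ≤ 16πM_f²) do not force convergence: no theorem excludes an eternally non-settling censored exterior whose monotone limits sit on a Kerr curve; the χ̄-margin stability theorems consume slice-norm closeness that monotone limits never supply (caution c4).
sources: arXiv:2104.11857, arXiv:2606.28253, arXiv:2605.18730, arXiv:2205.14808, doi:10.1111/j.1749-6632.1973.tb41447.x
[crux · NEW RESIDUAL · PARKED residual · internal node K of lens-5 g5 «FinalChargeCells» on
stmt-27603] Admissible non-generic data outside the dispersive and threshold cells whose maximal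
developments are censored, trapped, with exactly ONE and finitely many future black holes (the
BoundedSingleExit population) AND whose asymptotic books close MGHD-coherently (Acc: a final Bondi
rest mass MassF = inf over asymptotically round receding families of Hawking-mass limits, ≤ m_ADM in
every AF chart, and a final horizon area AreaF = sup over future Cauchy cuts of area(Σ′ ∩ 𝓗⁺)) with
the books in the KERR BAND 8π·MassF² < AreaF ≤ 16π·MassF² (KerrB), exit tamely with codimension ≥ 1.
The candidate final Kerr (M_f, χ_f) is PINNED by two monotone scalars (χ_f read off A =
8πM²(1+√(1−χ²))); what remains is a pure RATE statement: convergence of the censored exterior to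
that Kerr — the large-data Kerr stability problem proper. RE-PARKED by the critic (05:09:06Z):
χ-band sub-splits are exact and window-free but decorative under caution c4 until a «charge ⇒
slice-norm» rung exists. Instrumentable (NR reads M_f, A_f). Domination: 27603 ⟺ K ∧ Dr ∧ L ∧ H ∧ N
(lens kernel boundedSingleExit_iff_cells) -/
@[route_item "route-FinalStateConjecture-RootDecompSobolevLedgerCells", crux]
def SubextremalChargeExit : Prop :=
  ∀ (X : Type) [TopologicalSpace X] [ChartedSpace Literature.Geometry.Lorentzian.E3 X] [IsManifold (𝓡 3) ((⊤ : ℕ∞) : WithTop ℕ∞) X] [T2Space X] [SecondCountableTopology X] [ConnectedSpace X], let P : Literature.Geometry.Lorentzian.InitialDataSet (𝓡 3) X → Prop := fun D ↦ (∃ 𝒟 : Literature.Geometry.Lorentzian.VacuumCauchyDevelopment D, 𝒟.IsMaximal) ∧ ∀ 𝒟 : Literature.Geometry.Lorentzian.VacuumCauchyDevelopment D, 𝒟.IsMaximal → Summit.FinalStateConjecture.HasCompleteNullInfinity 𝒟.toCauchyDevelopment ∧ ∃ (O : Set 𝒟.carrier) (d : Literature.Geometry.Lorentzian.FinalStateDecomposition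 𝒟.toSpacetime O 2), (∀ i, Literature.Geometry.Lorentzian.Kerr.IsSubextremal (d.mass i) (d.spin i)) ∧ O = Summit.FinalStateConjecture.exteriorOf 𝒟.toCauchyDevelopment d.charted ∧ Summit.FinalStateConjecture.RaysStayInClosure 𝒟.toCauchyDevelopment O ∧ Summit.FinalStateConjecture.HasExhaustiveCharts d ∧ Summit.FinalStateConjecture.IsFutureOriented d; let Pw0 : Literature.Geometry.Lorentzian.InitialDataSet (𝓡 3) X → Prop := fun D ↦ (∃ 𝒟 : Literature.Geometry.Lorentzian.VacuumCauchyDevelopment D, 𝒟.IsMaximal) ∧ ∀ 𝒟 : Literature.Geometry.Lorentzian.VacuumCauchyDevelopment D, 𝒟.IsMaximal → Summit.FinalStateConjecture.HasCompleteNullInfinity 𝒟.toCauchyDevelopment ∧ ∃ (O : Set 𝒟.carrier) (d : Literature.Geometry.Lorentzian.FinalStateDecomposition 𝒟.toSpacetime O 0), O = Summit.FinalStateConjecture.exteriorOf 𝒟.toCauchyDevelopment d.charted ∧ Summit.FinalStateConjecture.RaysStayInClosure 𝒟.toCauchyDevelopment O ∧ Summit.FinalStateConjecture.HasExhaustiveCharts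 d ∧ Summit.FinalStateConjecture.IsFutureOriented d; let Disp : Literature.Geometry.Lorentzian.InitialDataSet (𝓡 3) X → Prop := fun D ↦ (∃ 𝒟 : Literature.Geometry.Lorentzian.VacuumCauchyDevelopment D, 𝒟.IsMaximal) ∧ ∀ 𝒟 : Literature.Geometry.Lorentzian.VacuumCauchyDevelopment D, 𝒟.IsMaximal → ∀ [𝒟.metric.HasLeviCivita], ¬ 𝒟.metric.IsFutureNullGeodesicallyIncomplete 𝒟.timeOrientation ∧ ¬ 𝒟.metric.IsFutureTimelikeGeodesicallyIncomplete 𝒟.timeOrientation; let Trap : Literature.Geometry.Lorentzian.InitialDataSet (𝓡 3) X → Prop := fun D ↦ (∃ 𝒟 : Literature.Geometry.Lorentzian.VacuumCauchyDevelopment D, 𝒟.IsMaximal) ∧ ∀ 𝒟 : Literature.Geometry.Lorentzian.VacuumCauchyDevelopment D, 𝒟.IsMaximal → ∀ [𝒟.metric.HasLeviCivita], ∃ f : Metric.sphere (0 : Literature.Geometry.Lorentzian.E3) 1 → 𝒟.carrier, Set.range f ⊆ 𝒟.metric.causalFuture 𝒟.timeOrientation (Set.range 𝒟.embed) ∧ 𝒟.metric.IsTrappedSurface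 (𝓡 2) 𝒟.timeOrientation f; let Cens : Literature.Geometry.Lorentzian.InitialDataSet (𝓡 3) X → Prop := fun D ↦ ∀ 𝒟 : Literature.Geometry.Lorentzian.VacuumCauchyDevelopment D, 𝒟.IsMaximal → Summit.FinalStateConjecture.HasCompleteNullInfinity 𝒟.toCauchyDevelopment; let Single : Literature.Geometry.Lorentzian.InitialDataSet (𝓡 3) X → Prop := fun D ↦ ∀ 𝒟 : Literature.Geometry.Lorentzian.VacuumCauchyDevelopment D, 𝒟.IsMaximal → ∀ [𝒟.metric.HasLeviCivita], Subsingleton (ConnectedComponents ↥(Literature.Geometry.Lorentzian.DataEmbedding.blackHoleRegion 𝒟.toDataEmbedding ∩ 𝒟.metric.causalFuture 𝒟.timeOrientation (Set.range 𝒟.embed))); let CenFinF : Literature.Geometry.Lorentzian.InitialDataSet (𝓡 3) X → Prop := fun D ↦ ∀ 𝒟 : Literature.Geometry.Lorentzian.VacuumCauchyDevelopment D, 𝒟.IsMaximal → ∃ n : ℕ, ∀ (X' : Type) [TopologicalSpace X'] [ChartedSpace Literature.Geometry.Lorentzian.E3 X'] [IsManifold (𝓡 3) ((⊤ : ℕ∞)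 : WithTop ℕ∞) X'] [ConnectedSpace X'] (D' : Literature.Geometry.Lorentzian.InitialDataSet (𝓡 3) X') (ι' : X' → 𝒟.carrier) (ν' : Literature.Geometry.Lorentzian.NormalField (𝓡 4) ι'), Manifold.IsSmoothEmbedding (𝓡 3) (𝓡 4) ((⊤ : ℕ∞) : WithTop ℕ∞) ι' → 𝒟.metric.IsFutureUnitNormal (𝓡 3) 𝒟.timeOrientation ι' ν' → (∀ y : X', Literature.Geometry.Lorentzian.pullbackBilin (I := 𝓡 4) (I' := 𝓡 3) ι' 𝒟.metric.val y = D'.h.inner y) → (∀ [𝒟.metric.toPseudoRiemannianMetric.HasLeviCivita] (y : X'), 𝒟.metric.toPseudoRiemannianMetric.secondFundamentalForm (𝓡 3) ι' ν' y = D'.kBilin y) → 𝒟.metric.IsCauchyHypersurface 𝒟.timeOrientation (Set.range ι') → Set.range ι' ⊆ 𝒟.metric.causalFuture 𝒟.timeOrientation (Set.range 𝒟.embed) → ∀ S : Fin (n + 1) → Literature.Geometry.Lorentzian.OutermostMOTS (𝓡 3) D'.h D'.k, (∀ j, ConnectedSpace (S j).surf) → (∀ j, IsCompact (((S j).exterior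 : Set X'))ᶜ ∧ (interior (((S j).exterior : Set X'))ᶜ).Nonempty) → ∃ j j', j ≠ j' ∧ ((((S j).exterior : Set X'))ᶜ ∩ (((S j').exterior : Set X'))ᶜ).Nonempty; let kerrLo : ENNReal → ENNReal := fun M ↦ ENNReal.ofReal (8 * Real.pi) * M ^ 2; let kerrHi : ENNReal → ENNReal := fun M ↦ ENNReal.ofReal (16 * Real.pi) * M ^ 2; let MassF : (D : Literature.Geometry.Lorentzian.InitialDataSet (𝓡 3) X) → Literature.Geometry.Lorentzian.VacuumCauchyDevelopment D → ENNReal := fun D 𝒟 ↦ ⨅ (K : Set 𝒟.carrier) (_ : IsCompact K) (m : ℝ) (_ : 𝒟.toCauchyDevelopment.HasCutBondiMass K m), ENNReal.ofReal m; let AreaF : (D : Literature.Geometry.Lorentzian.InitialDataSet (𝓡 3) X) → (𝒟 : Literature.Geometry.Lorentzian.VacuumCauchyDevelopment D) → [𝒟.metric.HasLeviCivita] → ENNReal := fun D 𝒟 hLC ↦ sInf {a : ENNReal | ∀ (X' : Type) [TopologicalSpace X'] [ChartedSpace Literature.Geometry.Lorentzian.E3 X'] [IsManifold (𝓡 3)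 ((⊤ : ℕ∞) : WithTop ℕ∞) X'] [ConnectedSpace X'] [T2Space X'] (D' : Literature.Geometry.Lorentzian.InitialDataSet (𝓡 3) X') (ι' : X' → 𝒟.carrier) (ν' : Literature.Geometry.Lorentzian.NormalField (𝓡 4) ι'), Manifold.IsSmoothEmbedding (𝓡 3) (𝓡 4) ((⊤ : ℕ∞) : WithTop ℕ∞) ι' → 𝒟.metric.IsFutureUnitNormal (𝓡 3) 𝒟.timeOrientation ι' ν' → (∀ y : X', Literature.Geometry.Lorentzian.pullbackBilin (I := 𝓡 4) (I' := 𝓡 3) ι' 𝒟.metric.val y = D'.h.inner y) → (∀ [𝒟.metric.toPseudoRiemannianMetric.HasLeviCivita] (y : X'), 𝒟.metric.toPseudoRiemannianMetric.secondFundamentalForm (𝓡 3) ι' ν' y = D'.kBilin y) → 𝒟.metric.IsCauchyHypersurface 𝒟.timeOrientation (Set.range ι') → Set.range ι' ⊆ 𝒟.metric.causalFuture 𝒟.timeOrientation (Set.range 𝒟.embed) → (letI : MeasurableSpace X' := borel X'; haveI : BorelSpace X' := ⟨rfl⟩; haveI : LocallyCompactSpace X' := ChartedSpace.locallyCompactSpace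 Literature.Geometry.Lorentzian.E3 X'; Literature.Geometry.Lorentzian.area D'.h (ι' ⁻¹' Literature.Geometry.Lorentzian.DataEmbedding.futureEventHorizon 𝒟.toDataEmbedding)) ≤ a}; let Acc : Literature.Geometry.Lorentzian.InitialDataSet (𝓡 3) X → Prop := fun D ↦ ∃ (M A : ENNReal), M ≠ ⊤ ∧ (∀ e : Literature.Geometry.Lorentzian.AFEnd X, e.IsAsymptoticallyFlat D 1 → (∃ m, e.HasADMEnergy D m) → M ≤ ENNReal.ofReal (e.admMass D)) ∧ ∀ 𝒟 : Literature.Geometry.Lorentzian.VacuumCauchyDevelopment D, 𝒟.IsMaximal → ∀ [𝒟.metric.HasLeviCivita], MassF D 𝒟 = M ∧ AreaF D 𝒟 = A; let KerrB : Literature.Geometry.Lorentzian.InitialDataSet (𝓡 3) X → Prop := fun D ↦ ∀ 𝒟 : Literature.Geometry.Lorentzian.VacuumCauchyDevelopment D, 𝒟.IsMaximal → ∀ [𝒟.metric.HasLeviCivita], MassF D 𝒟 ≠ ⊤ ∧ kerrLo (MassF D 𝒟) < AreaF D 𝒟 ∧ AreaF D 𝒟 ≤ kerrHi (MassF D 𝒟);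 ∀ d ∈ Literature.Geometry.Lorentzian.admissibleVacuumData X, ¬ P d → (((¬ Disp d ∧ Trap d ∧ Cens d ∧ ¬ Pw0 d) ∧ Single d) ∧ CenFinF d) → (Acc d ∧ KerrB d) → ∃ (e : Literature.Geometry.Lorentzian.AFEnd X) (F : EuclideanSpace ℝ (Fin 1) → Literature.Geometry.Lorentzian.InitialDataSet (𝓡 3) X), Literature.Geometry.Lorentzian.InitialDataSet.IsTameDataFamily e 1 F ∧ Literature.Geometry.Lorentzian.InitialDataSet.IsImmersedAtZero 1 F ∧ F 0 = d ∧ Injective F ∧ (∀ c, F c ∈ Literature.Geometry.Lorentzian.admissibleVacuumData X) ∧ ∀ c ≠ 0, P (F c)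

/-- item stmt-FinalStateConjecture-28424 · crux · rank 4 · open · by planner
why it might fail: Extremal horizons DO form dynamically in finite time for Einstein–Maxwell–charged matter (Kehle–Unger); a vacuum analogue A_f = 8πM_f², or an eternal non-radiating exterior reservoir giving A_f < 8πM_f², is excluded by no theorem (no-periodic results need analyticity/stationarity near 𝓘).
sources: arXiv:2211.15742, arXiv:2402.10190, arXiv:1504.04592, arXiv:1008.0248
[crux · SPECIAL-TYPE · leaf L of lens-5 g5 on stmt-27603] Same population with Acc ∧ ¬KerrB ∧ HeavyB
∧ ¬Hor: the books are at or below the extremal Kerr line (AreaF ≤ 8π·MassF²) and NO honest outermost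
horizon of area ≥ 16π(0.81)m² is available — the EXTREMAL END STATE corner (A_f = 8πM_f²: dynamical
formation of an extremal vacuum horizon) together with the «massive eternal exterior reservoir»
corner (A_f < 8πM_f² with mass that never radiates nor falls in): exit tamely with codimension ≥ 1.
IDEA-NEEDED: a vacuum third law / no-reservoir theorem (Kehle–Unger arXiv:2211.15742 shows extremal
horizons DO form in finite time for Einstein–Maxwell–charged matter; vacuum open; no-periodic
results arXiv:1504.04592, arXiv:1008.0248 need stationarity/analyticity near 𝓘). Mechanism disjoint
from K (rate), H (Penrose inequality), N (Bondi account). -/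
@[route_item "route-FinalStateConjecture-RootDecompSobolevLedgerCells", crux]
def HeavyChargeExit : Prop :=
  ∀ (X : Type) [TopologicalSpace X] [ChartedSpace Literature.Geometry.Lorentzian.E3 X] [IsManifold (𝓡 3) ((⊤ : ℕ∞) : WithTop ℕ∞) X] [T2Space X] [SecondCountableTopology X] [ConnectedSpace X], let P : Literature.Geometry.Lorentzian.InitialDataSet (𝓡 3) X → Prop := fun D ↦ (∃ 𝒟 : Literature.Geometry.Lorentzian.VacuumCauchyDevelopment D, 𝒟.IsMaximal) ∧ ∀ 𝒟 : Literature.Geometry.Lorentzian.VacuumCauchyDevelopment D, 𝒟.IsMaximal → Summit.FinalStateConjecture.HasCompleteNullInfinity 𝒟.toCauchyDevelopment ∧ ∃ (O : Set 𝒟.carrier) (d : Literature.Geometry.Lorentzian.FinalStateDecomposition 𝒟.toSpacetime O 2), (∀ i, Literature.Geometry.Lorentzian.Kerr.IsSubextremal (d.mass i) (d.spin i)) ∧ O = Summit.FinalStateConjecture.exteriorOf 𝒟.toCauchyDevelopment d.charted ∧ Summit.FinalStateConjecture.RaysStayInClosure 𝒟.toCauchyDevelopment O ∧ Summit.FinalStateConjecture.HasExhaustiveCharts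 d ∧ Summit.FinalStateConjecture.IsFutureOriented d; let Pw0 : Literature.Geometry.Lorentzian.InitialDataSet (𝓡 3) X → Prop := fun D ↦ (∃ 𝒟 : Literature.Geometry.Lorentzian.VacuumCauchyDevelopment D, 𝒟.IsMaximal) ∧ ∀ 𝒟 : Literature.Geometry.Lorentzian.VacuumCauchyDevelopment D, 𝒟.IsMaximal → Summit.FinalStateConjecture.HasCompleteNullInfinity 𝒟.toCauchyDevelopment ∧ ∃ (O : Set 𝒟.carrier) (d : Literature.Geometry.Lorentzian.FinalStateDecomposition 𝒟.toSpacetime O 0), O = Summit.FinalStateConjecture.exteriorOf 𝒟.toCauchyDevelopment d.charted ∧ Summit.FinalStateConjecture.RaysStayInClosure 𝒟.toCauchyDevelopment O ∧ Summit.FinalStateConjecture.HasExhaustiveCharts d ∧ Summit.FinalStateConjecture.IsFutureOriented d; let Disp : Literature.Geometry.Lorentzian.InitialDataSet (𝓡 3) X → Prop := fun D ↦ (∃ 𝒟 : Literature.Geometry.Lorentzian.VacuumCauchyDevelopment D, 𝒟.IsMaximal) ∧ ∀ 𝒟 : Literature.Geometry.Lorentzian.VacuumCauchyDevelopment D, 𝒟.IsMaximal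 → ∀ [𝒟.metric.HasLeviCivita], ¬ 𝒟.metric.IsFutureNullGeodesicallyIncomplete 𝒟.timeOrientation ∧ ¬ 𝒟.metric.IsFutureTimelikeGeodesicallyIncomplete 𝒟.timeOrientation; let Trap : Literature.Geometry.Lorentzian.InitialDataSet (𝓡 3) X → Prop := fun D ↦ (∃ 𝒟 : Literature.Geometry.Lorentzian.VacuumCauchyDevelopment D, 𝒟.IsMaximal) ∧ ∀ 𝒟 : Literature.Geometry.Lorentzian.VacuumCauchyDevelopment D, 𝒟.IsMaximal → ∀ [𝒟.metric.HasLeviCivita], ∃ f : Metric.sphere (0 : Literature.Geometry.Lorentzian.E3) 1 → 𝒟.carrier, Set.range f ⊆ 𝒟.metric.causalFuture 𝒟.timeOrientation (Set.range 𝒟.embed) ∧ 𝒟.metric.IsTrappedSurface (𝓡 2) 𝒟.timeOrientation f; let Cens : Literature.Geometry.Lorentzian.InitialDataSet (𝓡 3) X → Prop := fun D ↦ ∀ 𝒟 : Literature.Geometry.Lorentzian.VacuumCauchyDevelopment D, 𝒟.IsMaximal → Summit.FinalStateConjecture.HasCompleteNullInfinity 𝒟.toCauchyDevelopment; let Single :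 Literature.Geometry.Lorentzian.InitialDataSet (𝓡 3) X → Prop := fun D ↦ ∀ 𝒟 : Literature.Geometry.Lorentzian.VacuumCauchyDevelopment D, 𝒟.IsMaximal → ∀ [𝒟.metric.HasLeviCivita], Subsingleton (ConnectedComponents ↥(Literature.Geometry.Lorentzian.DataEmbedding.blackHoleRegion 𝒟.toDataEmbedding ∩ 𝒟.metric.causalFuture 𝒟.timeOrientation (Set.range 𝒟.embed))); let CenFinF : Literature.Geometry.Lorentzian.InitialDataSet (𝓡 3) X → Prop := fun D ↦ ∀ 𝒟 : Literature.Geometry.Lorentzian.VacuumCauchyDevelopment D, 𝒟.IsMaximal → ∃ n : ℕ, ∀ (X' : Type) [TopologicalSpace X'] [ChartedSpace Literature.Geometry.Lorentzian.E3 X'] [IsManifold (𝓡 3) ((⊤ : ℕ∞) : WithTop ℕ∞) X'] [ConnectedSpace X'] (D' : Literature.Geometry.Lorentzian.InitialDataSet (𝓡 3) X') (ι' : X' → 𝒟.carrier) (ν' : Literature.Geometry.Lorentzian.NormalField (𝓡 4) ι'), Manifold.IsSmoothEmbedding (𝓡 3) (𝓡 4) ((⊤ : ℕ∞) : WithTop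 ℕ∞) ι' → 𝒟.metric.IsFutureUnitNormal (𝓡 3) 𝒟.timeOrientation ι' ν' → (∀ y : X', Literature.Geometry.Lorentzian.pullbackBilin (I := 𝓡 4) (I' := 𝓡 3) ι' 𝒟.metric.val y = D'.h.inner y) → (∀ [𝒟.metric.toPseudoRiemannianMetric.HasLeviCivita] (y : X'), 𝒟.metric.toPseudoRiemannianMetric.secondFundamentalForm (𝓡 3) ι' ν' y = D'.kBilin y) → 𝒟.metric.IsCauchyHypersurface 𝒟.timeOrientation (Set.range ι') → Set.range ι' ⊆ 𝒟.metric.causalFuture 𝒟.timeOrientation (Set.range 𝒟.embed) → ∀ S : Fin (n + 1) → Literature.Geometry.Lorentzian.OutermostMOTS (𝓡 3) D'.h D'.k, (∀ j, ConnectedSpace (S j).surf) → (∀ j, IsCompact (((S j).exterior : Set X'))ᶜ ∧ (interior (((S j).exterior : Set X'))ᶜ).Nonempty) → ∃ j j', j ≠ j' ∧ ((((S j).exterior : Set X'))ᶜ ∩ (((S j').exterior : Set X'))ᶜ).Nonempty; let kerrLo : ENNReal → ENNReal := fun M ↦ ENNReal.ofReal (8 * Real.pi) * M ^ 2; let kerrHi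 : ENNReal → ENNReal := fun M ↦ ENNReal.ofReal (16 * Real.pi) * M ^ 2; let MassF : (D : Literature.Geometry.Lorentzian.InitialDataSet (𝓡 3) X) → Literature.Geometry.Lorentzian.VacuumCauchyDevelopment D → ENNReal := fun D 𝒟 ↦ ⨅ (K : Set 𝒟.carrier) (_ : IsCompact K) (m : ℝ) (_ : 𝒟.toCauchyDevelopment.HasCutBondiMass K m), ENNReal.ofReal m; let AreaF : (D : Literature.Geometry.Lorentzian.InitialDataSet (𝓡 3) X) → (𝒟 : Literature.Geometry.Lorentzian.VacuumCauchyDevelopment D) → [𝒟.metric.HasLeviCivita] → ENNReal := fun D 𝒟 hLC ↦ sInf {a : ENNReal | ∀ (X' : Type) [TopologicalSpace X'] [ChartedSpace Literature.Geometry.Lorentzian.E3 X'] [IsManifold (𝓡 3) ((⊤ : ℕ∞) : WithTop ℕ∞) X'] [ConnectedSpace X'] [T2Space X'] (D' : Literature.Geometry.Lorentzian.InitialDataSet (𝓡 3) X') (ι' : X' → 𝒟.carrier) (ν' : Literature.Geometry.Lorentzian.NormalField (𝓡 4) ι'), Manifold.IsSmoothEmbedding (𝓡 3) (𝓡 4)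 ((⊤ : ℕ∞) : WithTop ℕ∞) ι' → 𝒟.metric.IsFutureUnitNormal (𝓡 3) 𝒟.timeOrientation ι' ν' → (∀ y : X', Literature.Geometry.Lorentzian.pullbackBilin (I := 𝓡 4) (I' := 𝓡 3) ι' 𝒟.metric.val y = D'.h.inner y) → (∀ [𝒟.metric.toPseudoRiemannianMetric.HasLeviCivita] (y : X'), 𝒟.metric.toPseudoRiemannianMetric.secondFundamentalForm (𝓡 3) ι' ν' y = D'.kBilin y) → 𝒟.metric.IsCauchyHypersurface 𝒟.timeOrientation (Set.range ι') → Set.range ι' ⊆ 𝒟.metric.causalFuture 𝒟.timeOrientation (Set.range 𝒟.embed) → (letI : MeasurableSpace X' := borel X'; haveI : BorelSpace X' := ⟨rfl⟩; haveI : LocallyCompactSpace X' := ChartedSpace.locallyCompactSpace Literature.Geometry.Lorentzian.E3 X'; Literature.Geometry.Lorentzian.area D'.h (ι' ⁻¹' Literature.Geometry.Lorentzian.DataEmbedding.futureEventHorizon 𝒟.toDataEmbedding)) ≤ a}; let Acc : Literature.Geometry.Lorentzian.InitialDataSet (𝓡 3) X → Prop := fun D ↦ ∃ (M A : ENNReal),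 M ≠ ⊤ ∧ (∀ e : Literature.Geometry.Lorentzian.AFEnd X, e.IsAsymptoticallyFlat D 1 → (∃ m, e.HasADMEnergy D m) → M ≤ ENNReal.ofReal (e.admMass D)) ∧ ∀ 𝒟 : Literature.Geometry.Lorentzian.VacuumCauchyDevelopment D, 𝒟.IsMaximal → ∀ [𝒟.metric.HasLeviCivita], MassF D 𝒟 = M ∧ AreaF D 𝒟 = A; let KerrB : Literature.Geometry.Lorentzian.InitialDataSet (𝓡 3) X → Prop := fun D ↦ ∀ 𝒟 : Literature.Geometry.Lorentzian.VacuumCauchyDevelopment D, 𝒟.IsMaximal → ∀ [𝒟.metric.HasLeviCivita], MassF D 𝒟 ≠ ⊤ ∧ kerrLo (MassF D 𝒟) < AreaF D 𝒟 ∧ AreaF D 𝒟 ≤ kerrHi (MassF D 𝒟); let HeavyB : Literature.Geometry.Lorentzian.InitialDataSet (𝓡 3) X → Prop := fun D ↦ ∀ 𝒟 : Literature.Geometry.Lorentzian.VacuumCauchyDevelopment D, 𝒟.IsMaximal → ∀ [𝒟.metric.HasLeviCivita], MassF D 𝒟 ≠ ⊤ ∧ AreaF D 𝒟 ≤ kerrLo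 (MassF D 𝒟); let Hor : Literature.Geometry.Lorentzian.InitialDataSet (𝓡 3) X → Prop := fun D ↦ ∃ (hLC : D.metric.HasLeviCivita) (e : Literature.Geometry.Lorentzian.AFEnd X) (S : Literature.Geometry.Lorentzian.OutermostMOTS (𝓡 3) D.h D.k), haveI : (Literature.Geometry.Lorentzian.PseudoRiemannianMetric.ofRiemannian D.h).HasLeviCivita := hLC; let IsExteriorRegion : TopologicalSpace.Opens X → Prop := fun U ↦ IsConnected (U : Set X) ∧ ∃ R', e.R < R' ∧ e.far R' ⊆ (U : Set X) ∧ IsCompact (closure (U : Set X) \ e.far R'); let IsOutsideOf : TopologicalSpace.Opens X → (S' : Type) → (f' : S' → X) → Literature.Geometry.Lorentzian.NormalField (𝓡 3) f' → Prop := fun U _ f' ν' ↦ frontier (U : Set X) = Set.range f' ∧ (∀ y, ∀ᶠ t in nhdsWithin (0 : ℝ) (Set.Ioi 0), Literature.Geometry.Lorentzian.curveThrough (𝓡 3) (f' y) (ν' y) t ∈ (U : Set X)) ∧ (∀ y, ∀ᶠ t in nhdsWithin (0 : ℝ) (Set.Iio 0), Literature.Geometry.Lorentzian.curveThrough (𝓡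 3) (f' y) (ν' y) t ∉ closure (U : Set X)) ∧ IsExteriorRegion U; let IsCalS : TopologicalSpace.Opens X → Prop := fun V ↦ ∃ (S' : Type) (_ : TopologicalSpace S') (_ : ChartedSpace (EuclideanSpace ℝ (Fin 2)) S') (_ : IsManifold (𝓡 2) ((⊤ : ℕ∞) : WithTop ℕ∞) S') (_ : CompactSpace S') (_ : T2Space S') (f' : S' → X) (ν' : Literature.Geometry.Lorentzian.NormalField (𝓡 3) f'), Manifold.IsSmoothEmbedding (𝓡 2) (𝓡 3) ((⊤ : ℕ∞) : WithTop ℕ∞) f' ∧ (Literature.Geometry.Lorentzian.PseudoRiemannianMetric.ofRiemannian D.h).IsUnitNormal (𝓡 2) f' ν' 1 ∧ IsOutsideOf V S' f' ν'; let WOTFree : TopologicalSpace.Opens X → Prop := fun U ↦ ∀ (S' : Type) [TopologicalSpace S'] [ChartedSpace (EuclideanSpace ℝ (Fin 2)) S'] [IsManifold (𝓡 2) ((⊤ : ℕ∞) : WithTop ℕ∞) S'] [CompactSpace S'] [T2Space S'] (f' : S' → X) (ν' : Literature.Geometry.Lorentzian.NormalField (𝓡 3) f') (hpb' : Literature.Geometry.Lorentzian.PseudoRiemannianMetric.contMDiff_pullbackBilin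 (𝓡 3) X (𝓡 2) S' ((⊤ : ℕ∞) : WithTop ℕ∞)) (hf' : (Literature.Geometry.Lorentzian.PseudoRiemannianMetric.ofRiemannian D.h).IsSpacelikeImmersion (𝓡 2) f') (Ω : TopologicalSpace.Opens X), Manifold.IsSmoothEmbedding (𝓡 2) (𝓡 3) ((⊤ : ℕ∞) : WithTop ℕ∞) f' → Set.range f' ⊆ (U : Set X) → (Literature.Geometry.Lorentzian.PseudoRiemannianMetric.ofRiemannian D.h).IsUnitNormal (𝓡 2) f' ν' 1 → Nonempty S' → frontier (Ω : Set X) = Set.range f' → (∃ R', e.R < R' ∧ Disjoint (e.far R') (Ω : Set X)) → (∀ y, ∀ᶠ t in nhdsWithin (0 : ℝ) (Set.Iio 0), Literature.Geometry.Lorentzian.curveThrough (𝓡 3) (f' y) (ν' y) t ∈ (Ω : Set X)) → ¬ Literature.Geometry.Lorentzian.IsWeaklyOuterTrapped D.h D.k f' hpb' hf' ν'; ContMDiff (𝓡 2) (𝓡 3).tangent ((⊤ : ℕ∞) : WithTop ℕ∞) (fun y ↦ (Bundle.TotalSpace.mk' Literature.Geometry.Lorentzian.E3 (S.f y) (S.ν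 y) : TangentBundle (𝓡 3) X)) ∧ D.SatisfiesDominantEnergyCondition ∧ e.IsAsymptoticallyFlat D 1 ∧ D.IsComplete ∧ (∃ m, e.HasADMEnergy D m) ∧ (∀ i, ∃ p, e.HasADMMomentum D i p) ∧ WOTFree S.exterior ∧ IsOutsideOf S.exterior S.surf S.f S.ν ∧ 0 < e.admMass D ∧ (letI : MeasurableSpace X := borel X; haveI : BorelSpace X := ⟨rfl⟩; haveI : LocallyCompactSpace X := ChartedSpace.locallyCompactSpace Literature.Geometry.Lorentzian.E3 X; (9 / 10 : ℝ) * e.admMass D ≤ Real.sqrt ((⨅ (V : TopologicalSpace.Opens X) (_ : IsCalS V ∧ V ≤ S.exterior), Literature.Geometry.Lorentzian.area D.h (frontier (V : Set X))).toReal / (16 * Real.pi))); ∀ d ∈ Literature.Geometry.Lorentzian.admissibleVacuumData X, ¬ P d → (((¬ Disp d ∧ Trap d ∧ Cens d ∧ ¬ Pw0 d) ∧ Single d) ∧ CenFinF d) → (Acc d ∧ ¬ KerrB d ∧ HeavyB d ∧ ¬ Hor d) → ∃ (e : Literature.Geometry.Lorentzian.AFEnd X) (F : EuclideanSpace ℝ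 (Fin 1) → Literature.Geometry.Lorentzian.InitialDataSet (𝓡 3) X), Literature.Geometry.Lorentzian.InitialDataSet.IsTameDataFamily e 1 F ∧ Literature.Geometry.Lorentzian.InitialDataSet.IsImmersedAtZero 1 F ∧ F 0 = d ∧ Injective F ∧ (∀ c, F c ∈ Literature.Geometry.Lorentzian.admissibleVacuumData X) ∧ ∀ c ≠ 0, P (F c)

/-- item stmt-FinalStateConjecture-28425 · crux · rank 5 · open · by planner
why it might fail: M_f ≥ √(A_f/16π) for the LIMITING Bondi mass is Penrose's stronger spacetime statement, proved only near Schwarzschild (Alexakis; Le) or under a quasi-final-state hypothesis (2026); a censored development whose horizon area outgrows 16πM_f² contradicts no theorem.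
sources: arXiv:1506.06400, arXiv:2605.18730, arXiv:1609.02875, arXiv:2404.17137, arXiv:2505.11399
[crux · IDEA-NEEDED · leaf H of lens-5 g5 on stmt-27603] Same population with Acc ∧ AreaF >
16π·MassF² (the books ABOVE the Schwarzschild line: more final horizon area than any Kerr of the
final Bondi mass can carry): exit tamely with codimension ≥ 1. Conjecturally EMPTY by the
LIMITING-BONDI-MASS (null, late-time) PENROSE INEQUALITY M_f ≥ √(A_f/16π) — Penrose's stronger
spacetime statement, in print only near Schwarzschild (Alexakis arXiv:1506.06400; Le
arXiv:2404.17137; Roesch arXiv:1609.02875) or under a quasi-final-state hypothesis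
(arXiv:2605.18730); print-adjacent idea-leaf, PDE-light relative to K. -/
@[route_item "route-FinalStateConjecture-RootDecompSobolevLedgerCells", crux]
def LightChargeExit : Prop :=
  ∀ (X : Type) [TopologicalSpace X] [ChartedSpace Literature.Geometry.Lorentzian.E3 X] [IsManifold (𝓡 3) ((⊤ : ℕ∞) : WithTop ℕ∞) X] [T2Space X] [SecondCountableTopology X] [ConnectedSpace X], let P : Literature.Geometry.Lorentzian.InitialDataSet (𝓡 3) X → Prop := fun D ↦ (∃ 𝒟 : Literature.Geometry.Lorentzian.VacuumCauchyDevelopment D, 𝒟.IsMaximal) ∧ ∀ 𝒟 : Literature.Geometry.Lorentzian.VacuumCauchyDevelopment D, 𝒟.IsMaximal → Summit.FinalStateConjecture.HasCompleteNullInfinity 𝒟.toCauchyDevelopment ∧ ∃ (O : Set 𝒟.carrier) (d : Literature.Geometry.Lorentzian.FinalStateDecomposition 𝒟.toSpacetime O 2), (∀ i, Literature.Geometry.Lorentzian.Kerr.IsSubextremal (d.mass i) (d.spin i)) ∧ O = Summit.FinalStateConjecture.exteriorOf 𝒟.toCauchyDevelopment d.charted ∧ Summit.FinalStateConjecture.RaysStayInClosure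 𝒟.toCauchyDevelopment O ∧ Summit.FinalStateConjecture.HasExhaustiveCharts d ∧ Summit.FinalStateConjecture.IsFutureOriented d; let Pw0 : Literature.Geometry.Lorentzian.InitialDataSet (𝓡 3) X → Prop := fun D ↦ (∃ 𝒟 : Literature.Geometry.Lorentzian.VacuumCauchyDevelopment D, 𝒟.IsMaximal) ∧ ∀ 𝒟 : Literature.Geometry.Lorentzian.VacuumCauchyDevelopment D, 𝒟.IsMaximal → Summit.FinalStateConjecture.HasCompleteNullInfinity 𝒟.toCauchyDevelopment ∧ ∃ (O : Set 𝒟.carrier) (d : Literature.Geometry.Lorentzian.FinalStateDecomposition 𝒟.toSpacetime O 0), O = Summit.FinalStateConjecture.exteriorOf 𝒟.toCauchyDevelopment d.charted ∧ Summit.FinalStateConjecture.RaysStayInClosure 𝒟.toCauchyDevelopment O ∧ Summit.FinalStateConjecture.HasExhaustiveCharts d ∧ Summit.FinalStateConjecture.IsFutureOriented d; let Disp : Literature.Geometry.Lorentzian.InitialDataSet (𝓡 3) X → Prop := fun D ↦ (∃ 𝒟 : Literature.Geometry.Lorentzian.VacuumCauchyDevelopment D, 𝒟.IsMaximal) ∧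 ∀ 𝒟 : Literature.Geometry.Lorentzian.VacuumCauchyDevelopment D, 𝒟.IsMaximal → ∀ [𝒟.metric.HasLeviCivita], ¬ 𝒟.metric.IsFutureNullGeodesicallyIncomplete 𝒟.timeOrientation ∧ ¬ 𝒟.metric.IsFutureTimelikeGeodesicallyIncomplete 𝒟.timeOrientation; let Trap : Literature.Geometry.Lorentzian.InitialDataSet (𝓡 3) X → Prop := fun D ↦ (∃ 𝒟 : Literature.Geometry.Lorentzian.VacuumCauchyDevelopment D, 𝒟.IsMaximal) ∧ ∀ 𝒟 : Literature.Geometry.Lorentzian.VacuumCauchyDevelopment D, 𝒟.IsMaximal → ∀ [𝒟.metric.HasLeviCivita], ∃ f : Metric.sphere (0 : Literature.Geometry.Lorentzian.E3) 1 → 𝒟.carrier, Set.range f ⊆ 𝒟.metric.causalFuture 𝒟.timeOrientation (Set.range 𝒟.embed) ∧ 𝒟.metric.IsTrappedSurface (𝓡 2) 𝒟.timeOrientation f; let Cens : Literature.Geometry.Lorentzian.InitialDataSet (𝓡 3) X → Prop := fun D ↦ ∀ 𝒟 : Literature.Geometry.Lorentzian.VacuumCauchyDevelopment D, 𝒟.IsMaximal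 → Summit.FinalStateConjecture.HasCompleteNullInfinity 𝒟.toCauchyDevelopment; let Single : Literature.Geometry.Lorentzian.InitialDataSet (𝓡 3) X → Prop := fun D ↦ ∀ 𝒟 : Literature.Geometry.Lorentzian.VacuumCauchyDevelopment D, 𝒟.IsMaximal → ∀ [𝒟.metric.HasLeviCivita], Subsingleton (ConnectedComponents ↥(Literature.Geometry.Lorentzian.DataEmbedding.blackHoleRegion 𝒟.toDataEmbedding ∩ 𝒟.metric.causalFuture 𝒟.timeOrientation (Set.range 𝒟.embed))); let CenFinF : Literature.Geometry.Lorentzian.InitialDataSet (𝓡 3) X → Prop := fun D ↦ ∀ 𝒟 : Literature.Geometry.Lorentzian.VacuumCauchyDevelopment D, 𝒟.IsMaximal → ∃ n : ℕ, ∀ (X' : Type) [TopologicalSpace X'] [ChartedSpace Literature.Geometry.Lorentzian.E3 X'] [IsManifold (𝓡 3) ((⊤ : ℕ∞) : WithTop ℕ∞) X'] [ConnectedSpace X'] (D' : Literature.Geometry.Lorentzian.InitialDataSet (𝓡 3) X') (ι' : X' → 𝒟.carrier) (ν' : Literature.Geometry.Lorentzian.NormalField (𝓡 4) ι'), Manifold.IsSmoothEmbedding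 (𝓡 3) (𝓡 4) ((⊤ : ℕ∞) : WithTop ℕ∞) ι' → 𝒟.metric.IsFutureUnitNormal (𝓡 3) 𝒟.timeOrientation ι' ν' → (∀ y : X', Literature.Geometry.Lorentzian.pullbackBilin (I := 𝓡 4) (I' := 𝓡 3) ι' 𝒟.metric.val y = D'.h.inner y) → (∀ [𝒟.metric.toPseudoRiemannianMetric.HasLeviCivita] (y : X'), 𝒟.metric.toPseudoRiemannianMetric.secondFundamentalForm (𝓡 3) ι' ν' y = D'.kBilin y) → 𝒟.metric.IsCauchyHypersurface 𝒟.timeOrientation (Set.range ι') → Set.range ι' ⊆ 𝒟.metric.causalFuture 𝒟.timeOrientation (Set.range 𝒟.embed) → ∀ S : Fin (n + 1) → Literature.Geometry.Lorentzian.OutermostMOTS (𝓡 3) D'.h D'.k, (∀ j, ConnectedSpace (S j).surf) → (∀ j, IsCompact (((S j).exterior : Set X'))ᶜ ∧ (interior (((S j).exterior : Set X'))ᶜ).Nonempty) → ∃ j j', j ≠ j' ∧ ((((S j).exterior : Set X'))ᶜ ∩ (((S j').exterior : Set X'))ᶜ).Nonempty; let kerrLo : ENNReal → ENNReal := fun M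 ↦ ENNReal.ofReal (8 * Real.pi) * M ^ 2; let kerrHi : ENNReal → ENNReal := fun M ↦ ENNReal.ofReal (16 * Real.pi) * M ^ 2; let MassF : (D : Literature.Geometry.Lorentzian.InitialDataSet (𝓡 3) X) → Literature.Geometry.Lorentzian.VacuumCauchyDevelopment D → ENNReal := fun D 𝒟 ↦ ⨅ (K : Set 𝒟.carrier) (_ : IsCompact K) (m : ℝ) (_ : 𝒟.toCauchyDevelopment.HasCutBondiMass K m), ENNReal.ofReal m; let AreaF : (D : Literature.Geometry.Lorentzian.InitialDataSet (𝓡 3) X) → (𝒟 : Literature.Geometry.Lorentzian.VacuumCauchyDevelopment D) → [𝒟.metric.HasLeviCivita] → ENNReal := fun D 𝒟 hLC ↦ sInf {a : ENNReal | ∀ (X' : Type) [TopologicalSpace X'] [ChartedSpace Literature.Geometry.Lorentzian.E3 X'] [IsManifold (𝓡 3) ((⊤ : ℕ∞) : WithTop ℕ∞) X'] [ConnectedSpace X'] [T2Space X'] (D' : Literature.Geometry.Lorentzian.InitialDataSet (𝓡 3) X') (ι' : X' → 𝒟.carrier) (ν' : Literature.Geometry.Lorentzian.NormalField (𝓡 4)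 ι'), Manifold.IsSmoothEmbedding (𝓡 3) (𝓡 4) ((⊤ : ℕ∞) : WithTop ℕ∞) ι' → 𝒟.metric.IsFutureUnitNormal (𝓡 3) 𝒟.timeOrientation ι' ν' → (∀ y : X', Literature.Geometry.Lorentzian.pullbackBilin (I := 𝓡 4) (I' := 𝓡 3) ι' 𝒟.metric.val y = D'.h.inner y) → (∀ [𝒟.metric.toPseudoRiemannianMetric.HasLeviCivita] (y : X'), 𝒟.metric.toPseudoRiemannianMetric.secondFundamentalForm (𝓡 3) ι' ν' y = D'.kBilin y) → 𝒟.metric.IsCauchyHypersurface 𝒟.timeOrientation (Set.range ι') → Set.range ι' ⊆ 𝒟.metric.causalFuture 𝒟.timeOrientation (Set.range 𝒟.embed) → (letI : MeasurableSpace X' := borel X'; haveI : BorelSpace X' := ⟨rfl⟩; haveI : LocallyCompactSpace X' := ChartedSpace.locallyCompactSpace Literature.Geometry.Lorentzian.E3 X'; Literature.Geometry.Lorentzian.area D'.h (ι' ⁻¹' Literature.Geometry.Lorentzian.DataEmbedding.futureEventHorizon 𝒟.toDataEmbedding)) ≤ a}; let Acc : Literature.Geometry.Lorentzian.InitialDataSet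 (𝓡 3) X → Prop := fun D ↦ ∃ (M A : ENNReal), M ≠ ⊤ ∧ (∀ e : Literature.Geometry.Lorentzian.AFEnd X, e.IsAsymptoticallyFlat D 1 → (∃ m, e.HasADMEnergy D m) → M ≤ ENNReal.ofReal (e.admMass D)) ∧ ∀ 𝒟 : Literature.Geometry.Lorentzian.VacuumCauchyDevelopment D, 𝒟.IsMaximal → ∀ [𝒟.metric.HasLeviCivita], MassF D 𝒟 = M ∧ AreaF D 𝒟 = A; let KerrB : Literature.Geometry.Lorentzian.InitialDataSet (𝓡 3) X → Prop := fun D ↦ ∀ 𝒟 : Literature.Geometry.Lorentzian.VacuumCauchyDevelopment D, 𝒟.IsMaximal → ∀ [𝒟.metric.HasLeviCivita], MassF D 𝒟 ≠ ⊤ ∧ kerrLo (MassF D 𝒟) < AreaF D 𝒟 ∧ AreaF D 𝒟 ≤ kerrHi (MassF D 𝒟); let HeavyB : Literature.Geometry.Lorentzian.InitialDataSet (𝓡 3) X → Prop := fun D ↦ ∀ 𝒟 : Literature.Geometry.Lorentzian.VacuumCauchyDevelopment D, 𝒟.IsMaximal → ∀ [𝒟.metric.HasLeviCivita], MassF D 𝒟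 ≠ ⊤ ∧ AreaF D 𝒟 ≤ kerrLo (MassF D 𝒟); ∀ d ∈ Literature.Geometry.Lorentzian.admissibleVacuumData X, ¬ P d → (((¬ Disp d ∧ Trap d ∧ Cens d ∧ ¬ Pw0 d) ∧ Single d) ∧ CenFinF d) → (Acc d ∧ ¬ KerrB d ∧ ¬ HeavyB d) → ∃ (e : Literature.Geometry.Lorentzian.AFEnd X) (F : EuclideanSpace ℝ (Fin 1) → Literature.Geometry.Lorentzian.InitialDataSet (𝓡 3) X), Literature.Geometry.Lorentzian.InitialDataSet.IsTameDataFamily e 1 F ∧ Literature.Geometry.Lorentzian.InitialDataSet.IsImmersedAtZero 1 F ∧ F 0 = d ∧ Injective F ∧ (∀ c, F c ∈ Literature.Geometry.Lorentzian.admissibleVacuumData X) ∧ ∀ c ≠ 0, P (F c)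

/-- item stmt-FinalStateConjecture-26647 · crux · rank 6 · open · by planner
why it might fail: Late-time tails refocusing through an already formed hole's strong field (caustics near photon spheres) could keep forming ever smaller holes at ever later times on a tame-open set; no statement either way is in print (arXiv:2210.13960 p.6).
sources: arXiv:0805.3880, arXiv:1409.6270, Christodoulou1999, arXiv:0811.0354, arXiv:2210.13960, HawkingEllis1973
[crux · child 𝓣₂^∞ of TrappedCaptureExit · thin · conjecturally EMPTY · IDEA-NEEDED; CLEARED by
decomp-fsc-crit-1-g0 2026-08-30T03:23:32Z (k = 3 chosen); writer glue/exactness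
folder/n2bg3/Sketch.lean rc 0 / 0 sorry.] For every Σ and every admissible P_Σ-exceptional datum d
of the capture cell 𝓣₂ (not of dispersive type; every MGHD contains a closed trapped sphere in the
causal future of the data; every MGHD has complete future null infinity; d fails the weak C⁰
property P_w⁰) SOME of whose MGHDs ends with INFINITELY MANY black holes (¬ Finite
(ConnectedComponents ↥𝓑⁺)), there are one end e and a tame (order 1 at e), immersed-at-0, injective
one-parameter family F of admissible data with F 0 = d all of whose members c ≠ 0 satisfy P_Σ. It
isolates the clause «N : ℕ» (finitely many hole charts) of FinalStateDecomposition inside the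
censored trapped basin. Kill path: a quantitative converse of trapped-surface formation (no closed
trapped surface in a region uniformly C¹-close to Minkowski) + late-time decay of the exterior field
⟹ no hole forms after some slab ⟹ finitely many components; classical vacuum has no mass gap
(Christodoulou short pulse arXiv:0805.3880, An–Luk arXiv:1409.627 -/
@[route_item "route-FinalStateConjecture-RootDecompSobolevLedgerCells", crux]
def InfiniteHoleCaptureExit : Prop :=
  ∀ (X : Type) [TopologicalSpace X] [ChartedSpace Literature.Geometry.Lorentzian.E3 X] [IsManifold (𝓡 3) ((⊤ : ℕ∞) : WithTop ℕ∞) X] [T2Space X] [SecondCountableTopology X] [ConnectedSpace X], let P : Literature.Geometry.Lorentzian.InitialDataSet (𝓡 3) X → Prop := fun D ↦ (∃ 𝒟 : Literature.Geometry.Lorentzian.VacuumCauchyDevelopment D, 𝒟.IsMaximal) ∧ ∀ 𝒟 : Literature.Geometry.Lorentzian.VacuumCauchyDevelopment D, 𝒟.IsMaximal → Summit.FinalStateConjecture.HasCompleteNullInfinity 𝒟.toCauchyDevelopment ∧ ∃ (O : Set 𝒟.carrier) (d : Literature.Geometry.Lorentzian.FinalStateDecomposition 𝒟.toSpacetime O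 2), (∀ i, Literature.Geometry.Lorentzian.Kerr.IsSubextremal (d.mass i) (d.spin i)) ∧ O = Summit.FinalStateConjecture.exteriorOf 𝒟.toCauchyDevelopment d.charted ∧ Summit.FinalStateConjecture.RaysStayInClosure 𝒟.toCauchyDevelopment O ∧ Summit.FinalStateConjecture.HasExhaustiveCharts d ∧ Summit.FinalStateConjecture.IsFutureOriented d; let Pw0 : Literature.Geometry.Lorentzian.InitialDataSet (𝓡 3) X → Prop := fun D ↦ (∃ 𝒟 : Literature.Geometry.Lorentzian.VacuumCauchyDevelopment D, 𝒟.IsMaximal) ∧ ∀ 𝒟 : Literature.Geometry.Lorentzian.VacuumCauchyDevelopment D, 𝒟.IsMaximal → Summit.FinalStateConjecture.HasCompleteNullInfinity 𝒟.toCauchyDevelopment ∧ ∃ (O : Set 𝒟.carrier) (d : Literature.Geometry.Lorentzian.FinalStateDecomposition 𝒟.toSpacetime O 0), O = Summit.FinalStateConjecture.exteriorOf 𝒟.toCauchyDevelopment d.charted ∧ Summit.FinalStateConjecture.RaysStayInClosure 𝒟.toCauchyDevelopment O ∧ Summit.FinalStateConjecture.HasExhaustiveCharts d ∧ Summit.FinalStateConjecture.IsFutureOriented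 d; let Disp : Literature.Geometry.Lorentzian.InitialDataSet (𝓡 3) X → Prop := fun D ↦ (∃ 𝒟 : Literature.Geometry.Lorentzian.VacuumCauchyDevelopment D, 𝒟.IsMaximal) ∧ ∀ 𝒟 : Literature.Geometry.Lorentzian.VacuumCauchyDevelopment D, 𝒟.IsMaximal → ∀ [𝒟.metric.HasLeviCivita], ¬ 𝒟.metric.IsFutureNullGeodesicallyIncomplete 𝒟.timeOrientation ∧ ¬ 𝒟.metric.IsFutureTimelikeGeodesicallyIncomplete 𝒟.timeOrientation; let Trap : Literature.Geometry.Lorentzian.InitialDataSet (𝓡 3) X → Prop := fun D ↦ (∃ 𝒟 : Literature.Geometry.Lorentzian.VacuumCauchyDevelopment D, 𝒟.IsMaximal) ∧ ∀ 𝒟 : Literature.Geometry.Lorentzian.VacuumCauchyDevelopment D, 𝒟.IsMaximal → ∀ [𝒟.metric.HasLeviCivita], ∃ f : Metric.sphere (0 : Literature.Geometry.Lorentzian.E3) 1 → 𝒟.carrier, Set.range f ⊆ 𝒟.metric.causalFuture 𝒟.timeOrientation (Set.range 𝒟.embed) ∧ 𝒟.metric.IsTrappedSurface (𝓡 2) 𝒟.timeOrientation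 f; let Cens : Literature.Geometry.Lorentzian.InitialDataSet (𝓡 3) X → Prop := fun D ↦ ∀ 𝒟 : Literature.Geometry.Lorentzian.VacuumCauchyDevelopment D, 𝒟.IsMaximal → Summit.FinalStateConjecture.HasCompleteNullInfinity 𝒟.toCauchyDevelopment; let FinMany : Literature.Geometry.Lorentzian.InitialDataSet (𝓡 3) X → Prop := fun D ↦ ∀ 𝒟 : Literature.Geometry.Lorentzian.VacuumCauchyDevelopment D, 𝒟.IsMaximal → ∀ [𝒟.metric.HasLeviCivita], Finite (ConnectedComponents ↥(Literature.Geometry.Lorentzian.DataEmbedding.blackHoleRegion 𝒟.toDataEmbedding ∩ 𝒟.metric.causalFuture 𝒟.timeOrientation (Set.range 𝒟.embed))); ∀ d ∈ Literature.Geometry.Lorentzian.admissibleVacuumData X, ¬ P d → ((¬ Disp d ∧ Trap d ∧ Cens d ∧ ¬ Pw0 d) ∧ ¬ FinMany d) → ∃ (e : Literature.Geometry.Lorentzian.AFEnd X) (F : EuclideanSpace ℝ (Fin 1) → Literature.Geometry.Lorentzian.InitialDataSet (𝓡 3) X), Literature.Geometry.Lorentzian.InitialDataSet.IsTameDataFamily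 e 1 F ∧ Literature.Geometry.Lorentzian.InitialDataSet.IsImmersedAtZero 1 F ∧ F 0 = d ∧ Injective F ∧ (∀ c, F c ∈ Literature.Geometry.Lorentzian.admissibleVacuumData X) ∧ ∀ c ≠ 0, P (F c)

/-- item stmt-FinalStateConjecture-28423 · crux (kind.auto-crux: conjecture-grade) · rank 9 · open · by planner
why it might fail: Empty only modulo HorizonAreaBridge: should the outermost trapped region of some censored MGHD be visible from 𝓘⁺ in the sojourn formalism (HE 9.2.8 / Wald 12.2.4 porting fails without future causal simplicity) or A_min exceed the Lipschitz horizon-cut area, heavy books could coexist with Hor.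
sources: HawkingEllis1973 §9.2, Wald1984 §12.2, arXiv:2605.18730 p.3, ChruscielEtAl2001 §3-4, decomp-fsc-lens-5/g5/FinalChargeCells.lean:heavyChargeDoor_of_bridge, stmt-FinalStateConjecture-26560
[support · THIN · EMPTY BY BRIDGE · door Dr of lens-5 g5 on stmt-27603] Same population with Acc ∧
¬KerrB ∧ HeavyB (AreaF ≤ 8π·MassF²) ∧ Hor (lens-1 horizon let of stmt-26560 verbatim: an honest
outermost future horizon with A_min ≥ 16π(0.81)m²): exit tamely with codimension ≥ 1. Conjecturally
EMPTY: lens kernel theorem heavyChargeDoor_of_bridge : HorizonAreaBridge → HeavyChargeDoor (rc 0,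
axioms std) by the chain 16π(0.81)m² ≤ A_min ≤ A_f ≤ 8πM_f² ≤ 8πm², 12.96 > 8 — pure arithmetic once
the PDE-free bridge HorizonAreaBridge (A_min ≤ AreaF: invisibility of the outermost trapped body
from the complete-ray region, HawkingEllis1973 Prop. 9.2.8 / Wald1984 Props. 12.2.2–12.2.4; far AF
region visible; Lipschitz GMT enclosure comparison ChruscielEtAl2001 §3–4) is ported; the bridge
does not fit this route's item cap and is queued as porting request D5 «HorizonAreaBridge»
(statement = lens one-liner verbatim; facts F1–F3) — REGISTERED KILL PATH: a prover lands
«HorizonAreaBridge → HeavyChargeDoor» verbatim from decomp-fsc-lens-5/g5/FinalChargeCells.lean with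
--supports this item. Independently dominated by stmt-26560 HorizonDominatedResidual by restriction
(same exit currency; informs len -/
@[route_item "route-FinalStateConjecture-RootDecompSobolevLedgerCells", crux]
def HeavyChargeDoor : Prop :=
  ∀ (X : Type) [TopologicalSpace X] [ChartedSpace Literature.Geometry.Lorentzian.E3 X] [IsManifold (𝓡 3) ((⊤ : ℕ∞) : WithTop ℕ∞) X] [T2Space X] [SecondCountableTopology X] [ConnectedSpace X], let P : Literature.Geometry.Lorentzian.InitialDataSet (𝓡 3) X → Prop := fun D ↦ (∃ 𝒟 : Literature.Geometry.Lorentzian.VacuumCauchyDevelopment D, 𝒟.IsMaximal) ∧ ∀ 𝒟 : Literature.Geometry.Lorentzian.VacuumCauchyDevelopment D, 𝒟.IsMaximal → Summit.FinalStateConjecture.HasCompleteNullInfinity 𝒟.toCauchyDevelopment ∧ ∃ (O : Set 𝒟.carrier) (d : Literature.Geometry.Lorentzian.FinalStateDecomposition 𝒟.toSpacetime O 2), (∀ i, Literature.Geometry.Lorentzian.Kerr.IsSubextremal (d.mass i) (d.spin i)) ∧ O = Summit.FinalStateConjecture.exteriorOf 𝒟.toCauchyDevelopment d.charted ∧ Summit.FinalStateConjecture.RaysStayInClosure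 𝒟.toCauchyDevelopment O ∧ Summit.FinalStateConjecture.HasExhaustiveCharts d ∧ Summit.FinalStateConjecture.IsFutureOriented d; let Pw0 : Literature.Geometry.Lorentzian.InitialDataSet (𝓡 3) X → Prop := fun D ↦ (∃ 𝒟 : Literature.Geometry.Lorentzian.VacuumCauchyDevelopment D, 𝒟.IsMaximal) ∧ ∀ 𝒟 : Literature.Geometry.Lorentzian.VacuumCauchyDevelopment D, 𝒟.IsMaximal → Summit.FinalStateConjecture.HasCompleteNullInfinity 𝒟.toCauchyDevelopment ∧ ∃ (O : Set 𝒟.carrier) (d : Literature.Geometry.Lorentzian.FinalStateDecomposition 𝒟.toSpacetime O 0), O = Summit.FinalStateConjecture.exteriorOf 𝒟.toCauchyDevelopment d.charted ∧ Summit.FinalStateConjecture.RaysStayInClosure 𝒟.toCauchyDevelopment O ∧ Summit.FinalStateConjecture.HasExhaustiveCharts d ∧ Summit.FinalStateConjecture.IsFutureOriented d; let Disp : Literature.Geometry.Lorentzian.InitialDataSet (𝓡 3) X → Prop := fun D ↦ (∃ 𝒟 : Literature.Geometry.Lorentzian.VacuumCauchyDevelopment D, 𝒟.IsMaximal) ∧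 ∀ 𝒟 : Literature.Geometry.Lorentzian.VacuumCauchyDevelopment D, 𝒟.IsMaximal → ∀ [𝒟.metric.HasLeviCivita], ¬ 𝒟.metric.IsFutureNullGeodesicallyIncomplete 𝒟.timeOrientation ∧ ¬ 𝒟.metric.IsFutureTimelikeGeodesicallyIncomplete 𝒟.timeOrientation; let Trap : Literature.Geometry.Lorentzian.InitialDataSet (𝓡 3) X → Prop := fun D ↦ (∃ 𝒟 : Literature.Geometry.Lorentzian.VacuumCauchyDevelopment D, 𝒟.IsMaximal) ∧ ∀ 𝒟 : Literature.Geometry.Lorentzian.VacuumCauchyDevelopment D, 𝒟.IsMaximal → ∀ [𝒟.metric.HasLeviCivita], ∃ f : Metric.sphere (0 : Literature.Geometry.Lorentzian.E3) 1 → 𝒟.carrier, Set.range f ⊆ 𝒟.metric.causalFuture 𝒟.timeOrientation (Set.range 𝒟.embed) ∧ 𝒟.metric.IsTrappedSurface (𝓡 2) 𝒟.timeOrientation f; let Cens : Literature.Geometry.Lorentzian.InitialDataSet (𝓡 3) X → Prop := fun D ↦ ∀ 𝒟 : Literature.Geometry.Lorentzian.VacuumCauchyDevelopment D, 𝒟.IsMaximal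 → Summit.FinalStateConjecture.HasCompleteNullInfinity 𝒟.toCauchyDevelopment; let Single : Literature.Geometry.Lorentzian.InitialDataSet (𝓡 3) X → Prop := fun D ↦ ∀ 𝒟 : Literature.Geometry.Lorentzian.VacuumCauchyDevelopment D, 𝒟.IsMaximal → ∀ [𝒟.metric.HasLeviCivita], Subsingleton (ConnectedComponents ↥(Literature.Geometry.Lorentzian.DataEmbedding.blackHoleRegion 𝒟.toDataEmbedding ∩ 𝒟.metric.causalFuture 𝒟.timeOrientation (Set.range 𝒟.embed))); let CenFinF : Literature.Geometry.Lorentzian.InitialDataSet (𝓡 3) X → Prop := fun D ↦ ∀ 𝒟 : Literature.Geometry.Lorentzian.VacuumCauchyDevelopment D, 𝒟.IsMaximal → ∃ n : ℕ, ∀ (X' : Type) [TopologicalSpace X'] [ChartedSpace Literature.Geometry.Lorentzian.E3 X'] [IsManifold (𝓡 3) ((⊤ : ℕ∞) : WithTop ℕ∞) X'] [ConnectedSpace X'] (D' : Literature.Geometry.Lorentzian.InitialDataSet (𝓡 3) X') (ι' : X' → 𝒟.carrier) (ν' : Literature.Geometry.Lorentzian.NormalField (𝓡 4) ι'), Manifold.IsSmoothEmbedding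 (𝓡 3) (𝓡 4) ((⊤ : ℕ∞) : WithTop ℕ∞) ι' → 𝒟.metric.IsFutureUnitNormal (𝓡 3) 𝒟.timeOrientation ι' ν' → (∀ y : X', Literature.Geometry.Lorentzian.pullbackBilin (I := 𝓡 4) (I' := 𝓡 3) ι' 𝒟.metric.val y = D'.h.inner y) → (∀ [𝒟.metric.toPseudoRiemannianMetric.HasLeviCivita] (y : X'), 𝒟.metric.toPseudoRiemannianMetric.secondFundamentalForm (𝓡 3) ι' ν' y = D'.kBilin y) → 𝒟.metric.IsCauchyHypersurface 𝒟.timeOrientation (Set.range ι') → Set.range ι' ⊆ 𝒟.metric.causalFuture 𝒟.timeOrientation (Set.range 𝒟.embed) → ∀ S : Fin (n + 1) → Literature.Geometry.Lorentzian.OutermostMOTS (𝓡 3) D'.h D'.k, (∀ j, ConnectedSpace (S j).surf) → (∀ j, IsCompact (((S j).exterior : Set X'))ᶜ ∧ (interior (((S j).exterior : Set X'))ᶜ).Nonempty) → ∃ j j', j ≠ j' ∧ ((((S j).exterior : Set X'))ᶜ ∩ (((S j').exterior : Set X'))ᶜ).Nonempty; let kerrLo : ENNReal → ENNReal := fun M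 ↦ ENNReal.ofReal (8 * Real.pi) * M ^ 2; let kerrHi : ENNReal → ENNReal := fun M ↦ ENNReal.ofReal (16 * Real.pi) * M ^ 2; let MassF : (D : Literature.Geometry.Lorentzian.InitialDataSet (𝓡 3) X) → Literature.Geometry.Lorentzian.VacuumCauchyDevelopment D → ENNReal := fun D 𝒟 ↦ ⨅ (K : Set 𝒟.carrier) (_ : IsCompact K) (m : ℝ) (_ : 𝒟.toCauchyDevelopment.HasCutBondiMass K m), ENNReal.ofReal m; let AreaF : (D : Literature.Geometry.Lorentzian.InitialDataSet (𝓡 3) X) → (𝒟 : Literature.Geometry.Lorentzian.VacuumCauchyDevelopment D) → [𝒟.metric.HasLeviCivita] → ENNReal := fun D 𝒟 hLC ↦ sInf {a : ENNReal | ∀ (X' : Type) [TopologicalSpace X'] [ChartedSpace Literature.Geometry.Lorentzian.E3 X'] [IsManifold (𝓡 3) ((⊤ : ℕ∞) : WithTop ℕ∞) X'] [ConnectedSpace X'] [T2Space X'] (D' : Literature.Geometry.Lorentzian.InitialDataSet (𝓡 3) X') (ι' : X' → 𝒟.carrier) (ν' : Literature.Geometry.Lorentzian.NormalField (𝓡 4)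 ι'), Manifold.IsSmoothEmbedding (𝓡 3) (𝓡 4) ((⊤ : ℕ∞) : WithTop ℕ∞) ι' → 𝒟.metric.IsFutureUnitNormal (𝓡 3) 𝒟.timeOrientation ι' ν' → (∀ y : X', Literature.Geometry.Lorentzian.pullbackBilin (I := 𝓡 4) (I' := 𝓡 3) ι' 𝒟.metric.val y = D'.h.inner y) → (∀ [𝒟.metric.toPseudoRiemannianMetric.HasLeviCivita] (y : X'), 𝒟.metric.toPseudoRiemannianMetric.secondFundamentalForm (𝓡 3) ι' ν' y = D'.kBilin y) → 𝒟.metric.IsCauchyHypersurface 𝒟.timeOrientation (Set.range ι') → Set.range ι' ⊆ 𝒟.metric.causalFuture 𝒟.timeOrientation (Set.range 𝒟.embed) → (letI : MeasurableSpace X' := borel X'; haveI : BorelSpace X' := ⟨rfl⟩; haveI : LocallyCompactSpace X' := ChartedSpace.locallyCompactSpace Literature.Geometry.Lorentzian.E3 X'; Literature.Geometry.Lorentzian.area D'.h (ι' ⁻¹' Literature.Geometry.Lorentzian.DataEmbedding.futureEventHorizon 𝒟.toDataEmbedding)) ≤ a}; let Acc : Literature.Geometry.Lorentzian.InitialDataSet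 (𝓡 3) X → Prop := fun D ↦ ∃ (M A : ENNReal), M ≠ ⊤ ∧ (∀ e : Literature.Geometry.Lorentzian.AFEnd X, e.IsAsymptoticallyFlat D 1 → (∃ m, e.HasADMEnergy D m) → M ≤ ENNReal.ofReal (e.admMass D)) ∧ ∀ 𝒟 : Literature.Geometry.Lorentzian.VacuumCauchyDevelopment D, 𝒟.IsMaximal → ∀ [𝒟.metric.HasLeviCivita], MassF D 𝒟 = M ∧ AreaF D 𝒟 = A; let KerrB : Literature.Geometry.Lorentzian.InitialDataSet (𝓡 3) X → Prop := fun D ↦ ∀ 𝒟 : Literature.Geometry.Lorentzian.VacuumCauchyDevelopment D, 𝒟.IsMaximal → ∀ [𝒟.metric.HasLeviCivita], MassF D 𝒟 ≠ ⊤ ∧ kerrLo (MassF D 𝒟) < AreaF D 𝒟 ∧ AreaF D 𝒟 ≤ kerrHi (MassF D 𝒟); let HeavyB : Literature.Geometry.Lorentzian.InitialDataSet (𝓡 3) X → Prop := fun D ↦ ∀ 𝒟 : Literature.Geometry.Lorentzian.VacuumCauchyDevelopment D, 𝒟.IsMaximal → ∀ [𝒟.metric.HasLeviCivita], MassF D 𝒟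 ≠ ⊤ ∧ AreaF D 𝒟 ≤ kerrLo (MassF D 𝒟); let Hor : Literature.Geometry.Lorentzian.InitialDataSet (𝓡 3) X → Prop := fun D ↦ ∃ (hLC : D.metric.HasLeviCivita) (e : Literature.Geometry.Lorentzian.AFEnd X) (S : Literature.Geometry.Lorentzian.OutermostMOTS (𝓡 3) D.h D.k), haveI : (Literature.Geometry.Lorentzian.PseudoRiemannianMetric.ofRiemannian D.h).HasLeviCivita := hLC; let IsExteriorRegion : TopologicalSpace.Opens X → Prop := fun U ↦ IsConnected (U : Set X) ∧ ∃ R', e.R < R' ∧ e.far R' ⊆ (U : Set X) ∧ IsCompact (closure (U : Set X) \ e.far R'); let IsOutsideOf : TopologicalSpace.Opens X → (S' : Type) → (f' : S' → X) → Literature.Geometry.Lorentzian.NormalField (𝓡 3) f' → Prop := fun U _ f' ν' ↦ frontier (U : Set X) = Set.range f' ∧ (∀ y, ∀ᶠ t in nhdsWithin (0 : ℝ) (Set.Ioi 0), Literature.Geometry.Lorentzian.curveThrough (𝓡 3) (f' y) (ν' y) t ∈ (U : Set X)) ∧ (∀ y, ∀ᶠ t in nhdsWithin (0 : ℝ) (Set.Iio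 0), Literature.Geometry.Lorentzian.curveThrough (𝓡 3) (f' y) (ν' y) t ∉ closure (U : Set X)) ∧ IsExteriorRegion U; let IsCalS : TopologicalSpace.Opens X → Prop := fun V ↦ ∃ (S' : Type) (_ : TopologicalSpace S') (_ : ChartedSpace (EuclideanSpace ℝ (Fin 2)) S') (_ : IsManifold (𝓡 2) ((⊤ : ℕ∞) : WithTop ℕ∞) S') (_ : CompactSpace S') (_ : T2Space S') (f' : S' → X) (ν' : Literature.Geometry.Lorentzian.NormalField (𝓡 3) f'), Manifold.IsSmoothEmbedding (𝓡 2) (𝓡 3) ((⊤ : ℕ∞) : WithTop ℕ∞) f' ∧ (Literature.Geometry.Lorentzian.PseudoRiemannianMetric.ofRiemannian D.h).IsUnitNormal (𝓡 2) f' ν' 1 ∧ IsOutsideOf V S' f' ν'; let WOTFree : TopologicalSpace.Opens X → Prop := fun U ↦ ∀ (S' : Type) [TopologicalSpace S'] [ChartedSpace (EuclideanSpace ℝ (Fin 2)) S'] [IsManifold (𝓡 2) ((⊤ : ℕ∞) : WithTop ℕ∞) S'] [CompactSpace S'] [T2Space S'] (f' : S' → X) (ν' : Literature.Geometry.Lorentzian.NormalField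 (𝓡 3) f') (hpb' : Literature.Geometry.Lorentzian.PseudoRiemannianMetric.contMDiff_pullbackBilin (𝓡 3) X (𝓡 2) S' ((⊤ : ℕ∞) : WithTop ℕ∞)) (hf' : (Literature.Geometry.Lorentzian.PseudoRiemannianMetric.ofRiemannian D.h).IsSpacelikeImmersion (𝓡 2) f') (Ω : TopologicalSpace.Opens X), Manifold.IsSmoothEmbedding (𝓡 2) (𝓡 3) ((⊤ : ℕ∞) : WithTop ℕ∞) f' → Set.range f' ⊆ (U : Set X) → (Literature.Geometry.Lorentzian.PseudoRiemannianMetric.ofRiemannian D.h).IsUnitNormal (𝓡 2) f' ν' 1 → Nonempty S' → frontier (Ω : Set X) = Set.range f' → (∃ R', e.R < R' ∧ Disjoint (e.far R') (Ω : Set X)) → (∀ y, ∀ᶠ t in nhdsWithin (0 : ℝ) (Set.Iio 0), Literature.Geometry.Lorentzian.curveThrough (𝓡 3) (f' y) (ν' y) t ∈ (Ω : Set X)) → ¬ Literature.Geometry.Lorentzian.IsWeaklyOuterTrapped D.h D.k f' hpb' hf' ν'; ContMDiff (𝓡 2) (𝓡 3).tangent ((⊤ : ℕ∞) : WithTop ℕ∞)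 (fun y ↦ (Bundle.TotalSpace.mk' Literature.Geometry.Lorentzian.E3 (S.f y) (S.ν y) : TangentBundle (𝓡 3) X)) ∧ D.SatisfiesDominantEnergyCondition ∧ e.IsAsymptoticallyFlat D 1 ∧ D.IsComplete ∧ (∃ m, e.HasADMEnergy D m) ∧ (∀ i, ∃ p, e.HasADMMomentum D i p) ∧ WOTFree S.exterior ∧ IsOutsideOf S.exterior S.surf S.f S.ν ∧ 0 < e.admMass D ∧ (letI : MeasurableSpace X := borel X; haveI : BorelSpace X := ⟨rfl⟩; haveI : LocallyCompactSpace X := ChartedSpace.locallyCompactSpace Literature.Geometry.Lorentzian.E3 X; (9 / 10 : ℝ) * e.admMass D ≤ Real.sqrt ((⨅ (V : TopologicalSpace.Opens X) (_ : IsCalS V ∧ V ≤ S.exterior), Literature.Geometry.Lorentzian.area D.h (frontier (V : Set X))).toReal / (16 * Real.pi))); ∀ d ∈ Literature.Geometry.Lorentzian.admissibleVacuumData X, ¬ P d → (((¬ Disp d ∧ Trap d ∧ Cens d ∧ ¬ Pw0 d) ∧ Single d) ∧ CenFinF d) → (Acc d ∧ ¬ KerrB d ∧ HeavyB d ∧ Hor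 d) → ∃ (e : Literature.Geometry.Lorentzian.AFEnd X) (F : EuclideanSpace ℝ (Fin 1) → Literature.Geometry.Lorentzian.InitialDataSet (𝓡 3) X), Literature.Geometry.Lorentzian.InitialDataSet.IsTameDataFamily e 1 F ∧ Literature.Geometry.Lorentzian.InitialDataSet.IsImmersedAtZero 1 F ∧ F 0 = d ∧ Injective F ∧ (∀ c, F c ∈ Literature.Geometry.Lorentzian.admissibleVacuumData X) ∧ ∀ c ≠ 0, P (F c)

/-- item stmt-FinalStateConjecture-24765 · support · rank 9 · open · by planner
why it might fail: the extremal critical set B_crit could be thick in the tame topology (extremal thresholds accumulating on themselves along every tame line), or leaving the threshold could land in naked data; vacuum extremal formation itself is open (arXiv:2402.10190 p.12).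
sources: arXiv:2402.10190, arXiv:2211.15742, arXiv:2304.08455
[crux] PIECE 𝓝∧P_w — ExtremalThresholdExit [WEAKER·thin — critic CLEARED 2026-08-30T01:39:13Z with
retag: the printed Kehle–Unger exit family (arXiv:2402.10190 Thm 1, Einstein–Maxwell–Vlasov) is a
MODEL-ANALOGUE, not a rung; leaf IDEA-NEEDED; BARRIER placement: AretakisInstability concerns
settling ON the threshold, this piece only asks to LEAVE it along a tame curve — outside; the bet is
transversality of B_crit]. For every Σ and every admissible P_Σ-exceptional datum d of threshold
type (not dispersive, not trapped) which satisfies the WEAK property P_w (an MGHD exists; every MGHD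
has complete 𝓘⁺ and a Kerr final state decomposition with all the Statement's clauses but only |aᵢ|
≤ Mᵢ — so d fails P_Σ only through an exactly extremal final hole), there are one end e and a tame
immersed injective one-parameter family F of admissible data with F 0 = d whose members c ≠ 0
satisfy P_Σ. [difficulty: open-problem] -/
@[route_item "route-FinalStateConjecture-RootDecompSobolevLedgerCells", crux]
def ExtremalThresholdExit : Prop :=
  ∀ (X : Type) [TopologicalSpace X] [ChartedSpace Literature.Geometry.Lorentzian.E3 X] [IsManifold (𝓡 3) ((⊤ : ℕ∞) : WithTop ℕ∞) X] [T2Space X] [SecondCountableTopology X] [ConnectedSpace X], let P : Literature.Geometry.Lorentzian.InitialDataSet (𝓡 3) X → Prop := fun D ↦ (∃ 𝒟 : Literature.Geometry.Lorentzian.VacuumCauchyDevelopment D, 𝒟.IsMaximal) ∧ ∀ 𝒟 : Literature.Geometry.Lorentzian.VacuumCauchyDevelopment D, 𝒟.IsMaximal → Summit.FinalStateConjecture.HasCompleteNullInfinity 𝒟.toCauchyDevelopment ∧ ∃ (O : Set 𝒟.carrier) (d : Literature.Geometry.Lorentzian.FinalStateDecomposition 𝒟.toSpacetime O 2), (∀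 i, Literature.Geometry.Lorentzian.Kerr.IsSubextremal (d.mass i) (d.spin i)) ∧ O = Summit.FinalStateConjecture.exteriorOf 𝒟.toCauchyDevelopment d.charted ∧ Summit.FinalStateConjecture.RaysStayInClosure 𝒟.toCauchyDevelopment O ∧ Summit.FinalStateConjecture.HasExhaustiveCharts d ∧ Summit.FinalStateConjecture.IsFutureOriented d; let Pw : Literature.Geometry.Lorentzian.InitialDataSet (𝓡 3) X → Prop := fun D ↦ (∃ 𝒟 : Literature.Geometry.Lorentzian.VacuumCauchyDevelopment D, 𝒟.IsMaximal) ∧ ∀ 𝒟 : Literature.Geometry.Lorentzian.VacuumCauchyDevelopment D, 𝒟.IsMaximal → Summit.FinalStateConjecture.HasCompleteNullInfinity 𝒟.toCauchyDevelopment ∧ ∃ (O : Set 𝒟.carrier) (d : Literature.Geometry.Lorentzian.FinalStateDecomposition 𝒟.toSpacetime O 2), O = Summit.FinalStateConjecture.exteriorOf 𝒟.toCauchyDevelopment d.charted ∧ Summit.FinalStateConjecture.RaysStayInClosure 𝒟.toCauchyDevelopment O ∧ Summit.FinalStateConjecture.HasExhaustiveCharts d ∧ Summit.FinalStateConjecture.IsFutureOriented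 d; let Disp : Literature.Geometry.Lorentzian.InitialDataSet (𝓡 3) X → Prop := fun D ↦ (∃ 𝒟 : Literature.Geometry.Lorentzian.VacuumCauchyDevelopment D, 𝒟.IsMaximal) ∧ ∀ 𝒟 : Literature.Geometry.Lorentzian.VacuumCauchyDevelopment D, 𝒟.IsMaximal → ∀ [𝒟.metric.HasLeviCivita], ¬ 𝒟.metric.IsFutureNullGeodesicallyIncomplete 𝒟.timeOrientation ∧ ¬ 𝒟.metric.IsFutureTimelikeGeodesicallyIncomplete 𝒟.timeOrientation; let Trap : Literature.Geometry.Lorentzian.InitialDataSet (𝓡 3) X → Prop := fun D ↦ (∃ 𝒟 : Literature.Geometry.Lorentzian.VacuumCauchyDevelopment D, 𝒟.IsMaximal) ∧ ∀ 𝒟 : Literature.Geometry.Lorentzian.VacuumCauchyDevelopment D, 𝒟.IsMaximal → ∀ [𝒟.metric.HasLeviCivita], ∃ f : Metric.sphere (0 : Literature.Geometry.Lorentzian.E3) 1 → 𝒟.carrier, Set.range f ⊆ 𝒟.metric.causalFuture 𝒟.timeOrientation (Set.range 𝒟.embed) ∧ 𝒟.metric.IsTrappedSurface (𝓡 2) 𝒟.timeOrientation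 f; ∀ d ∈ Literature.Geometry.Lorentzian.admissibleVacuumData X, ¬ P d → (¬ Disp d ∧ ¬ Trap d ∧ Pw d) → ∃ (e : Literature.Geometry.Lorentzian.AFEnd X) (F : EuclideanSpace ℝ (Fin 1) → Literature.Geometry.Lorentzian.InitialDataSet (𝓡 3) X), Literature.Geometry.Lorentzian.InitialDataSet.IsTameDataFamily e 1 F ∧ Literature.Geometry.Lorentzian.InitialDataSet.IsImmersedAtZero 1 F ∧ F 0 = d ∧ Injective F ∧ (∀ c, F c ∈ Literature.Geometry.Lorentzian.admissibleVacuumData X) ∧ ∀ c ≠ 0, P (F c)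

/-- item stmt-FinalStateConjecture-24766 · support · rank 9 · open · by planner
why it might fail: a non-radiating vacuum breather or a complete development with curvature not decaying at i⁺ whose tame neighbours are also exceptional (an open set) refutes it; no-breather results hold only near 𝓘 (arXiv:1504.04592) or for decaying solutions (arXiv:2108.13379).
sources: arXiv:2108.13379, arXiv:1504.04592, doi:10.1007/PL00001021
[crux] PIECE 𝓒 — DispersiveExit [WEAKER·thin — critic CLEARED 2026-08-30T01:39:13Z; implied outright
by the registered pointwise item stmt-FinalStateConjecture-17320
`NoParkingWithoutHorizon.CompleteSpacetimesDisperse` (lens kernel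
`dispersiveExit_of_completeSpacetimesDisperse`; cited by name, not re-typed); leaf IDEA-NEEDED;
attackable-now sub-rung: stationary-complete ⇒ flat (Lichnerowicz–Anderson port); rung stmt-10029
NoVacuumBreathers]. For every Σ and every admissible P_Σ-exceptional datum d of dispersive type (an
MGHD exists and every MGHD is future causally geodesically complete: no future null or timelike
geodesic incompleteness, stated under the metric's Levi-Civita instance), there are one end e and a
tame immersed injective one-parameter family F of admissible data with F 0 = d whose members c ≠ 0
satisfy P_Σ. [difficulty: open-problem] -/
@[route_item "route-FinalStateConjecture-RootDecompSobolevLedgerCells", crux]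
def DispersiveExit : Prop :=
  ∀ (X : Type) [TopologicalSpace X] [ChartedSpace Literature.Geometry.Lorentzian.E3 X] [IsManifold (𝓡 3) ((⊤ : ℕ∞) : WithTop ℕ∞) X] [T2Space X] [SecondCountableTopology X] [ConnectedSpace X], let P : Literature.Geometry.Lorentzian.InitialDataSet (𝓡 3) X → Prop := fun D ↦ (∃ 𝒟 : Literature.Geometry.Lorentzian.VacuumCauchyDevelopment D, 𝒟.IsMaximal) ∧ ∀ 𝒟 : Literature.Geometry.Lorentzian.VacuumCauchyDevelopment D, 𝒟.IsMaximal → Summit.FinalStateConjecture.HasCompleteNullInfinity 𝒟.toCauchyDevelopment ∧ ∃ (O : Set 𝒟.carrier) (d : Literature.Geometry.Lorentzian.FinalStateDecomposition 𝒟.toSpacetime O 2), (∀ i, Literature.Geometry.Lorentzian.Kerr.IsSubextremal (d.mass i) (d.spin i)) ∧ O = Summit.FinalStateConjecture.exteriorOf 𝒟.toCauchyDevelopment d.charted ∧ Summit.FinalStateConjecture.RaysStayInClosure 𝒟.toCauchyDevelopment O ∧ Summit.FinalStateConjecture.HasExhaustiveCharts d ∧ Summit.FinalStateConjecture.IsFutureOriented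 d; let Disp : Literature.Geometry.Lorentzian.InitialDataSet (𝓡 3) X → Prop := fun D ↦ (∃ 𝒟 : Literature.Geometry.Lorentzian.VacuumCauchyDevelopment D, 𝒟.IsMaximal) ∧ ∀ 𝒟 : Literature.Geometry.Lorentzian.VacuumCauchyDevelopment D, 𝒟.IsMaximal → ∀ [𝒟.metric.HasLeviCivita], ¬ 𝒟.metric.IsFutureNullGeodesicallyIncomplete 𝒟.timeOrientation ∧ ¬ 𝒟.metric.IsFutureTimelikeGeodesicallyIncomplete 𝒟.timeOrientation; ∀ d ∈ Literature.Geometry.Lorentzian.admissibleVacuumData X, ¬ P d → Disp d → ∃ (e : Literature.Geometry.Lorentzian.AFEnd X) (F : EuclideanSpace ℝ (Fin 1) → Literature.Geometry.Lorentzian.InitialDataSet (𝓡 3) X), Literature.Geometry.Lorentzian.InitialDataSet.IsTameDataFamily e 1 F ∧ Literature.Geometry.Lorentzian.InitialDataSet.IsImmersedAtZero 1 F ∧ F 0 = d ∧ Injective F ∧ (∀ c, F c ∈ Literature.Geometry.Lorentzian.admissibleVacuumData X) ∧ ∀ c ≠ 0, P (F c)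

/-- item stmt-FinalStateConjecture-24767 · support · rank 9 · open · by planner
why it might fail: a smooth-data analogue of the Singh–Zheng stability — a tame-open set of admissible vacuum data forming naked singularities (RSR arXiv:1912.08478 exteriors are fine-tuned, consistent so far).
sources: Christodoulou1999, arXiv:1912.08478, arXiv:2204.09891, arXiv:2605.16235, arXiv:0811.0354
[crux] PIECE 𝓝∧¬P_w — NakedThresholdExit [WEAKER·COUNTS — critic CLEARED 2026-08-30T01:39:13Z; =
weak cosmic censorship on the untrapped incomplete sector in Christodoulou's own codimension form
(the all-cells version is the registered hard core stmt-FinalStateConjecture-17269, cited; this is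
its cell restriction with cure target P_Σ); leaf IDEA-NEEDED; BARRIER: nakedSingularityInstability
is the MODEL exit family (Christodoulou1999 Thm 4.1, 2-plane of exits) = the generic form, outside
the genericity-blind class; functional-framework dependence (Singh–Zheng arXiv:2605.16235:
Hölder-stable naked singularities in the spherical scalar field) — the bet is that smooth tame data
are on the unstable side]. For every Σ and every admissible P_Σ-exceptional datum d of threshold
type (not dispersive, not trapped) failing even the weak property P_w (no MGHD, or an MGHD with
incomplete 𝓘⁺, or censored but settling to no Kerr configuration with |aᵢ| ≤ Mᵢ), there are one end
e and a tame immersed injective one-parameter family F of admissible data with F 0 = d whose members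
c ≠ 0 satisfy P_Σ. [difficulty: open-problem] -/
@[route_item "route-FinalStateConjecture-RootDecompSobolevLedgerCells", crux]
def NakedThresholdExit : Prop :=
  ∀ (X : Type) [TopologicalSpace X] [ChartedSpace Literature.Geometry.Lorentzian.E3 X] [IsManifold (𝓡 3) ((⊤ : ℕ∞) : WithTop ℕ∞) X] [T2Space X] [SecondCountableTopology X] [ConnectedSpace X], let P : Literature.Geometry.Lorentzian.InitialDataSet (𝓡 3) X → Prop := fun D ↦ (∃ 𝒟 : Literature.Geometry.Lorentzian.VacuumCauchyDevelopment D, 𝒟.IsMaximal) ∧ ∀ 𝒟 : Literature.Geometry.Lorentzian.VacuumCauchyDevelopment D, 𝒟.IsMaximal → Summit.FinalStateConjecture.HasCompleteNullInfinity 𝒟.toCauchyDevelopment ∧ ∃ (O : Set 𝒟.carrier) (d : Literature.Geometry.Lorentzian.FinalStateDecomposition 𝒟.toSpacetime O 2), (∀ i, Literature.Geometry.Lorentzian.Kerr.IsSubextremal (d.mass i) (d.spin i)) ∧ O = Summit.FinalStateConjecture.exteriorOf 𝒟.toCauchyDevelopment d.charted ∧ Summit.FinalStateConjecture.RaysStayInClosure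 𝒟.toCauchyDevelopment O ∧ Summit.FinalStateConjecture.HasExhaustiveCharts d ∧ Summit.FinalStateConjecture.IsFutureOriented d; let Pw : Literature.Geometry.Lorentzian.InitialDataSet (𝓡 3) X → Prop := fun D ↦ (∃ 𝒟 : Literature.Geometry.Lorentzian.VacuumCauchyDevelopment D, 𝒟.IsMaximal) ∧ ∀ 𝒟 : Literature.Geometry.Lorentzian.VacuumCauchyDevelopment D, 𝒟.IsMaximal → Summit.FinalStateConjecture.HasCompleteNullInfinity 𝒟.toCauchyDevelopment ∧ ∃ (O : Set 𝒟.carrier) (d : Literature.Geometry.Lorentzian.FinalStateDecomposition 𝒟.toSpacetime O 2), O = Summit.FinalStateConjecture.exteriorOf 𝒟.toCauchyDevelopment d.charted ∧ Summit.FinalStateConjecture.RaysStayInClosure 𝒟.toCauchyDevelopment O ∧ Summit.FinalStateConjecture.HasExhaustiveCharts d ∧ Summit.FinalStateConjecture.IsFutureOriented d; let Disp : Literature.Geometry.Lorentzian.InitialDataSet (𝓡 3) X → Prop := fun D ↦ (∃ 𝒟 : Literature.Geometry.Lorentzian.VacuumCauchyDevelopment D, 𝒟.IsMaximal) ∧ ∀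 𝒟 : Literature.Geometry.Lorentzian.VacuumCauchyDevelopment D, 𝒟.IsMaximal → ∀ [𝒟.metric.HasLeviCivita], ¬ 𝒟.metric.IsFutureNullGeodesicallyIncomplete 𝒟.timeOrientation ∧ ¬ 𝒟.metric.IsFutureTimelikeGeodesicallyIncomplete 𝒟.timeOrientation; let Trap : Literature.Geometry.Lorentzian.InitialDataSet (𝓡 3) X → Prop := fun D ↦ (∃ 𝒟 : Literature.Geometry.Lorentzian.VacuumCauchyDevelopment D, 𝒟.IsMaximal) ∧ ∀ 𝒟 : Literature.Geometry.Lorentzian.VacuumCauchyDevelopment D, 𝒟.IsMaximal → ∀ [𝒟.metric.HasLeviCivita], ∃ f : Metric.sphere (0 : Literature.Geometry.Lorentzian.E3) 1 → 𝒟.carrier, Set.range f ⊆ 𝒟.metric.causalFuture 𝒟.timeOrientation (Set.range 𝒟.embed) ∧ 𝒟.metric.IsTrappedSurface (𝓡 2) 𝒟.timeOrientation f; ∀ d ∈ Literature.Geometry.Lorentzian.admissibleVacuumData X, ¬ P d → (¬ Disp d ∧ ¬ Trap d ∧ ¬ Pw d) → ∃ (e : Literature.Geometry.Lorentzian.AFEnd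 X) (F : EuclideanSpace ℝ (Fin 1) → Literature.Geometry.Lorentzian.InitialDataSet (𝓡 3) X), Literature.Geometry.Lorentzian.InitialDataSet.IsTameDataFamily e 1 F ∧ Literature.Geometry.Lorentzian.InitialDataSet.IsImmersedAtZero 1 F ∧ F 0 = d ∧ Injective F ∧ (∀ c, F c ∈ Literature.Geometry.Lorentzian.admissibleVacuumData X) ∧ ∀ c ≠ 0, P (F c)

/-- item stmt-FinalStateConjecture-25598 · support · rank 9 · open · by planner
why it might fail: a tame-open set of admissible vacuum data whose MGHD traps a sphere AND forms a naked singularity outside the resulting black hole (smooth-data analogue of the Hölder-class stability arXiv:2605.16235), or incompleteness of 𝓘⁺ generated by the black-hole region itself on an open set.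
sources: doi:10.1088/0264-9381/22/11/019, arXiv:2402.10190, arXiv:2211.15742, arXiv:1912.08478, arXiv:2204.09891, arXiv:1407.4766
[crux] PIECE 𝓣₁ — TrappedNakedExit [WEAKER·COUNTS·SPECIAL-TYPE — critic CLEARED
2026-08-30T02:40:09Z; weak cosmic censorship AFTER trapping (cell empty in the spherical
scalar-field model doi:10.1088/0264-9381/22/11/019, expected codim ≥ 1 in vacuum); subsumes lens-5's
TrappedNakedCell (critic ruling); leaf IDEA-NEEDED; BARRIER-adjacent nakedSingularityInstability
honoured as the cure]. For every Σ and every admissible P_Σ-exceptional datum d, not of dispersive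
type, all of whose MGHDs contain a closed trapped sphere to the future of the data, and SOME of
whose MGHDs has incomplete future null infinity (weak cosmic censorship fails in the presence of a
trapped sphere), there are one end e and a tame immersed injective one-parameter family F of
admissible data with F 0 = d whose members c ≠ 0 satisfy P_Σ. Model: the cell is EMPTY for
spherically symmetric Einstein–Maxwell–scalar field / Einstein–Vlasov (Dafermos 2005; Rendall 2008
§11.5); in vacuum 3+1 expected inhabited (naked-singularity datum superposed with a distant
collapsing region by localized gluing) with positive codimension. [difficulty: open-problem] -/
@[route_item "route-FinalStateConjecture-RootDecompSobolevLedgerCells", crux]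
def TrappedNakedExit : Prop :=
  ∀ (X : Type) [TopologicalSpace X] [ChartedSpace Literature.Geometry.Lorentzian.E3 X] [IsManifold (𝓡 3) ((⊤ : ℕ∞) : WithTop ℕ∞) X] [T2Space X] [SecondCountableTopology X] [ConnectedSpace X], let P : Literature.Geometry.Lorentzian.InitialDataSet (𝓡 3) X → Prop := fun D ↦ (∃ 𝒟 : Literature.Geometry.Lorentzian.VacuumCauchyDevelopment D, 𝒟.IsMaximal) ∧ ∀ 𝒟 : Literature.Geometry.Lorentzian.VacuumCauchyDevelopment D, 𝒟.IsMaximal → Summit.FinalStateConjecture.HasCompleteNullInfinity 𝒟.toCauchyDevelopment ∧ ∃ (O : Set 𝒟.carrier) (d : Literature.Geometry.Lorentzian.FinalStateDecomposition 𝒟.toSpacetime O 2), (∀ i, Literature.Geometry.Lorentzian.Kerr.IsSubextremal (d.mass i) (d.spin i)) ∧ O = Summit.FinalStateConjecture.exteriorOf 𝒟.toCauchyDevelopment d.charted ∧ Summit.FinalStateConjecture.RaysStayInClosure 𝒟.toCauchyDevelopment O ∧ Summit.FinalStateConjecture.HasExhaustiveCharts d ∧ Summit.FinalStateConjecture.IsFutureOriented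 d; let Disp : Literature.Geometry.Lorentzian.InitialDataSet (𝓡 3) X → Prop := fun D ↦ (∃ 𝒟 : Literature.Geometry.Lorentzian.VacuumCauchyDevelopment D, 𝒟.IsMaximal) ∧ ∀ 𝒟 : Literature.Geometry.Lorentzian.VacuumCauchyDevelopment D, 𝒟.IsMaximal → ∀ [𝒟.metric.HasLeviCivita], ¬ 𝒟.metric.IsFutureNullGeodesicallyIncomplete 𝒟.timeOrientation ∧ ¬ 𝒟.metric.IsFutureTimelikeGeodesicallyIncomplete 𝒟.timeOrientation; let Trap : Literature.Geometry.Lorentzian.InitialDataSet (𝓡 3) X → Prop := fun D ↦ (∃ 𝒟 : Literature.Geometry.Lorentzian.VacuumCauchyDevelopment D, 𝒟.IsMaximal) ∧ ∀ 𝒟 : Literature.Geometry.Lorentzian.VacuumCauchyDevelopment D, 𝒟.IsMaximal → ∀ [𝒟.metric.HasLeviCivita], ∃ f : Metric.sphere (0 : Literature.Geometry.Lorentzian.E3) 1 → 𝒟.carrier, Set.range f ⊆ 𝒟.metric.causalFuture 𝒟.timeOrientation (Set.range 𝒟.embed) ∧ 𝒟.metric.IsTrappedSurface (𝓡 2) 𝒟.timeOrientation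 f; let Cens : Literature.Geometry.Lorentzian.InitialDataSet (𝓡 3) X → Prop := fun D ↦ ∀ 𝒟 : Literature.Geometry.Lorentzian.VacuumCauchyDevelopment D, 𝒟.IsMaximal → Summit.FinalStateConjecture.HasCompleteNullInfinity 𝒟.toCauchyDevelopment; ∀ d ∈ Literature.Geometry.Lorentzian.admissibleVacuumData X, ¬ P d → (¬ Disp d ∧ Trap d ∧ ¬ Cens d) → ∃ (e : Literature.Geometry.Lorentzian.AFEnd X) (F : EuclideanSpace ℝ (Fin 1) → Literature.Geometry.Lorentzian.InitialDataSet (𝓡 3) X), Literature.Geometry.Lorentzian.InitialDataSet.IsTameDataFamily e 1 F ∧ Literature.Geometry.Lorentzian.InitialDataSet.IsImmersedAtZero 1 F ∧ F 0 = d ∧ Injective F ∧ (∀ c, F c ∈ Literature.Geometry.Lorentzian.admissibleVacuumData X) ∧ ∀ c ≠ 0, P (F c)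

/-- item stmt-FinalStateConjecture-25599 · support · rank 9 · open · by planner
why it might fail: the set of trapped data with exactly extremal remnants could be tame-thick (accumulating on itself along every tame line through a member), or every tame exit from it could pass through uncensored data; vacuum extremal Kerr formation itself is open (arXiv:2402.10190 p.12).
sources: arXiv:2211.15742, arXiv:2402.10190, arXiv:2304.08455, Aretakis2015, arXiv:1402.7034, Israel1986
[crux] PIECE 𝓣₃ — TrappedExtremalExit [WEAKER·COUNTS·SPECIAL-TYPE — critic CLEARED
2026-08-30T02:40:09Z; generic THIRD LAW after trapping (transversal crossing of |a_f|/M_f = 1 along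
a tame line) + pointwise C⁰→C² upgrade at sub-extremal members (content pinned by
stmt-FinalStateConjecture-17298 SubextremalUpgrade, cited by name); MODEL-ANALOGUE in print not a
rung (arXiv:2211.15742 Thm 1); INSTRUMENTABLE (remnant-spin census); BARRIER AretakisInstability
OUTSIDE (asks to leave the cell)]. For every Σ and every admissible P_Σ-exceptional datum d, not of
dispersive type, all of whose MGHDs contain a closed trapped sphere to the future of the data, and
which SATISFIES the weak C⁰ property P_w⁰ (an MGHD exists; every MGHD has complete 𝓘⁺ and an honest
C⁰ Kerr final-state decomposition with |a_i| ≤ M_i and the Statement's four clauses) — so that,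
given the registered pointwise upgrade stmt-17298, d fails P_Σ exactly because one of its MGHDs has
only end states with an exactly extremal hole — there are one end e and a tame immersed injective
one-parameter family F of admissible data with F 0 = d whose members c ≠ 0 satisfy P_Σ. Content: the
generic third law after trapping (final |a_f|/ -/
@[route_item "route-FinalStateConjecture-RootDecompSobolevLedgerCells", crux]
def TrappedExtremalExit : Prop :=
  ∀ (X : Type) [TopologicalSpace X] [ChartedSpace Literature.Geometry.Lorentzian.E3 X] [IsManifold (𝓡 3) ((⊤ : ℕ∞) : WithTop ℕ∞) X] [T2Space X] [SecondCountableTopology X] [ConnectedSpace X], let P : Literature.Geometry.Lorentzian.InitialDataSet (𝓡 3) X → Prop := fun D ↦ (∃ 𝒟 : Literature.Geometry.Lorentzian.VacuumCauchyDevelopment D, 𝒟.IsMaximal) ∧ ∀ 𝒟 : Literature.Geometry.Lorentzian.VacuumCauchyDevelopment D, 𝒟.IsMaximal → Summit.FinalStateConjecture.HasCompleteNullInfinity 𝒟.toCauchyDevelopment ∧ ∃ (O : Set 𝒟.carrier) (d : Literature.Geometry.Lorentzian.FinalStateDecomposition 𝒟.toSpacetime O 2), (∀ i, Literature.Geometry.Lorentzian.Kerr.IsSubextremal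 (d.mass i) (d.spin i)) ∧ O = Summit.FinalStateConjecture.exteriorOf 𝒟.toCauchyDevelopment d.charted ∧ Summit.FinalStateConjecture.RaysStayInClosure 𝒟.toCauchyDevelopment O ∧ Summit.FinalStateConjecture.HasExhaustiveCharts d ∧ Summit.FinalStateConjecture.IsFutureOriented d; let Pw0 : Literature.Geometry.Lorentzian.InitialDataSet (𝓡 3) X → Prop := fun D ↦ (∃ 𝒟 : Literature.Geometry.Lorentzian.VacuumCauchyDevelopment D, 𝒟.IsMaximal) ∧ ∀ 𝒟 : Literature.Geometry.Lorentzian.VacuumCauchyDevelopment D, 𝒟.IsMaximal → Summit.FinalStateConjecture.HasCompleteNullInfinity 𝒟.toCauchyDevelopment ∧ ∃ (O : Set 𝒟.carrier) (d : Literature.Geometry.Lorentzian.FinalStateDecomposition 𝒟.toSpacetime O 0), O = Summit.FinalStateConjecture.exteriorOf 𝒟.toCauchyDevelopment d.charted ∧ Summit.FinalStateConjecture.RaysStayInClosure 𝒟.toCauchyDevelopment O ∧ Summit.FinalStateConjecture.HasExhaustiveCharts d ∧ Summit.FinalStateConjecture.IsFutureOriented d; let Disp : Literature.Geometry.Lorentzian.InitialDataSet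 (𝓡 3) X → Prop := fun D ↦ (∃ 𝒟 : Literature.Geometry.Lorentzian.VacuumCauchyDevelopment D, 𝒟.IsMaximal) ∧ ∀ 𝒟 : Literature.Geometry.Lorentzian.VacuumCauchyDevelopment D, 𝒟.IsMaximal → ∀ [𝒟.metric.HasLeviCivita], ¬ 𝒟.metric.IsFutureNullGeodesicallyIncomplete 𝒟.timeOrientation ∧ ¬ 𝒟.metric.IsFutureTimelikeGeodesicallyIncomplete 𝒟.timeOrientation; let Trap : Literature.Geometry.Lorentzian.InitialDataSet (𝓡 3) X → Prop := fun D ↦ (∃ 𝒟 : Literature.Geometry.Lorentzian.VacuumCauchyDevelopment D, 𝒟.IsMaximal) ∧ ∀ 𝒟 : Literature.Geometry.Lorentzian.VacuumCauchyDevelopment D, 𝒟.IsMaximal → ∀ [𝒟.metric.HasLeviCivita], ∃ f : Metric.sphere (0 : Literature.Geometry.Lorentzian.E3) 1 → 𝒟.carrier, Set.range f ⊆ 𝒟.metric.causalFuture 𝒟.timeOrientation (Set.range 𝒟.embed) ∧ 𝒟.metric.IsTrappedSurface (𝓡 2) 𝒟.timeOrientation f; ∀ d ∈ Literature.Geometry.Lorentzian.admissibleVacuumData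 X, ¬ P d → (¬ Disp d ∧ Trap d ∧ Pw0 d) → ∃ (e : Literature.Geometry.Lorentzian.AFEnd X) (F : EuclideanSpace ℝ (Fin 1) → Literature.Geometry.Lorentzian.InitialDataSet (𝓡 3) X), Literature.Geometry.Lorentzian.InitialDataSet.IsTameDataFamily e 1 F ∧ Literature.Geometry.Lorentzian.InitialDataSet.IsImmersedAtZero 1 F ∧ F 0 = d ∧ Injective F ∧ (∀ c, F c ∈ Literature.Geometry.Lorentzian.admissibleVacuumData X) ∧ ∀ c ≠ 0, P (F c)

/-- item stmt-FinalStateConjecture-26646 · support · rank 9 · open · by planner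
why it might fail: A tame-open set of admissible data whose MGHD keeps two holes on an eternal quasi-periodic censored orbit (a vacuum 'floating' binary), or n ≥ 3 co-axial multi-Kerr(–NUT) equilibria that exist AND are attained from an open set, would refute it; n ≥ 3 non-existence is open (CCH12 p.14).
sources: doi:10.1007/BF00770326, arXiv:0905.4179, arXiv:1103.5248, arXiv:1105.5830, arXiv:1111.1448, arXiv:0811.1727
[crux · child 𝓣₂² of TrappedCaptureExit · SPECIAL-TYPE (configurational) · INSTRUMENTABLE; CLEARED
by decomp-fsc-crit-1-g0 2026-08-30T03:23:32Z (k = 3 chosen); writer glue/exactness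
folder/n2bg3/Sketch.lean rc 0 / 0 sorry.] For every Σ and every admissible P_Σ-exceptional datum d
of the capture cell 𝓣₂ (not of dispersive type; every MGHD contains a closed trapped sphere in the
causal future of the data; every MGHD has complete future null infinity; d fails the weak C⁰
property P_w⁰) SOME of whose MGHDs ends with AT LEAST TWO black holes (𝓑⁺ not preconnected) and ALL
of whose MGHDs end with FINITELY MANY (Finite (ConnectedComponents ↥𝓑⁺)), there are one end e and a
tame (order 1 at e), immersed-at-0, injective one-parameter family F of admissible data with F 0 = d
all of whose members c ≠ 0 satisfy P_Σ. Content = the generic MANY-BODY sector of the capture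
problem: (i) no eternal non-merging bound binary with censored exterior (radiative dissipation),
(ii) no stationary n-horizon vacuum equilibrium to park at (static: Bunting–Masood-ul-Alam 1987,
Beig–Gibbons–Schoen 2009; n = 2 stationary: Neugebauer–Hennig + Chruściel et al., CCH12 Thm 3.6; n ≥
3 widely open), (iii) capture of each -/
@[route_item "route-FinalStateConjecture-RootDecompSobolevLedgerCells", crux]
def MultiHoleCaptureExit : Prop :=
  ∀ (X : Type) [TopologicalSpace X] [ChartedSpace Literature.Geometry.Lorentzian.E3 X] [IsManifold (𝓡 3) ((⊤ : ℕ∞) : WithTop ℕ∞) X] [T2Space X] [SecondCountableTopology X] [ConnectedSpace X], let P : Literature.Geometry.Lorentzian.InitialDataSet (𝓡 3) X → Prop := fun D ↦ (∃ 𝒟 : Literature.Geometry.Lorentzian.VacuumCauchyDevelopment D, 𝒟.IsMaximal) ∧ ∀ 𝒟 : Literature.Geometry.Lorentzian.VacuumCauchyDevelopment D, 𝒟.IsMaximal → Summit.FinalStateConjecture.HasCompleteNullInfinity 𝒟.toCauchyDevelopment ∧ ∃ (O : Set 𝒟.carrier) (d : Literature.Geometry.Lorentzian.FinalStateDecomposition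 𝒟.toSpacetime O 2), (∀ i, Literature.Geometry.Lorentzian.Kerr.IsSubextremal (d.mass i) (d.spin i)) ∧ O = Summit.FinalStateConjecture.exteriorOf 𝒟.toCauchyDevelopment d.charted ∧ Summit.FinalStateConjecture.RaysStayInClosure 𝒟.toCauchyDevelopment O ∧ Summit.FinalStateConjecture.HasExhaustiveCharts d ∧ Summit.FinalStateConjecture.IsFutureOriented d; let Pw0 : Literature.Geometry.Lorentzian.InitialDataSet (𝓡 3) X → Prop := fun D ↦ (∃ 𝒟 : Literature.Geometry.Lorentzian.VacuumCauchyDevelopment D, 𝒟.IsMaximal) ∧ ∀ 𝒟 : Literature.Geometry.Lorentzian.VacuumCauchyDevelopment D, 𝒟.IsMaximal → Summit.FinalStateConjecture.HasCompleteNullInfinity 𝒟.toCauchyDevelopment ∧ ∃ (O : Set 𝒟.carrier) (d : Literature.Geometry.Lorentzian.FinalStateDecomposition 𝒟.toSpacetime O 0), O = Summit.FinalStateConjecture.exteriorOf 𝒟.toCauchyDevelopment d.charted ∧ Summit.FinalStateConjecture.RaysStayInClosure 𝒟.toCauchyDevelopment O ∧ Summit.FinalStateConjecture.HasExhaustiveCharts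 d ∧ Summit.FinalStateConjecture.IsFutureOriented d; let Disp : Literature.Geometry.Lorentzian.InitialDataSet (𝓡 3) X → Prop := fun D ↦ (∃ 𝒟 : Literature.Geometry.Lorentzian.VacuumCauchyDevelopment D, 𝒟.IsMaximal) ∧ ∀ 𝒟 : Literature.Geometry.Lorentzian.VacuumCauchyDevelopment D, 𝒟.IsMaximal → ∀ [𝒟.metric.HasLeviCivita], ¬ 𝒟.metric.IsFutureNullGeodesicallyIncomplete 𝒟.timeOrientation ∧ ¬ 𝒟.metric.IsFutureTimelikeGeodesicallyIncomplete 𝒟.timeOrientation; let Trap : Literature.Geometry.Lorentzian.InitialDataSet (𝓡 3) X → Prop := fun D ↦ (∃ 𝒟 : Literature.Geometry.Lorentzian.VacuumCauchyDevelopment D, 𝒟.IsMaximal) ∧ ∀ 𝒟 : Literature.Geometry.Lorentzian.VacuumCauchyDevelopment D, 𝒟.IsMaximal → ∀ [𝒟.metric.HasLeviCivita], ∃ f : Metric.sphere (0 : Literature.Geometry.Lorentzian.E3) 1 → 𝒟.carrier, Set.range f ⊆ 𝒟.metric.causalFuture 𝒟.timeOrientation (Set.range 𝒟.embed) ∧ 𝒟.metric.IsTrappedSurface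 (𝓡 2) 𝒟.timeOrientation f; let Cens : Literature.Geometry.Lorentzian.InitialDataSet (𝓡 3) X → Prop := fun D ↦ ∀ 𝒟 : Literature.Geometry.Lorentzian.VacuumCauchyDevelopment D, 𝒟.IsMaximal → Summit.FinalStateConjecture.HasCompleteNullInfinity 𝒟.toCauchyDevelopment; let Single : Literature.Geometry.Lorentzian.InitialDataSet (𝓡 3) X → Prop := fun D ↦ ∀ 𝒟 : Literature.Geometry.Lorentzian.VacuumCauchyDevelopment D, 𝒟.IsMaximal → ∀ [𝒟.metric.HasLeviCivita], Subsingleton (ConnectedComponents ↥(Literature.Geometry.Lorentzian.DataEmbedding.blackHoleRegion 𝒟.toDataEmbedding ∩ 𝒟.metric.causalFuture 𝒟.timeOrientation (Set.range 𝒟.embed))); let FinMany : Literature.Geometry.Lorentzian.InitialDataSet (𝓡 3) X → Prop := fun D ↦ ∀ 𝒟 : Literature.Geometry.Lorentzian.VacuumCauchyDevelopment D, 𝒟.IsMaximal → ∀ [𝒟.metric.HasLeviCivita], Finite (ConnectedComponents ↥(Literature.Geometry.Lorentzian.DataEmbedding.blackHoleRegion 𝒟.toDataEmbedding ∩ 𝒟.metric.causalFuture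 𝒟.timeOrientation (Set.range 𝒟.embed))); ∀ d ∈ Literature.Geometry.Lorentzian.admissibleVacuumData X, ¬ P d → ((¬ Disp d ∧ Trap d ∧ Cens d ∧ ¬ Pw0 d) ∧ ¬ Single d ∧ FinMany d) → ∃ (e : Literature.Geometry.Lorentzian.AFEnd X) (F : EuclideanSpace ℝ (Fin 1) → Literature.Geometry.Lorentzian.InitialDataSet (𝓡 3) X), Literature.Geometry.Lorentzian.InitialDataSet.IsTameDataFamily e 1 F ∧ Literature.Geometry.Lorentzian.InitialDataSet.IsImmersedAtZero 1 F ∧ F 0 = d ∧ Injective F ∧ (∀ c, F c ∈ Literature.Geometry.Lorentzian.admissibleVacuumData X) ∧ ∀ c ≠ 0, P (F c)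

/-- item stmt-FinalStateConjecture-27604 · support · rank 9 · open · by planner
why it might fail: Vacuous iff 13847 FiniteCensus holds on the cell; a single-final-hole development whose future slices carry unboundedly many disjoint shrinking outermost-MOTS bodies (not excluded by Penrose-type area/mass heuristics) would make it contentful and as hard as 26645 there.
sources: HawkingEllis1973, AnderssonMetzgerTrapped2009, arXiv:0805.3880, arXiv:1407.4766, doi:10.1103/PhysRevLett.14.57
[support · THIN BRIDGE ⟸ stmt-13847 · conjecturally VACUOUS · dominated] lens-5 g4
«FutureCensusCarve» child 2 of SingleHoleCaptureExit (stmt-26645; CLEARED[split]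
2026-08-30T04:18:58Z): the cell 𝓒 AND ¬CenFinF d (one final hole, yet some MGHD carries future
Cauchy slices with arbitrarily many pairwise-disjoint outermost-MOTS bodies) — admits a tame
injective exit line with P verbatim. Registered kill path: stmt-13847 CriticalAncestry.FiniteCensus
⟹ this item, kernel-certified by the lens as cascadeSingleExit_of_finiteCensus : FiniteCensusR →
CascadeSingleExit (an unbundled future slice IS a CauchyDevelopment D′ with rfl-same spacetime;
FiniteCensusR = character-identical copy of 13847 because importing Theses.CriticalAncestry answers
rc 75 unbuilt) — modus ponens, no analysis; closes the day 13847 closes. Kind support = per-route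
bookkeeping for a dominated bridge (it never drives staffing). c5 harmless here (13847 carries the
same clause). -/
@[route_item "route-FinalStateConjecture-RootDecompSobolevLedgerCells", crux]
def CascadeSingleExit : Prop :=
  ∀ (X : Type) [TopologicalSpace X] [ChartedSpace Literature.Geometry.Lorentzian.E3 X] [IsManifold (𝓡 3) ((⊤ : ℕ∞) : WithTop ℕ∞) X] [T2Space X] [SecondCountableTopology X] [ConnectedSpace X], let P : Literature.Geometry.Lorentzian.InitialDataSet (𝓡 3) X → Prop := fun D ↦ (∃ 𝒟 : Literature.Geometry.Lorentzian.VacuumCauchyDevelopment D, 𝒟.IsMaximal) ∧ ∀ 𝒟 : Literature.Geometry.Lorentzian.VacuumCauchyDevelopment D, 𝒟.IsMaximal → Summit.FinalStateConjecture.HasCompleteNullInfinity 𝒟.toCauchyDevelopment ∧ ∃ (O : Set 𝒟.carrier) (d : Literature.Geometry.Lorentzian.FinalStateDecomposition 𝒟.toSpacetime O 2), (∀ i, Literature.Geometry.Lorentzian.Kerr.IsSubextremal (d.mass i) (d.spin i)) ∧ O = Summit.FinalStateConjecture.exteriorOf 𝒟.toCauchyDevelopment d.charted ∧ Summit.FinalStateConjecture.RaysStayInClosure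 𝒟.toCauchyDevelopment O ∧ Summit.FinalStateConjecture.HasExhaustiveCharts d ∧ Summit.FinalStateConjecture.IsFutureOriented d; let Pw0 : Literature.Geometry.Lorentzian.InitialDataSet (𝓡 3) X → Prop := fun D ↦ (∃ 𝒟 : Literature.Geometry.Lorentzian.VacuumCauchyDevelopment D, 𝒟.IsMaximal) ∧ ∀ 𝒟 : Literature.Geometry.Lorentzian.VacuumCauchyDevelopment D, 𝒟.IsMaximal → Summit.FinalStateConjecture.HasCompleteNullInfinity 𝒟.toCauchyDevelopment ∧ ∃ (O : Set 𝒟.carrier) (d : Literature.Geometry.Lorentzian.FinalStateDecomposition 𝒟.toSpacetime O 0), O = Summit.FinalStateConjecture.exteriorOf 𝒟.toCauchyDevelopment d.charted ∧ Summit.FinalStateConjecture.RaysStayInClosure 𝒟.toCauchyDevelopment O ∧ Summit.FinalStateConjecture.HasExhaustiveCharts d ∧ Summit.FinalStateConjecture.IsFutureOriented d; let Disp : Literature.Geometry.Lorentzian.InitialDataSet (𝓡 3) X → Prop := fun D ↦ (∃ 𝒟 : Literature.Geometry.Lorentzian.VacuumCauchyDevelopment D, 𝒟.IsMaximal) ∧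 ∀ 𝒟 : Literature.Geometry.Lorentzian.VacuumCauchyDevelopment D, 𝒟.IsMaximal → ∀ [𝒟.metric.HasLeviCivita], ¬ 𝒟.metric.IsFutureNullGeodesicallyIncomplete 𝒟.timeOrientation ∧ ¬ 𝒟.metric.IsFutureTimelikeGeodesicallyIncomplete 𝒟.timeOrientation; let Trap : Literature.Geometry.Lorentzian.InitialDataSet (𝓡 3) X → Prop := fun D ↦ (∃ 𝒟 : Literature.Geometry.Lorentzian.VacuumCauchyDevelopment D, 𝒟.IsMaximal) ∧ ∀ 𝒟 : Literature.Geometry.Lorentzian.VacuumCauchyDevelopment D, 𝒟.IsMaximal → ∀ [𝒟.metric.HasLeviCivita], ∃ f : Metric.sphere (0 : Literature.Geometry.Lorentzian.E3) 1 → 𝒟.carrier, Set.range f ⊆ 𝒟.metric.causalFuture 𝒟.timeOrientation (Set.range 𝒟.embed) ∧ 𝒟.metric.IsTrappedSurface (𝓡 2) 𝒟.timeOrientation f; let Cens : Literature.Geometry.Lorentzian.InitialDataSet (𝓡 3) X → Prop := fun D ↦ ∀ 𝒟 : Literature.Geometry.Lorentzian.VacuumCauchyDevelopment D, 𝒟.IsMaximal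 → Summit.FinalStateConjecture.HasCompleteNullInfinity 𝒟.toCauchyDevelopment; let Single : Literature.Geometry.Lorentzian.InitialDataSet (𝓡 3) X → Prop := fun D ↦ ∀ 𝒟 : Literature.Geometry.Lorentzian.VacuumCauchyDevelopment D, 𝒟.IsMaximal → ∀ [𝒟.metric.HasLeviCivita], Subsingleton (ConnectedComponents ↥(Literature.Geometry.Lorentzian.DataEmbedding.blackHoleRegion 𝒟.toDataEmbedding ∩ 𝒟.metric.causalFuture 𝒟.timeOrientation (Set.range 𝒟.embed))); let CenFinF : Literature.Geometry.Lorentzian.InitialDataSet (𝓡 3) X → Prop := fun D ↦ ∀ 𝒟 : Literature.Geometry.Lorentzian.VacuumCauchyDevelopment D, 𝒟.IsMaximal → ∃ n : ℕ, ∀ (X' : Type) [TopologicalSpace X'] [ChartedSpace Literature.Geometry.Lorentzian.E3 X'] [IsManifold (𝓡 3) ((⊤ : ℕ∞) : WithTop ℕ∞) X'] [ConnectedSpace X'] (D' : Literature.Geometry.Lorentzian.InitialDataSet (𝓡 3) X') (ι' : X' → 𝒟.carrier) (ν' : Literature.Geometry.Lorentzian.NormalField (𝓡 4) ι'), Manifold.IsSmoothEmbedding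 (𝓡 3) (𝓡 4) ((⊤ : ℕ∞) : WithTop ℕ∞) ι' → 𝒟.metric.IsFutureUnitNormal (𝓡 3) 𝒟.timeOrientation ι' ν' → (∀ y : X', Literature.Geometry.Lorentzian.pullbackBilin (I := 𝓡 4) (I' := 𝓡 3) ι' 𝒟.metric.val y = D'.h.inner y) → (∀ [𝒟.metric.toPseudoRiemannianMetric.HasLeviCivita] (y : X'), 𝒟.metric.toPseudoRiemannianMetric.secondFundamentalForm (𝓡 3) ι' ν' y = D'.kBilin y) → 𝒟.metric.IsCauchyHypersurface 𝒟.timeOrientation (Set.range ι') → Set.range ι' ⊆ 𝒟.metric.causalFuture 𝒟.timeOrientation (Set.range 𝒟.embed) → ∀ S : Fin (n + 1) → Literature.Geometry.Lorentzian.OutermostMOTS (𝓡 3) D'.h D'.k, (∀ j, ConnectedSpace (S j).surf) → (∀ j, IsCompact (((S j).exterior : Set X'))ᶜ ∧ (interior (((S j).exterior : Set X'))ᶜ).Nonempty) → ∃ j j', j ≠ j' ∧ ((((S j).exterior : Set X'))ᶜ ∩ (((S j').exterior : Set X'))ᶜ).Nonempty; ∀ d ∈ Literature.Geometry.Lorentzian.admissibleVacuumData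 X, ¬ P d → (((¬ Disp d ∧ Trap d ∧ Cens d ∧ ¬ Pw0 d) ∧ Single d) ∧ ¬ CenFinF d) → ∃ (e : Literature.Geometry.Lorentzian.AFEnd X) (F : EuclideanSpace ℝ (Fin 1) → Literature.Geometry.Lorentzian.InitialDataSet (𝓡 3) X), Literature.Geometry.Lorentzian.InitialDataSet.IsTameDataFamily e 1 F ∧ Literature.Geometry.Lorentzian.InitialDataSet.IsImmersedAtZero 1 F ∧ F 0 = d ∧ Injective F ∧ (∀ c, F c ∈ Literature.Geometry.Lorentzian.admissibleVacuumData X) ∧ ∀ c ≠ 0, P (F c)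

/-- item stmt-FinalStateConjecture-29290 · support · rank 9 · open · by planner
why it might fail: Empty only modulo S1∧S3∧S2: should the identification of the Klainerman–Nicolò exterior cones with ∂J⁺(K) inside an arbitrary MGHD fail (causal bridge) the door would carry content; else none — K–N is printed for all data sizes.
sources: KlainermanNicolo2003 Thm 3.7.1, Thm 8.5.2, Thm 8.5.3, Bartnik1986 Thm 4.2, ChoquetBruhatGeroch1969
[support · THIN · EMPTY GIVEN SUPPORTS · does NOT count · door Dₙ of lens-5 g6 «FarLedgerCells» on
stmt-28426 (critic CLEARED 2026-08-30T06:07:07Z, RULING R1 06:11:22Z)] Same population as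
NoChargeExit (censored single-hole data, admissible, not dispersive, every MGHD traps, complete 𝓘⁺,
weak C⁰-Kerr capture fails, at most one final hole, bounded future census, ¬Acc d: no honest Bondi
account) AND the datum's TAIL lies in the Klainerman–Nicolò class KN d := d.IsMaximalData ∧ ∃ (e :
AFEnd X) (M η : ℝ), 0 < η ∧ e.IsSoleEnd ∧ e.IsStronglyAsymptoticallyFlatWith d M (3/2+η) (5/2+η) 4 3
(VERBATIM the hypothesis block of the tree fact klainerman_nicolo_exterior_null_completeness; large
data allowed, no hand-picked threshold): exit tamely with codimension ≥ 1. EMPTY once three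
cell-free porting-grade supports are theorems — kernel farAccountDoor_of_ledgers :
ExteriorBondiLedger (S1 = D9 wi-97120: K–N Ch. 8 exterior Bondi ledger + causal bridge) →
ADMChartLedger (S3 = D10 wi-97121: ADM 4-momentum chart invariance) → ChargeCoherence (S2 =
wi-96536: CBG development transport) → FarAccountDoor (std axioms); kill path = land that theorem
--supports this item once S1–S3 are in the tree. Text = l -/
@[route_item "route-FinalStateConjecture-RootDecompSobolevLedgerCells", crux]
def FarAccountDoor : Prop :=
  ∀ (X : Type) [TopologicalSpace X] [ChartedSpace Literature.Geometry.Lorentzian.E3 X] [IsManifold (𝓡 3) ((⊤ : ℕ∞) : WithTop ℕ∞) X] [T2Space X] [SecondCountableTopology X] [ConnectedSpace X], let P : Literature.Geometry.Lorentzian.InitialDataSet (𝓡 3) X → Prop := fun D ↦ (∃ 𝒟 : Literature.Geometry.Lorentzian.VacuumCauchyDevelopment D, 𝒟.IsMaximal) ∧ ∀ 𝒟 : Literature.Geometry.Lorentzian.VacuumCauchyDevelopment D, 𝒟.IsMaximal → Summit.FinalStateConjecture.HasCompleteNullInfinity 𝒟.toCauchyDevelopment ∧ ∃ (O : Set 𝒟.carrier)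 (d : Literature.Geometry.Lorentzian.FinalStateDecomposition 𝒟.toSpacetime O 2), (∀ i, Literature.Geometry.Lorentzian.Kerr.IsSubextremal (d.mass i) (d.spin i)) ∧ O = Summit.FinalStateConjecture.exteriorOf 𝒟.toCauchyDevelopment d.charted ∧ Summit.FinalStateConjecture.RaysStayInClosure 𝒟.toCauchyDevelopment O ∧ Summit.FinalStateConjecture.HasExhaustiveCharts d ∧ Summit.FinalStateConjecture.IsFutureOriented d; let Pw0 : Literature.Geometry.Lorentzian.InitialDataSet (𝓡 3) X → Prop := fun D ↦ (∃ 𝒟 : Literature.Geometry.Lorentzian.VacuumCauchyDevelopment D, 𝒟.IsMaximal) ∧ ∀ 𝒟 : Literature.Geometry.Lorentzian.VacuumCauchyDevelopment D, 𝒟.IsMaximal → Summit.FinalStateConjecture.HasCompleteNullInfinity 𝒟.toCauchyDevelopment ∧ ∃ (O : Set 𝒟.carrier) (d : Literature.Geometry.Lorentzian.FinalStateDecomposition 𝒟.toSpacetime O 0), O = Summit.FinalStateConjecture.exteriorOf 𝒟.toCauchyDevelopment d.charted ∧ Summit.FinalStateConjecture.RaysStayInClosure 𝒟.toCauchyDevelopment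 O ∧ Summit.FinalStateConjecture.HasExhaustiveCharts d ∧ Summit.FinalStateConjecture.IsFutureOriented d; let Disp : Literature.Geometry.Lorentzian.InitialDataSet (𝓡 3) X → Prop := fun D ↦ (∃ 𝒟 : Literature.Geometry.Lorentzian.VacuumCauchyDevelopment D, 𝒟.IsMaximal) ∧ ∀ 𝒟 : Literature.Geometry.Lorentzian.VacuumCauchyDevelopment D, 𝒟.IsMaximal → ∀ [𝒟.metric.HasLeviCivita], ¬ 𝒟.metric.IsFutureNullGeodesicallyIncomplete 𝒟.timeOrientation ∧ ¬ 𝒟.metric.IsFutureTimelikeGeodesicallyIncomplete 𝒟.timeOrientation; let Trap : Literature.Geometry.Lorentzian.InitialDataSet (𝓡 3) X → Prop := fun D ↦ (∃ 𝒟 : Literature.Geometry.Lorentzian.VacuumCauchyDevelopment D, 𝒟.IsMaximal) ∧ ∀ 𝒟 : Literature.Geometry.Lorentzian.VacuumCauchyDevelopment D, 𝒟.IsMaximal → ∀ [𝒟.metric.HasLeviCivita], ∃ f : Metric.sphere (0 : Literature.Geometry.Lorentzian.E3) 1 → 𝒟.carrier, Set.range f ⊆ 𝒟.metric.causalFuture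 𝒟.timeOrientation (Set.range 𝒟.embed) ∧ 𝒟.metric.IsTrappedSurface (𝓡 2) 𝒟.timeOrientation f; let Cens : Literature.Geometry.Lorentzian.InitialDataSet (𝓡 3) X → Prop := fun D ↦ ∀ 𝒟 : Literature.Geometry.Lorentzian.VacuumCauchyDevelopment D, 𝒟.IsMaximal → Summit.FinalStateConjecture.HasCompleteNullInfinity 𝒟.toCauchyDevelopment; let Single : Literature.Geometry.Lorentzian.InitialDataSet (𝓡 3) X → Prop := fun D ↦ ∀ 𝒟 : Literature.Geometry.Lorentzian.VacuumCauchyDevelopment D, 𝒟.IsMaximal → ∀ [𝒟.metric.HasLeviCivita], Subsingleton (ConnectedComponents ↥(Literature.Geometry.Lorentzian.DataEmbedding.blackHoleRegion 𝒟.toDataEmbedding ∩ 𝒟.metric.causalFuture 𝒟.timeOrientation (Set.range 𝒟.embed))); let CenFinF : Literature.Geometry.Lorentzian.InitialDataSet (𝓡 3) X → Prop := fun D ↦ ∀ 𝒟 : Literature.Geometry.Lorentzian.VacuumCauchyDevelopment D, 𝒟.IsMaximal → ∃ n : ℕ, ∀ (X' : Type) [TopologicalSpace X'] [ChartedSpace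 Literature.Geometry.Lorentzian.E3 X'] [IsManifold (𝓡 3) ((⊤ : ℕ∞) : WithTop ℕ∞) X'] [ConnectedSpace X'] (D' : Literature.Geometry.Lorentzian.InitialDataSet (𝓡 3) X') (ι' : X' → 𝒟.carrier) (ν' : Literature.Geometry.Lorentzian.NormalField (𝓡 4) ι'), Manifold.IsSmoothEmbedding (𝓡 3) (𝓡 4) ((⊤ : ℕ∞) : WithTop ℕ∞) ι' → 𝒟.metric.IsFutureUnitNormal (𝓡 3) 𝒟.timeOrientation ι' ν' → (∀ y : X', Literature.Geometry.Lorentzian.pullbackBilin (I := 𝓡 4) (I' := 𝓡 3) ι' 𝒟.metric.val y = D'.h.inner y) → (∀ [𝒟.metric.toPseudoRiemannianMetric.HasLeviCivita] (y : X'), 𝒟.metric.toPseudoRiemannianMetric.secondFundamentalForm (𝓡 3) ι' ν' y = D'.kBilin y) → 𝒟.metric.IsCauchyHypersurface 𝒟.timeOrientation (Set.range ι') → Set.range ι' ⊆ 𝒟.metric.causalFuture 𝒟.timeOrientation (Set.range 𝒟.embed) → ∀ S : Fin (n + 1) → Literature.Geometry.Lorentzian.OutermostMOTS (𝓡 3)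 D'.h D'.k, (∀ j, ConnectedSpace (S j).surf) → (∀ j, IsCompact (((S j).exterior : Set X'))ᶜ ∧ (interior (((S j).exterior : Set X'))ᶜ).Nonempty) → ∃ j j', j ≠ j' ∧ ((((S j).exterior : Set X'))ᶜ ∩ (((S j').exterior : Set X'))ᶜ).Nonempty; let MassF : (D : Literature.Geometry.Lorentzian.InitialDataSet (𝓡 3) X) → Literature.Geometry.Lorentzian.VacuumCauchyDevelopment D → ENNReal := fun D 𝒟 ↦ ⨅ (K : Set 𝒟.carrier) (_ : IsCompact K) (m : ℝ) (_ : 𝒟.toCauchyDevelopment.HasCutBondiMass K m), ENNReal.ofReal m; let AreaF : (D : Literature.Geometry.Lorentzian.InitialDataSet (𝓡 3) X) → (𝒟 : Literature.Geometry.Lorentzian.VacuumCauchyDevelopment D) → [𝒟.metric.HasLeviCivita] → ENNReal := fun D 𝒟 hLC ↦ sInf {a : ENNReal | ∀ (X' : Type) [TopologicalSpace X'] [ChartedSpace Literature.Geometry.Lorentzian.E3 X'] [IsManifold (𝓡 3) ((⊤ : ℕ∞) : WithTop ℕ∞) X'] [ConnectedSpace X'] [T2Space X'] (D' : Literature.Geometry.Lorentzian.InitialDataSet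 (𝓡 3) X') (ι' : X' → 𝒟.carrier) (ν' : Literature.Geometry.Lorentzian.NormalField (𝓡 4) ι'), Manifold.IsSmoothEmbedding (𝓡 3) (𝓡 4) ((⊤ : ℕ∞) : WithTop ℕ∞) ι' → 𝒟.metric.IsFutureUnitNormal (𝓡 3) 𝒟.timeOrientation ι' ν' → (∀ y : X', Literature.Geometry.Lorentzian.pullbackBilin (I := 𝓡 4) (I' := 𝓡 3) ι' 𝒟.metric.val y = D'.h.inner y) → (∀ [𝒟.metric.toPseudoRiemannianMetric.HasLeviCivita] (y : X'), 𝒟.metric.toPseudoRiemannianMetric.secondFundamentalForm (𝓡 3) ι' ν' y = D'.kBilin y) → 𝒟.metric.IsCauchyHypersurface 𝒟.timeOrientation (Set.range ι') → Set.range ι' ⊆ 𝒟.metric.causalFuture 𝒟.timeOrientation (Set.range 𝒟.embed) → (letI : MeasurableSpace X' := borel X'; haveI : BorelSpace X' := ⟨rfl⟩; haveI : LocallyCompactSpace X' := ChartedSpace.locallyCompactSpace Literature.Geometry.Lorentzian.E3 X'; Literature.Geometry.Lorentzian.area D'.h (ι' ⁻¹' Literature.Geometry.Lorentzian.DataEmbedding.futureEventHorizon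 𝒟.toDataEmbedding)) ≤ a}; let Acc : Literature.Geometry.Lorentzian.InitialDataSet (𝓡 3) X → Prop := fun D ↦ ∃ (M A : ENNReal), M ≠ ⊤ ∧ (∀ e : Literature.Geometry.Lorentzian.AFEnd X, e.IsAsymptoticallyFlat D 1 → (∃ m, e.HasADMEnergy D m) → M ≤ ENNReal.ofReal (e.admMass D)) ∧ ∀ 𝒟 : Literature.Geometry.Lorentzian.VacuumCauchyDevelopment D, 𝒟.IsMaximal → ∀ [𝒟.metric.HasLeviCivita], MassF D 𝒟 = M ∧ AreaF D 𝒟 = A; let KN : Literature.Geometry.Lorentzian.InitialDataSet (𝓡 3) X → Prop := fun D ↦ D.IsMaximalData ∧ ∃ (e : Literature.Geometry.Lorentzian.AFEnd X) (M η : ℝ), 0 < η ∧ e.IsSoleEnd ∧ e.IsStronglyAsymptoticallyFlatWith D M (3 / 2 + η) (5 / 2 + η) 4 3; ∀ d ∈ Literature.Geometry.Lorentzian.admissibleVacuumData X, ¬ P d → (((¬ Disp d ∧ Trap d ∧ Cens d ∧ ¬ Pw0 d) ∧ Single d) ∧ CenFinF d) → (¬ Acc d ∧ KN d) → ∃ (e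 : Literature.Geometry.Lorentzian.AFEnd X) (F : EuclideanSpace ℝ (Fin 1) → Literature.Geometry.Lorentzian.InitialDataSet (𝓡 3) X), Literature.Geometry.Lorentzian.InitialDataSet.IsTameDataFamily e 1 F ∧ Literature.Geometry.Lorentzian.InitialDataSet.IsImmersedAtZero 1 F ∧ F 0 = d ∧ Injective F ∧ (∀ c, F c ∈ Literature.Geometry.Lorentzian.admissibleVacuumData X) ∧ ∀ c ≠ 0, P (F c)

/-- item stmt-FinalStateConjecture-29872 · assembly · rank 1 · open · by planner
sources: arXiv:1612.04523
[assembly] RoughTailExit → SubextremalChargeExit → HeavyChargeExit → LightChargeExit →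
InfiniteHoleCaptureExit → FarAccountDoor → HeavyChargeDoor → MultiHoleCaptureExit → TrappedNakedExit
→ CascadeSingleExit → TrappedExtremalExit → ExtremalThresholdExit → DispersiveExit →
NakedThresholdExit → FinalStateConjecture (the fourteen leaves by signature jointly give the summit;
recorded implication, the deciding theorem is `closes`). -/
@[route_item "route-FinalStateConjecture-RootDecompSobolevLedgerCells"]
def Assembly : Prop :=
  RoughTailExit → SubextremalChargeExit → HeavyChargeExit → LightChargeExit → InfiniteHoleCaptureExit → FarAccountDoor → HeavyChargeDoor → MultiHoleCaptureExit → TrappedNakedExit → CascadeSingleExit → TrappedExtremalExit → ExtremalThresholdExit → DispersiveExit → NakedThresholdExit → _root_.FinalStateConjecture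

/-! D-0027 §2.1 — DECIDING THEOREM (planner-authored via `route open/edit --closes-file`; by planner-decomp-fsc-writer-1-g2-0 2026-08-30T07:03:58Z):
its hypotheses are this route's items and its conclusion the sub-problem Statement (glue_lint), and it elaborates with this file. -/

@[closes "route-FinalStateConjecture-RootDecompSobolevLedgerCells"] theorem closes (hK : SubextremalChargeExit) (hDr : HeavyChargeDoor) (hL : HeavyChargeExit) (hH : LightChargeExit) (hDoor : FarAccountDoor) (hRough : RoughTailExit) (hCas : CascadeSingleExit) (hMulti : MultiHoleCaptureExit) (hInf : InfiniteHoleCaptureExit) (t₁ : TrappedNakedExit) (t₃ : TrappedExtremalExit) (h₃ : ExtremalThresholdExit) (h₁ : DispersiveExit) (h₄ : NakedThresholdExit) : _root_.FinalStateConjecture := by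
  have t₂ : ∀ (X : Type) [TopologicalSpace X] [ChartedSpace Literature.Geometry.Lorentzian.E3 X] [IsManifold (𝓡 3) ((⊤ : ℕ∞) : WithTop ℕ∞) X] [T2Space X] [SecondCountableTopology X] [ConnectedSpace X], let P : Literature.Geometry.Lorentzian.InitialDataSet (𝓡 3) X → Prop := fun D ↦ (∃ 𝒟 : Literature.Geometry.Lorentzian.VacuumCauchyDevelopment D, 𝒟.IsMaximal) ∧ ∀ 𝒟 : Literature.Geometry.Lorentzian.VacuumCauchyDevelopment D, 𝒟.IsMaximal → Summit.FinalStateConjecture.HasCompleteNullInfinity 𝒟.toCauchyDevelopment ∧ ∃ (O : Set 𝒟.carrier) (d : Literature.Geometry.Lorentzian.FinalStateDecomposition 𝒟.toSpacetime O 2), (∀ i, Literature.Geometry.Lorentzian.Kerr.IsSubextremal (d.mass i) (d.spin i)) ∧ O = Summit.FinalStateConjecture.exteriorOf 𝒟.toCauchyDevelopment d.charted ∧ Summit.FinalStateConjecture.RaysStayInClosure 𝒟.toCauchyDevelopment O ∧ Summit.FinalStateConjecture.HasExhaustiveCharts d ∧ Summit.FinalStateConjecture.IsFutureOriented d; let Pw0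 : Literature.Geometry.Lorentzian.InitialDataSet (𝓡 3) X → Prop := fun D ↦ (∃ 𝒟 : Literature.Geometry.Lorentzian.VacuumCauchyDevelopment D, 𝒟.IsMaximal) ∧ ∀ 𝒟 : Literature.Geometry.Lorentzian.VacuumCauchyDevelopment D, 𝒟.IsMaximal → Summit.FinalStateConjecture.HasCompleteNullInfinity 𝒟.toCauchyDevelopment ∧ ∃ (O : Set 𝒟.carrier) (d : Literature.Geometry.Lorentzian.FinalStateDecomposition 𝒟.toSpacetime O 0), O = Summit.FinalStateConjecture.exteriorOf 𝒟.toCauchyDevelopment d.charted ∧ Summit.FinalStateConjecture.RaysStayInClosure 𝒟.toCauchyDevelopment O ∧ Summit.FinalStateConjecture.HasExhaustiveCharts d ∧ Summit.FinalStateConjecture.IsFutureOriented d; let Disp : Literature.Geometry.Lorentzian.InitialDataSet (𝓡 3) X → Prop := fun D ↦ (∃ 𝒟 : Literature.Geometry.Lorentzian.VacuumCauchyDevelopment D, 𝒟.IsMaximal) ∧ ∀ 𝒟 : Literature.Geometry.Lorentzian.VacuumCauchyDevelopment D, 𝒟.IsMaximal → ∀ [𝒟.metric.HasLeviCivita], ¬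 𝒟.metric.IsFutureNullGeodesicallyIncomplete 𝒟.timeOrientation ∧ ¬ 𝒟.metric.IsFutureTimelikeGeodesicallyIncomplete 𝒟.timeOrientation; let Trap : Literature.Geometry.Lorentzian.InitialDataSet (𝓡 3) X → Prop := fun D ↦ (∃ 𝒟 : Literature.Geometry.Lorentzian.VacuumCauchyDevelopment D, 𝒟.IsMaximal) ∧ ∀ 𝒟 : Literature.Geometry.Lorentzian.VacuumCauchyDevelopment D, 𝒟.IsMaximal → ∀ [𝒟.metric.HasLeviCivita], ∃ f : Metric.sphere (0 : Literature.Geometry.Lorentzian.E3) 1 → 𝒟.carrier, Set.range f ⊆ 𝒟.metric.causalFuture 𝒟.timeOrientation (Set.range 𝒟.embed) ∧ 𝒟.metric.IsTrappedSurface (𝓡 2) 𝒟.timeOrientation f; let Cens : Literature.Geometry.Lorentzian.InitialDataSet (𝓡 3) X → Prop := fun D ↦ ∀ 𝒟 : Literature.Geometry.Lorentzian.VacuumCauchyDevelopment D, 𝒟.IsMaximal → Summit.FinalStateConjecture.HasCompleteNullInfinity 𝒟.toCauchyDevelopment; ∀ d ∈ Literature.Geometry.Lorentzian.admissibleVacuumData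 X, ¬ P d → (¬ Disp d ∧ Trap d ∧ Cens d ∧ ¬ Pw0 d) → ∃ (e : Literature.Geometry.Lorentzian.AFEnd X) (F : EuclideanSpace ℝ (Fin 1) → Literature.Geometry.Lorentzian.InitialDataSet (𝓡 3) X), Literature.Geometry.Lorentzian.InitialDataSet.IsTameDataFamily e 1 F ∧ Literature.Geometry.Lorentzian.InitialDataSet.IsImmersedAtZero 1 F ∧ F 0 = d ∧ Injective F ∧ (∀ c, F c ∈ Literature.Geometry.Lorentzian.admissibleVacuumData X) ∧ ∀ c ≠ 0, P (F c) := by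
    intro X _ _ _ _ _ _ P Pw0 Disp Trap Cens d hd hP hcell
    exact (Classical.em _).elim (fun hS ↦ (Classical.em _).elim (fun hfin ↦ (Classical.em _).elim
          (fun hAcc ↦ (Classical.em _).elim
            (fun hKe ↦ hK X d hd hP ⟨⟨hcell, hS⟩, hfin⟩ ⟨hAcc, hKe⟩)
            (fun hKe ↦ (Classical.em _).elim
              (fun hLe ↦ (Classical.em _).elim
                (fun hHor ↦ hDr X d hd hP ⟨⟨hcell, hS⟩, hfin⟩ ⟨hAcc, hKe, hLe, hHor⟩)
                (fun hHor ↦ hL X d hd hP ⟨⟨hcell, hS⟩, hfin⟩ ⟨hAcc, hKe, hLe, hHor⟩))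
              (fun hLe ↦ hH X d hd hP ⟨⟨hcell, hS⟩, hfin⟩ ⟨hAcc, hKe, hLe⟩)))
          (fun hAcc ↦ (Classical.em _).elim (fun hKN ↦ hDoor X d hd hP ⟨⟨hcell, hS⟩, hfin⟩ ⟨hAcc, hKN⟩) (fun hKN ↦ hRough X d hd hP ⟨⟨hcell, hS⟩, hfin⟩ ⟨hAcc, hKN⟩))) (fun hfin ↦ hCas X d hd hP ⟨⟨hcell, hS⟩, hfin⟩))
      (fun hS ↦ (Classical.em _).elim (fun hF ↦ hMulti X d hd hP ⟨hcell, hS, hF⟩) (fun hF ↦ hInf X d hd hP ⟨hcell, hF⟩))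
  intro X _ _ _ _ _ _ d hd
  suffices h : ∃ (e : Literature.Geometry.Lorentzian.AFEnd X) (F : EuclideanSpace ℝ (Fin 1) → Literature.Geometry.Lorentzian.InitialDataSet (𝓡 3) X), Literature.Geometry.Lorentzian.InitialDataSet.IsTameDataFamily e 1 F ∧ Literature.Geometry.Lorentzian.InitialDataSet.IsImmersedAtZero 1 F ∧ F 0 = d ∧ Injective F ∧ (∀ c, F c ∈ Literature.Geometry.Lorentzian.admissibleVacuumData X) ∧ ∀ c ≠ 0, ((∃ 𝒟 : Literature.Geometry.Lorentzian.VacuumCauchyDevelopment (F c), 𝒟.IsMaximal) ∧ ∀ 𝒟 : Literature.Geometry.Lorentzian.VacuumCauchyDevelopment (F c), 𝒟.IsMaximal → Summit.FinalStateConjecture.HasCompleteNullInfinity 𝒟.toCauchyDevelopment ∧ ∃ (O : Set 𝒟.carrier) (d : Literature.Geometry.Lorentzian.FinalStateDecomposition 𝒟.toSpacetime O 2), (∀ i, Literature.Geometry.Lorentzian.Kerr.IsSubextremal (d.mass i) (d.spin i)) ∧ O = Summit.FinalStateConjecture.exteriorOf 𝒟.toCauchyDevelopment d.charted ∧ Summit.FinalStateConjecture.RaysStayInClosure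 𝒟.toCauchyDevelopment O ∧ Summit.FinalStateConjecture.HasExhaustiveCharts d ∧ Summit.FinalStateConjecture.IsFutureOriented d) by
    obtain ⟨e, F, h1, h2, h3, h4, h5, h6⟩ := h
    exact ⟨e, F, h1, h2, h3, h4, h5, fun c hc hmem ↦ hmem.2 (h6 c hc)⟩
  by_cases hD : (∃ 𝒟 : Literature.Geometry.Lorentzian.VacuumCauchyDevelopment d, 𝒟.IsMaximal) ∧ ∀ 𝒟 : Literature.Geometry.Lorentzian.VacuumCauchyDevelopment d, 𝒟.IsMaximal → ∀ [𝒟.metric.HasLeviCivita], ¬ 𝒟.metric.IsFutureNullGeodesicallyIncomplete 𝒟.timeOrientation ∧ ¬ 𝒟.metric.IsFutureTimelikeGeodesicallyIncomplete 𝒟.timeOrientation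
  · exact h₁ X d hd.1 hd.2 hD
  by_cases hT : (∃ 𝒟 : Literature.Geometry.Lorentzian.VacuumCauchyDevelopment d, 𝒟.IsMaximal) ∧ ∀ 𝒟 : Literature.Geometry.Lorentzian.VacuumCauchyDevelopment d, 𝒟.IsMaximal → ∀ [𝒟.metric.HasLeviCivita], ∃ f : Metric.sphere (0 : Literature.Geometry.Lorentzian.E3) 1 → 𝒟.carrier, Set.range f ⊆ 𝒟.metric.causalFuture 𝒟.timeOrientation (Set.range 𝒟.embed) ∧ 𝒟.metric.IsTrappedSurface (𝓡 2) 𝒟.timeOrientation f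
  · by_cases hW0 : (fun D ↦ (∃ 𝒟 : Literature.Geometry.Lorentzian.VacuumCauchyDevelopment D, 𝒟.IsMaximal) ∧ ∀ 𝒟 : Literature.Geometry.Lorentzian.VacuumCauchyDevelopment D, 𝒟.IsMaximal → Summit.FinalStateConjecture.HasCompleteNullInfinity 𝒟.toCauchyDevelopment ∧ ∃ (O : Set 𝒟.carrier) (d : Literature.Geometry.Lorentzian.FinalStateDecomposition 𝒟.toSpacetime O 0), O = Summit.FinalStateConjecture.exteriorOf 𝒟.toCauchyDevelopment d.charted ∧ Summit.FinalStateConjecture.RaysStayInClosure 𝒟.toCauchyDevelopment O ∧ Summit.FinalStateConjecture.HasExhaustiveCharts d ∧ Summit.FinalStateConjecture.IsFutureOriented d) d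
    · exact t₃ X d hd.1 hd.2 ⟨hD, hT, hW0⟩
    by_cases hC : (fun D ↦ ∀ 𝒟 : Literature.Geometry.Lorentzian.VacuumCauchyDevelopment D, 𝒟.IsMaximal → Summit.FinalStateConjecture.HasCompleteNullInfinity 𝒟.toCauchyDevelopment) d
    · exact t₂ X d hd.1 hd.2 ⟨hD, hT, hC, hW0⟩
    · exact t₁ X d hd.1 hd.2 ⟨hD, hT, hC⟩
  by_cases hW : (∃ 𝒟 : Literature.Geometry.Lorentzian.VacuumCauchyDevelopment d, 𝒟.IsMaximal) ∧ ∀ 𝒟 : Literature.Geometry.Lorentzian.VacuumCauchyDevelopment d, 𝒟.IsMaximal → Summit.FinalStateConjecture.HasCompleteNullInfinity 𝒟.toCauchyDevelopment ∧ ∃ (O : Set 𝒟.carrier) (d : Literature.Geometry.Lorentzian.FinalStateDecomposition 𝒟.toSpacetime O 2), O = Summit.FinalStateConjecture.exteriorOf 𝒟.toCauchyDevelopment d.charted ∧ Summit.FinalStateConjecture.RaysStayInClosure 𝒟.toCauchyDevelopment O ∧ Summit.FinalStateConjecture.HasExhaustiveCharts d ∧ Summit.FinalStateConjecture.IsFutureOriented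 d
  · exact h₃ X d hd.1 hd.2 ⟨hD, hT, hW⟩
  · exact h₄ X d hd.1 hd.2 ⟨hD, hT, hW⟩

end Summit.FinalStateConjecture.FinalStateConjecture.Theses.RootDecompSobolevLedgerCells
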